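import Summits.QuantumFields.YangMills.Theses.ParabolicTrajectory
import Literature.MathematicalPhysics.QuantumFieldTheory.LatticeGaugeProofs
import Literature.Probability.LatticeModels.ProductMeasureTools
import Literature.MathematicalPhysics.QuantumLattice.SchwartzReIm
import Literature.MathematicalPhysics.QuantumLattice.GaugeGroupsProofs
import Summits.QuantumFields.YangMills.Theorems.ContinuumLimitOnTrajectory.Negative.UltralocalNoLimit
import Summits.QuantumFields.YangMills.Theorems.LatticeGapOnTrajectory.Negative.ZeroCoupling

/-!
# Disproof work file — crux `ContinuumLimitOnTrajectory` (stmt-QuantumFields-10522), cdisprove gen 3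

Standing adversary's Lean record for crux (A) of route `ParabolicTrajectory`
(`Summit.QuantumFields.YangMills.Theses.ParabolicTrajectory.ContinuumLimitOnTrajectory`).
Prose lives only in docstrings; every `theorem` is checked (rc 0, **no `sorry`**, no warnings).

## Verdict (cycle 3): RESISTS. No formal kill exists without settling open physics (§1); what a
## kill must exhibit is now sharpened to WITNESS-FREE statements about Wilson lattice expectations
## (§4–§7): non-convergent kernel RATIOS, two equally-tuned sequences with different kernel-shape
## limits, or a surviving anisotropy in a kernel ratio.

## Index of findings

* §0 `Hyp`, `Concl`, `crux_iff` — read-back of the crux as `∀ … , Hyp → Concl`.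
* §1 RESISTANCE: `not_crux_iff`, `not_crux_imp_gappedAFSequence`, `not_crux_imp_tunedAFSequence`,
  `crux_of_no_gappedAFSequence`. Any refutation of (A) must EXHIBIT, for one compact simple `G`,
  a Wilson sequence with `β_k → ∞` that is uniformly gapped on all large tori (an instance of the
  gap clause of crux (B) `LatticeGapOnTrajectory` at WEAK coupling — open) AND tuned,
  `N_1(k) → θ > 0` (an instance of crux (S) `TunedSequenceExists` — open). If no weak-coupling
  gapped sequence exists at all, (A) holds VACUOUSLY. So (A) is false only in a world where the
  IR half of the Clay problem is true on the lattice for some `G` and yet the tuned full-sequence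
  OS limit fails — no mechanism for either is in print.
* §2 THE ULTRALOCAL JUNK MODEL `β ≡ 0` (namespace `Ultralocal`, fully proved; LANDED as
  `Theorems/ContinuumLimitOnTrajectory/Negative/Ultralocal*.lean`, p70428/p70619/p70860/p71691):
  `wilsonMeasure_zero`, torus Haar trick, `latticeConnectedCorr_actionDensity_zero`,
  `tendsto_N_zero`, `hasLatticeMassGap_beta_zero`, `latticeSchwinger_two_eq_mul`,
  `schwinger_two_eq_mul`, `not_isNontrivial_beta_zero`, `ultralocal_counterexample`,
  `ContinuumLimitOnTrajectoryWithoutAF`, `crux_of_withoutAF`, **`not_withoutAF`**,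
  `not_withoutAF_of_SU` and (gen 3) **`not_withoutAF_unconditional`** — the tree's named fact
  `isSimpleCompactGroup_specialUnitaryGroup` IS discharged (`GaugeGroupsProofs`), so the
  load-bearing result for the pair {`β_k → ∞`, `θ > 0`} is UNCONDITIONAL on `G = SU(2)`.
* §4 (gen 3) RIGIDITY OF THE WITNESS — what the species renormalisation can and cannot do:
  `smearedLatticeField_affine` (`Φ_{c,m} = c Φ_{1,0} - const`), `cov_affine`,
  `twoPointKernel` (the unit-normalised connected lattice kernel `K_{a,β,L}(u,v)`, a function of
  the BARE data alone), **`latticeSchwinger_conn_two_eq`** (`⟨ΦΦ⟩-⟨Φ⟩⟨Φ⟩ = c_k² K_k`: the additive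
  counterterm `m_k` is invisible in connected functions, `c_k` enters as `c_k²`),
  `S2T` + **`exists_truncated_ne_zero_of_isNontrivial`** (non-triviality is witnessed by a REAL
  time-separated pair), **`tendsto_c_sq_mul_kernel`** (`c_k² K_k(u,v) → 𝔖₂ᵀ(u⊗v)`),
  `eventually_c_ne_zero_and_kernel_ne_zero`, **`tendsto_kernel_ratio`** (witness-free: kernel
  RATIOS converge), **`truncated_two_unique_up_to_scale`** + `scale_ne_zero` (two witnesses for
  the same bare sequence have PROPORTIONAL truncated two-point functions of `tr F²`: the `∃ T` of
  the crux is secretly unique up to field rescaling on the pinned sector; `c_k` is determined up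
  to `o(1)` and a sign by the bare sequence).
* §5 (gen 3) INTERLEAVING = the universality content of the `∀`-over-sequences quantifier:
  `interleaveFun`, `tendsto_interleaveFun`, `eventually_interleaveFun`, `interleave` (of
  schemes), `reindex`, **`hyp_interleave`** (the hypothesis block is closed under interleaving
  two schemes with the same `(G,r,M,θ,Δ)` and equal towers `(lim N_t)_t`),
  `concl_split_of_interleave`, **`crux_imp_commonWitness`** (the crux forces ONE OS datum serving
  both), **`crux_imp_kernelRatio`** (necessary condition I), **`crux_imp_universalRatio`**
  (necessary condition II: the SHAPE of the curvature two-point kernel is universal across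
  equally-tuned admissible sequences — different torus growths `L_k`, different fine structure
  of `β_k`).
* §6 (gen 3) DECORATIONS: `two_le_of_hyp` (`2 ≤ M` is forced by the shape clause — sibling (B)'s
  `two_le_of_shape`), `abs_latticeConnectedCorr_le`, **`hasLatticeMassGap_of_nonpos`** (for
  `Δ ≤ 0` the gap clause holds along EVERY scheme: `0 < Δ` is exactly what gives (gap) content),
  `hyp_iff_of_nonpos`.
* §7 (gen 3) THE E1 BURDEN, WITNESS-FREE: `isOffDiagonal_linActMulti` (`⁰𝒮` is stable under
  diagonal isometries — small gap in the tree's API, proved here), `rotTest`, `linActMulti_T2`,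
  `S2T_rotTest` (E1 on the pinned sector), `tendsto_kernel_ratio_rotTest`,
  **`crux_imp_isotropicRatio`** (necessary condition III: along every admissible sequence the
  rotated and unrotated kernel ratios have the SAME limit for every proper rotation — the formal
  version of the route's kill criterion "an anisotropic limit refutes it").
* §8 (gen 3) THE TRUNCATED THREE-POINT FUNCTION: `cum3`, `cum3_affine` (affine maps act by `c³`),
  `threePointKernel`, `latticeSchwinger_three`, **`latticeSchwinger_conn_three_eq`** (`c_k³`-scaling,
  `m_k`-invisibility of the truncated lattice 3-point function), `Tn`/`isOffDiagonal_Tn` (pairwise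
  disjointly supported real tensors of any arity are in `⁰𝒮`), `S3T`, **`tendsto_c_cube_mul_kernel3`**,
  **`tendsto_skewness_ratio`** (the normalised lattice skewness `K3_k²/K_k³` converges — squares
  remove the sign ambiguity of `c_k`), **`crux_imp_skewnessRatio`** (necessary condition IV). Also
  in §4: `isNontrivial_of_truncated_ne_zero`, **`isNontrivial_iff_exists_truncated_ne_zero`**
  (`IsNontrivial s` ⟺ some REAL time-separated pair has `𝔖₂ᵀ ≠ 0`).
* §R record of gen-1 findings F1–F7, physics-level remarks, landing log.

## How to kill (A), after cycle 3 (all four are statements about Wilson expectations only)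
For ONE compact simple `G` (e.g. `SU(2)`, instantiable: `isSimpleCompactGroup_specialUnitaryGroup_holds`),
exhibit schemes in the hypothesis block (this needs weak-coupling control = instances of (S) and
(B), the honest obstruction) such that EITHER (I) some kernel ratio `K_k(u,v)/K_k(u₀,v₀)` fails to
converge for every choice of time-separated `(u₀,v₀)` with `K_k(u₀,v₀) ≠ 0` eventually
(`crux_imp_kernelRatio`), OR (II) two equally-tuned such schemes have different ratio limits
(`crux_imp_universalRatio`), OR (III) a rotated ratio has a different limit
(`crux_imp_isotropicRatio`), OR (IV) a normalised skewness `K3_k(f,g,h)²/K_k(u₀,v₀)³` fails to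
converge (`crux_imp_skewnessRatio`) — and, beyond the formalised part, (IV') ALL skewness limits
vanish (a Gaussian = trivial scaling limit of `tr F²`, the `φ⁴₄` scenario; this kills the
`IsNonGaussian` clause). Physics expects none of these for an asymptotically free theory
(universality; O(4) restoration by irrelevance of dimension-6 operators; asymptotic freedom as the
escape from triviality), which is WHY (A) resists; but (I)–(IV) are the precise,
renormalisation-free targets, and each is numerically explorable.
-/

noncomputable section

namespace Summit.QuantumFields.YangMills.Cruxes.ContinuumLimitOnTrajectory.Disproof

open Filter Topology MeasureTheory
open Literature.MathematicalPhysics.QuantumFieldTheory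
open Summit.QuantumFields.YangMills.Theses.ParabolicTrajectory

/-! ## §0 Read-back -/

section ReadBack

variable {G : Type} [Group G] [TopologicalSpace G] [IsTopologicalGroup G] [CompactSpace G]
  [MeasurableSpace G] [BorelSpace G]

/-- The dimensionless curvature two-point function `N_t(k) = a_k⁻⁸ ⟨P ; τ_{t/a_k} P⟩_k` of the crux
(time direction, on the scheme's own torus of side `2 L_k + 1`, `a_k = M^{-n_k}`). [folklore] -/
def N (r : LatticeRep G) (M : ℕ) (sch : SpeciesScheme (YMSpecies G)) (n : ℕ → ℕ) (t k : ℕ) : ℝ :=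
  ((M : ℝ) ^ n k) ^ 8 *
    latticeConnectedCorr r.ρ (sch.β k) (sch.side k) r.curvature.F r.curvature.F (t * M ^ n k)

/-- Unfolding `N`. [folklore] -/
theorem N_eq (r : LatticeRep G) (M : ℕ) (sch : SpeciesScheme (YMSpecies G)) (n : ℕ → ℕ) (t : ℕ) :
    N r M sch n t = fun k => ((M : ℝ) ^ n k) ^ 8 *
      latticeConnectedCorr r.ρ (sch.β k) (sch.side k) r.curvature.F r.curvature.F (t * M ^ n k) :=
  rfl

/-- `N_1` is the tuned quantity of the crux (`1 * M^{n_k} = M^{n_k}`). [folklore] -/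
theorem N_one (r : LatticeRep G) (M : ℕ) (sch : SpeciesScheme (YMSpecies G)) (n : ℕ → ℕ) :
    N r M sch n 1 = fun k => ((M : ℝ) ^ n k) ^ 8 *
      latticeConnectedCorr r.ρ (sch.β k) (sch.side k) r.curvature.F r.curvature.F (M ^ n k) := by
  funext k; simp only [N, one_mul]

/-- **Hypothesis block of the crux** for the data `(r, M, θ, Δ, sch, n)`: M-adic spacings,
asymptotic freedom `β_k → ∞`, convergence of every `N_t`, tuning `N_1 → θ`, uniform lattice gap. [folklore] -/
def Hyp (r : LatticeRep G) (M : ℕ) (θ Δ : ℝ) (sch : SpeciesScheme (YMSpecies G)) (n : ℕ → ℕ) :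
    Prop :=
  (∀ k, sch.a k = ((M : ℝ) ^ n k)⁻¹) ∧ Tendsto sch.β atTop atTop ∧
    (∀ t : ℕ, 0 < t → ∃ c : ℝ, Tendsto (fun k => ((M : ℝ) ^ n k) ^ 8 *
      latticeConnectedCorr r.ρ (sch.β k) (sch.side k) r.curvature.F r.curvature.F (t * M ^ n k))
        atTop (𝓝 c)) ∧
    Tendsto (fun k => ((M : ℝ) ^ n k) ^ 8 *
      latticeConnectedCorr r.ρ (sch.β k) (sch.side k) r.curvature.F r.curvature.F (M ^ n k))
        atTop (𝓝 θ) ∧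
    HasLatticeMassGap r sch Δ

/-- **Conclusion of the crux** for `(r, sch)`: species renormalisations with the same `(a, β, L)`
and OS data that ARE Yang–Mills along them, non-trivial and non-Gaussian in `tr F²`. [folklore] -/
def Concl (r : LatticeRep G) (sch : SpeciesScheme (YMSpecies G)) : Prop :=
  ∃ sch' : SpeciesScheme (YMSpecies G), sch'.a = sch.a ∧ sch'.β = sch.β ∧ sch'.L = sch.L ∧
    ∃ T : OSData (YMSpecies G) 4,
      IsYangMillsFor r sch' T ∧ T.IsNontrivial r.curvature ∧ T.IsNonGaussian r.curvature

end ReadBack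

/-- **Read-back.** The crux is literally `∀ G simple, ∀ r, ∃ M₀, ∀ M ≥ max M₀ 2, ∃ θ₀ > 0,
∀ θ ∈ (0, θ₀), ∀ Δ > 0, ∀ sch n, Hyp → Concl`. [folklore] -/
theorem crux_iff :
    ContinuumLimitOnTrajectory ↔
      ∀ (G : Type) [Group G] [TopologicalSpace G] [IsTopologicalGroup G] [CompactSpace G],
        IsCompactSimpleLieGroup G →
          letI : MeasurableSpace G := borel G
          haveI : BorelSpace G := ⟨rfl⟩
          ∀ r : LatticeRep G, ∃ M₀ : ℕ, ∀ M : ℕ, M₀ ≤ M → 2 ≤ M → ∃ θ₀ : ℝ, 0 < θ₀ ∧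
            ∀ (θ Δ : ℝ) (sch : SpeciesScheme (YMSpecies G)) (n : ℕ → ℕ),
              0 < θ → θ < θ₀ → 0 < Δ → Hyp r M θ Δ sch n → Concl r sch := by
  unfold ContinuumLimitOnTrajectory Hyp Concl
  refine forall_congr' fun G => forall_congr' fun _ => forall_congr' fun _ =>
    forall_congr' fun _ => forall_congr' fun _ => forall_congr' fun _ => forall_congr' fun r =>
    exists_congr fun M₀ => forall_congr' fun M => forall_congr' fun _ => forall_congr' fun _ =>
    exists_congr fun θ₀ => and_congr Iff.rfl <| forall_congr' fun θ => forall_congr' fun Δ =>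
    forall_congr' fun sch => forall_congr' fun n => forall_congr' fun _ => forall_congr' fun _ =>
    forall_congr' fun _ => ⟨fun h H => h H.1 H.2.1 H.2.2.1 H.2.2.2.1 H.2.2.2.2,
      fun h h1 h2 h3 h4 h5 => h ⟨h1, h2, h3, h4, h5⟩⟩

/-! ## §1 Resistance: what ANY refutation must exhibit -/

/-- **Negation, read back.** `¬ (A)` says: for ONE compact simple `G` and one faithful unitary `r`,
for cofinally many block factors `M` and for tuning constants `θ ↓ 0`, there are Wilson schemes
satisfying the whole hypothesis block whose conclusion fails. [folklore] -/
theorem not_crux_iff :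
    ¬ ContinuumLimitOnTrajectory ↔
      ∃ (G : Type) (_ : Group G) (_ : TopologicalSpace G) (_ : IsTopologicalGroup G)
        (_ : CompactSpace G), IsCompactSimpleLieGroup G ∧
          letI : MeasurableSpace G := borel G
          haveI : BorelSpace G := ⟨rfl⟩
          ∃ r : LatticeRep G, ∀ M₀ : ℕ, ∃ M : ℕ, M₀ ≤ M ∧ 2 ≤ M ∧ ∀ θ₀ : ℝ, 0 < θ₀ →
            ∃ (θ Δ : ℝ) (sch : SpeciesScheme (YMSpecies G)) (n : ℕ → ℕ),
              0 < θ ∧ θ < θ₀ ∧ 0 < Δ ∧ Hyp r M θ Δ sch n ∧ ¬ Concl r sch := by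
  rw [crux_iff]
  constructor
  · intro h
    by_contra hne
    apply h
    intro G _ _ _ _ hG r
    by_contra h'
    apply hne
    refine ⟨G, ‹_›, ‹_›, ‹_›, ‹_›, hG, r, ?_⟩
    intro M₀
    by_contra hM
    apply h'
    refine ⟨M₀, fun M hM₀ h2 => ?_⟩
    by_contra hθ
    apply hM
    refine ⟨M, hM₀, h2, fun θ₀ hθ₀ => ?_⟩
    by_contra hh
    apply hθ
    refine ⟨θ₀, hθ₀, fun θ Δ sch n h0 h1 hΔ hH => ?_⟩
    by_contra hc
    exact hh ⟨θ, Δ, sch, n, h0, h1, hΔ, hH, hc⟩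
  · rintro ⟨G, _, _, _, _, hG, r, h⟩ hA
    obtain ⟨M₀, hM₀⟩ := hA G hG r
    obtain ⟨M, hM, h2, hM'⟩ := h M₀
    obtain ⟨θ₀, hθ₀, hθ⟩ := hM₀ M hM h2
    obtain ⟨θ, Δ, sch, n, h0, h1, hΔ, hH, hc⟩ := hM' θ₀ hθ₀
    exact hc (hθ θ Δ sch n h0 h1 hΔ hH)

/-- **A refutation must exhibit a weak-coupling, volume-uniformly gapped Wilson sequence.**
From `¬ (A)`: for some compact simple `G` and faithful unitary `r` there is a scheme with
`β_k → ∞` and `HasLatticeMassGap r sch Δ`, `Δ > 0` — exponential clustering of ALL pairs of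
gauge-invariant local observables at rate `Δ a_k` (lattice units) on every torus at least as large
as the scheme's, at couplings `β_k → ∞`. This is the gap clause of crux (B) `LatticeGapOnTrajectory`
at weak coupling; nothing of the kind is proved for any non-abelian `G` in `d = 4` beyond strong
coupling (Osterwalder–Seiler 1978). [folklore] -/
theorem not_crux_imp_gappedAFSequence (h : ¬ ContinuumLimitOnTrajectory) :
    ∃ (G : Type) (_ : Group G) (_ : TopologicalSpace G) (_ : IsTopologicalGroup G)
      (_ : CompactSpace G), IsCompactSimpleLieGroup G ∧
        letI : MeasurableSpace G := borel G
        haveI : BorelSpace G := ⟨rfl⟩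
        ∃ (r : LatticeRep G) (sch : SpeciesScheme (YMSpecies G)) (Δ : ℝ),
          0 < Δ ∧ Tendsto sch.β atTop atTop ∧ HasLatticeMassGap r sch Δ := by
  obtain ⟨G, _, _, _, _, hG, r, h⟩ := not_crux_iff.1 h
  obtain ⟨M, -, -, hM⟩ := h 0
  obtain ⟨θ, Δ, sch, n, -, -, hΔ, hH, -⟩ := hM 1 one_pos
  exact ⟨G, ‹_›, ‹_›, ‹_›, ‹_›, hG, r, sch, Δ, hΔ, hH.2.1, hH.2.2.2.2⟩

/-- **A refutation must exhibit tuned asymptotically free sequences for arbitrarily small `θ`**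
(instances of crux (S) `TunedSequenceExists` for one `G, r` and cofinally many `M`): `M`-adic
Wilson schemes with `β_k → ∞`, all `N_t(k)` convergent and `N_1(k) → θ` with `0 < θ < θ₀`, for
every `θ₀ > 0` — whose only known route needs a correlator LOWER bound at weak coupling
(quantitative `ξ(β) → ∞`), not in print. [folklore] -/
theorem not_crux_imp_tunedAFSequence (h : ¬ ContinuumLimitOnTrajectory) :
    ∃ (G : Type) (_ : Group G) (_ : TopologicalSpace G) (_ : IsTopologicalGroup G)
      (_ : CompactSpace G), IsCompactSimpleLieGroup G ∧
        letI : MeasurableSpace G := borel G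
        haveI : BorelSpace G := ⟨rfl⟩
        ∃ r : LatticeRep G, ∀ M₀ : ℕ, ∃ M : ℕ, M₀ ≤ M ∧ 2 ≤ M ∧ ∀ θ₀ : ℝ, 0 < θ₀ →
          ∃ (θ : ℝ) (sch : SpeciesScheme (YMSpecies G)) (n : ℕ → ℕ), 0 < θ ∧ θ < θ₀ ∧
            (∀ k, sch.a k = ((M : ℝ) ^ n k)⁻¹) ∧ Tendsto sch.β atTop atTop ∧
            (∀ t : ℕ, 0 < t → ∃ c : ℝ, Tendsto (N r M sch n t) atTop (𝓝 c)) ∧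
            Tendsto (N r M sch n 1) atTop (𝓝 θ) := by
  obtain ⟨G, _, _, _, _, hG, r, h⟩ := not_crux_iff.1 h
  letI : MeasurableSpace G := borel G
  haveI : BorelSpace G := ⟨rfl⟩
  refine ⟨G, ‹_›, ‹_›, ‹_›, ‹_›, hG, r, fun M₀ => ?_⟩
  obtain ⟨M, hM₀, h2, hM⟩ := h M₀
  refine ⟨M, hM₀, h2, fun θ₀ hθ₀ => ?_⟩
  obtain ⟨θ, Δ, sch, n, h0, h1, -, hH, -⟩ := hM θ₀ hθ₀
  refine ⟨θ, sch, n, h0, h1, hH.1, hH.2.1, fun t ht => ?_, ?_⟩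
  · obtain ⟨c, hc⟩ := hH.2.2.1 t ht
    exact ⟨c, (N_eq r M sch n t).symm ▸ hc⟩
  · rw [N_one]; exact hH.2.2.2.1

/-- **Conversely: in a world with no weak-coupling gapped Wilson sequence, (A) holds vacuously.**
If for every compact simple `G`, every `r`, every scheme with `β_k → ∞` and every `Δ > 0` the
uniform lattice gap FAILS (e.g. a massless weak-coupling phase à la Patrascioiu–Seiler), then the
crux is true — for the wrong reason. So (A) can only be false in a world where the lattice mass gap
at weak coupling (the IR half of the Clay problem) is TRUE for some group. [folklore] -/
theorem crux_of_no_gappedAFSequence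
    (h : ∀ (G : Type) [Group G] [TopologicalSpace G] [IsTopologicalGroup G] [CompactSpace G],
      IsCompactSimpleLieGroup G →
        letI : MeasurableSpace G := borel G
        haveI : BorelSpace G := ⟨rfl⟩
        ∀ (r : LatticeRep G) (sch : SpeciesScheme (YMSpecies G)) (Δ : ℝ),
          0 < Δ → Tendsto sch.β atTop atTop → ¬ HasLatticeMassGap r sch Δ) :
    ContinuumLimitOnTrajectory := by
  by_contra hA
  obtain ⟨G, _, _, _, _, hG, r, sch, Δ, hΔ, hβ, hgap⟩ := not_crux_imp_gappedAFSequence hA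
  exact h G hG r sch Δ hΔ hβ hgap

/-! ## §2 The ultralocal junk model `β ≡ 0` -/

namespace Ultralocal

open MeasureTheory Filter Topology
open Literature.MathematicalPhysics.QuantumFieldTheory Literature.MathematicalPhysics.QuantumLattice
open Literature.Probability.LatticeModels (Torus.proj Torus.proj_apply)


section Density

variable {G : Type} [Group G] {N : ℕ} (ρ : G →* Matrix (Fin N) (Fin N) ℂ) (S : ℕ)

/-- The Wilson action density at the torus site `x`: `∑_{i<j} Re tr ρ(U_{(x,i,j)})`. -/
def torusDensity (x : Site 4 S) (U : GaugeConfig 4 S G) : ℝ :=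
  ∑ p : Fin 4 × Fin 4, if p.1 < p.2 then (ρ (plaquetteHolonomy U x p.1 p.2)).trace.re else 0

theorem proj_add (v w : Literature.Probability.LatticeModels.Site 4) :
    Torus.proj S (v + w) = Torus.proj S v + Torus.proj S w := by
  funext i; simp

theorem proj_single (i : Fin 4) (z : ℤ) :
    Torus.proj S (Pi.single i z) = Pi.single i (z : ZMod S) := by
  funext k; by_cases h : k = i
  · subst h; simp
  · simp [h]

theorem proj_zero : Torus.proj S (0 : Literature.Probability.LatticeModels.Site 4) = 0 := by
  funext k; simp

/-- Plaquette holonomy of the periodic lift, shifted by `v`, at the origin = torus holonomy at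
`proj v`. -/
theorem plaquetteHolonomyZd_shift_torusLift [MeasurableSpace G]
    (v : Literature.Probability.LatticeModels.Site 4) (U : GaugeConfig 4 S G) (i j : Fin 4) :
    plaquetteHolonomyZd (configShift (-v) (torusLift S U)) 0 i j =
      plaquetteHolonomy U (Torus.proj S v) i j := by
  simp only [plaquetteHolonomyZd, configShift_apply, torusLift, Function.comp_apply, torusEdge,
    plaquetteHolonomy, Site.shift, sub_neg_eq_add, zero_add, proj_add, proj_single, Int.cast_one,
    add_comm (Torus.proj S v)]

theorem actionDensity_shift_torusLift [MeasurableSpace G]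
    (v : Literature.Probability.LatticeModels.Site 4) (U : GaugeConfig 4 S G) :
    actionDensity ρ (configShift (-v) (torusLift S U)) = torusDensity ρ S (Torus.proj S v) U := by
  simp only [actionDensity, torusDensity, plaquetteObs, plaquetteHolonomyZd_shift_torusLift,
    Fintype.sum_prod_type]

theorem actionDensity_torusLift [MeasurableSpace G] (U : GaugeConfig 4 S G) :
    actionDensity ρ (torusLift S U) = torusDensity ρ S 0 U := by
  have h := actionDensity_shift_torusLift ρ S 0 U
  rw [proj_zero] at h
  rw [← h]
  congr 1
  funext e
  simp [configShift_apply]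

end Density

section Combinatorics

variable {G : Type} [Group G] (S : ℕ)

theorem shift_ne_self (hS : (1 : ZMod S) ≠ 0) (x : Site 4 S) (k : Fin 4) : x.shift k ≠ x := by
  intro h
  have := congrFun h k
  simp [Site.shift, hS] at this

theorem shift_ne_shift (hS : (1 : ZMod S) ≠ 0) (x : Site 4 S) {i j : Fin 4} (hij : i ≠ j) :
    x.shift i ≠ x.shift j := by
  intro h
  have := congrFun h i
  simp [Site.shift, hS, hij] at this

/-- Updating a link not on the plaquette does not change its holonomy. -/
theorem plaquetteHolonomy_update_of_ne (x : Site 4 S) (i j : Fin 4) (U : GaugeConfig 4 S G)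
    {e : Edge 4 S} (h1 : e ≠ (x, i)) (h2 : e ≠ (x.shift i, j)) (h3 : e ≠ (x.shift j, i))
    (h4 : e ≠ (x, j)) (g : G) :
    plaquetteHolonomy (Function.update U e g) x i j = plaquetteHolonomy U x i j := by
  simp only [plaquetteHolonomy, Function.update_of_ne h1.symm, Function.update_of_ne h2.symm,
    Function.update_of_ne h3.symm, Function.update_of_ne h4.symm]

/-- The torus plaquette holonomy after updating one of its four bonds (`S ≠ 1`, `i ≠ j`). -/
theorem plaquette_update (hS : (1 : ZMod S) ≠ 0) (x : Site 4 S) {i j : Fin 4} (hij : i ≠ j)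
    (U : GaugeConfig 4 S G) (g : G) :
    plaquetteHolonomy (Function.update U (x, i) g) x i j =
        g * U (x.shift i, j) * (U (x.shift j, i))⁻¹ * (U (x, j))⁻¹ ∧
    plaquetteHolonomy (Function.update U (x.shift i, j) g) x i j =
        U (x, i) * g * (U (x.shift j, i))⁻¹ * (U (x, j))⁻¹ ∧
    plaquetteHolonomy (Function.update U (x.shift j, i) g) x i j =
        U (x, i) * U (x.shift i, j) * g⁻¹ * (U (x, j))⁻¹ ∧
    plaquetteHolonomy (Function.update U (x, j) g) x i j =
        U (x, i) * U (x.shift i, j) * (U (x.shift j, i))⁻¹ * g⁻¹ := by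
  have hx : ∀ k : Fin 4, x.shift k ≠ x := shift_ne_self S hS x
  have h12 : ((x, i) : Edge 4 S) ≠ (x.shift i, j) := fun h => hx i (Prod.ext_iff.1 h).1.symm
  have h13 : ((x, i) : Edge 4 S) ≠ (x.shift j, i) := fun h => hx j (Prod.ext_iff.1 h).1.symm
  have h14 : ((x, i) : Edge 4 S) ≠ (x, j) := fun h => hij (Prod.ext_iff.1 h).2
  have h23 : ((x.shift i, j) : Edge 4 S) ≠ (x.shift j, i) :=
    fun h => hij ((Prod.ext_iff.1 h).2).symm
  have h24 : ((x.shift i, j) : Edge 4 S) ≠ (x, j) := fun h => hx i (Prod.ext_iff.1 h).1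
  have h34 : ((x.shift j, i) : Edge 4 S) ≠ (x, j) := fun h => hx j (Prod.ext_iff.1 h).1
  simp only [plaquetteHolonomy, Function.update_self, Function.update_of_ne h12.symm,
    Function.update_of_ne h13.symm, Function.update_of_ne h14.symm, Function.update_of_ne h12,
    Function.update_of_ne h23.symm, Function.update_of_ne h24.symm, Function.update_of_ne h13,
    Function.update_of_ne h23, Function.update_of_ne h34.symm, Function.update_of_ne h14,
    Function.update_of_ne h24, Function.update_of_ne h34, and_self]

/-- A private bond: for base points `x ≠ y` every plaquette at `y` has a bond not on a given
plaquette at `x`. -/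
theorem exists_private_edge (hS : (1 : ZMod S) ≠ 0) {x y : Site 4 S} (hxy : x ≠ y)
    {i j k l : Fin 4} (hij : i ≠ j) (hkl : k ≠ l) :
    ∃ e : Edge 4 S, (e = (y, k) ∨ e = (y.shift k, l) ∨ e = (y.shift l, k) ∨ e = (y, l)) ∧
      e ≠ (x, i) ∧ e ≠ (x.shift i, j) ∧ e ≠ (x.shift j, i) ∧ e ≠ (x, j) := by
  have hne2 : ∀ {a b : Site 4 S} {m m' : Fin 4}, m ≠ m' → ((a, m) : Edge 4 S) ≠ (b, m') :=
    fun h h' => h (Prod.ext_iff.1 h').2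
  have hne1 : ∀ {a b : Site 4 S} {m m' : Fin 4}, a ≠ b → ((a, m) : Edge 4 S) ≠ (b, m') :=
    fun h h' => h (Prod.ext_iff.1 h').1
  by_cases hk : k ≠ i ∧ k ≠ j
  · exact ⟨(y, k), Or.inl rfl, hne2 hk.1, hne2 hk.2, hne2 hk.1, hne2 hk.2⟩
  by_cases hl : l ≠ i ∧ l ≠ j
  · exact ⟨(y, l), Or.inr (Or.inr (Or.inr rfl)), hne2 hl.1, hne2 hl.2, hne2 hl.1, hne2 hl.2⟩
  -- now `k, l ∈ {i, j}`; one of them is `i`, one of them is `j`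
  have hk' : k = i ∨ k = j := by tauto
  have hl' : l = i ∨ l = j := by tauto
  by_cases hy : y = x.shift j
  · -- use the bond of `q` based at `y` in direction `j`
    have key : ∀ e : Edge 4 S, e = (y, j) →
        e ≠ (x, i) ∧ e ≠ (x.shift i, j) ∧ e ≠ (x.shift j, i) ∧ e ≠ (x, j) := by
      rintro e rfl
      refine ⟨hne2 hij.symm, hne1 ?_, hne2 hij.symm, hne1 ?_⟩
      · rw [hy]; exact (shift_ne_shift S hS x hij).symm
      · rw [hy]; exact shift_ne_self S hS x j
    rcases hk' with rfl | rfl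
    · rcases hl' with rfl | rfl
      · exact absurd rfl hkl
      · exact ⟨(y, l), Or.inr (Or.inr (Or.inr rfl)), key _ rfl⟩
    · exact ⟨(y, k), Or.inl rfl, key _ rfl⟩
  · -- use the bond of `q` based at `y` in direction `i`
    have key : ∀ e : Edge 4 S, e = (y, i) →
        e ≠ (x, i) ∧ e ≠ (x.shift i, j) ∧ e ≠ (x.shift j, i) ∧ e ≠ (x, j) := by
      rintro e rfl
      exact ⟨hne1 (Ne.symm hxy), hne2 hij, hne1 hy, hne2 hij⟩
    rcases hk' with rfl | rfl
    · exact ⟨(y, k), Or.inl rfl, key _ rfl⟩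
    · rcases hl' with rfl | rfl
      · exact ⟨(y, l), Or.inr (Or.inr (Or.inr rfl)), key _ rfl⟩
      · exact absurd rfl hkl

end Combinatorics

section Haar

variable {G : Type} [Group G] [TopologicalSpace G] [IsTopologicalGroup G] [CompactSpace G]
  [MeasurableSpace G] [BorelSpace G] (S : ℕ) [NeZero S]

/-- Product Haar measure on torus gauge configurations. -/
abbrev piHaar : Measure (GaugeConfig 4 S G) := Measure.pi fun _ : Edge 4 S => haarProbability G

omit [NeZero S] in
/-- **Haar invariance over one bond** (torus version of `integral_update_plaquette`). -/
theorem integral_update_plaquette {E : Type*} [NormedAddCommGroup E] [NormedSpace ℝ E]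
    (hS : (1 : ZMod S) ≠ 0) {Φ : G → E} (hΦ : Continuous Φ) (x : Site 4 S) {i j : Fin 4}
    (hij : i ≠ j) (U : GaugeConfig 4 S G) {e : Edge 4 S}
    (he : e = (x, i) ∨ e = (x.shift i, j) ∨ e = (x.shift j, i) ∨ e = (x, j)) :
    Integrable (fun g => Φ (plaquetteHolonomy (Function.update U e g) x i j)) (haarProbability G) ∧
      ∫ g, Φ (plaquetteHolonomy (Function.update U e g) x i j) ∂haarProbability G =
        ∫ g, Φ g ∂haarProbability G := by
  have hint : ∀ {ψ : G → E}, Continuous ψ → Integrable ψ (haarProbability G) := fun hψ =>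
    hψ.integrable_of_hasCompactSupport (HasCompactSupport.of_compactSpace _)
  rcases he with rfl | rfl | rfl | rfl
  · have hupd : ∀ g, plaquetteHolonomy (Function.update U (x, i) g) x i j =
        1 * g * (U (x.shift i, j) * (U (x.shift j, i))⁻¹ * (U (x, j))⁻¹) :=
      fun g => by rw [(plaquette_update S hS x hij U g).1]; simp [mul_assoc]
    simp_rw [hupd]
    exact ⟨hint (hΦ.comp ((continuous_const.mul continuous_id).mul continuous_const)),
      integral_haar_conj_eq Φ _ _⟩
  · have hupd : ∀ g, plaquetteHolonomy (Function.update U (x.shift i, j) g) x i j =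
        U (x, i) * g * ((U (x.shift j, i))⁻¹ * (U (x, j))⁻¹) :=
      fun g => by rw [(plaquette_update S hS x hij U g).2.1]; simp [mul_assoc]
    simp_rw [hupd]
    exact ⟨hint (hΦ.comp ((continuous_const.mul continuous_id).mul continuous_const)),
      integral_haar_conj_eq Φ _ _⟩
  · have hupd : ∀ g, plaquetteHolonomy (Function.update U (x.shift j, i) g) x i j =
        U (x, i) * U (x.shift i, j) * g⁻¹ * (U (x, j))⁻¹ :=
      fun g => (plaquette_update S hS x hij U g).2.2.1
    simp_rw [hupd]
    exact ⟨hint (hΦ.comp ((continuous_const.mul continuous_inv).mul continuous_const)),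
      integral_haar_conj_inv_eq Φ _ _⟩
  · have hupd : ∀ g, plaquetteHolonomy (Function.update U (x, j) g) x i j =
        U (x, i) * U (x.shift i, j) * (U (x.shift j, i))⁻¹ * g⁻¹ * 1 :=
      fun g => by rw [(plaquette_update S hS x hij U g).2.2.2, mul_one]
    simp_rw [hupd]
    exact ⟨hint (hΦ.comp ((continuous_const.mul continuous_inv).mul continuous_const)),
      integral_haar_conj_inv_eq Φ _ _⟩

/-- Resampling one coordinate of a finite product of probability measures. -/
theorem integral_pi_eq_integral_update {ι : Type*} [Fintype ι] [DecidableEq ι] {X : ι → Type*}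
    [∀ i, MeasurableSpace (X i)] (μ : (i : ι) → Measure (X i)) [∀ i, IsProbabilityMeasure (μ i)]
    (i₀ : ι) {F : (Π i, X i) → ℝ} (hF : Integrable F (Measure.pi μ)) :
    ∫ x, F x ∂Measure.pi μ = ∫ x, ∫ y, F (Function.update x i₀ y) ∂μ i₀ ∂Measure.pi μ := by
  rw [← Measure.infinitePi_eq_pi] at hF ⊢
  exact Literature.Probability.LatticeModels.integral_infinitePi_eq_integral_update μ i₀ hF

variable [SecondCountableTopology G]

omit [CompactSpace G] [MeasurableSpace G] [BorelSpace G] [SecondCountableTopology G] [NeZero S] in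
theorem continuous_plaquetteHolonomy (x : Site 4 S) (i j : Fin 4) :
    Continuous fun U : GaugeConfig 4 S G => plaquetteHolonomy U x i j := by
  unfold plaquetteHolonomy; fun_prop

theorem integrable_of_continuous {F : GaugeConfig 4 S G → ℝ} (hF : Continuous F) :
    Integrable F (piHaar S (G := G)) :=
  hF.integrable_of_hasCompactSupport (HasCompactSupport.of_compactSpace _)

/-- **The plaquette variable is Haar distributed** under the product Haar measure on the torus. -/
theorem integral_comp_plaquette (hS : (1 : ZMod S) ≠ 0) {Φ : G → ℝ} (hΦ : Continuous Φ)
    (x : Site 4 S) {i j : Fin 4} (hij : i ≠ j) :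
    ∫ U, Φ (plaquetteHolonomy U x i j) ∂piHaar S = ∫ g, Φ g ∂haarProbability G := by
  classical
  have hint : Integrable (fun U : GaugeConfig 4 S G => Φ (plaquetteHolonomy U x i j)) (piHaar S) :=
    integrable_of_continuous S (hΦ.comp (continuous_plaquetteHolonomy S x i j))
  rw [piHaar, integral_pi_eq_integral_update (fun _ : Edge 4 S => haarProbability G) ((x, i) : Edge 4 S) hint]
  have hupd : ∀ U : GaugeConfig 4 S G,
      ∫ g, Φ (plaquetteHolonomy (Function.update U (x, i) g) x i j) ∂haarProbability G =
        ∫ g, Φ g ∂haarProbability G := fun U =>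
    (integral_update_plaquette S hS hΦ x hij U (e := (x, i)) (Or.inl rfl)).2
  simp_rw [hupd]
  rw [integral_const, probReal_univ, one_smul]

/-- **Distinct base points carry uncorrelated plaquette variables** under product Haar. -/
theorem integral_plaquette_mul_plaquette (hS : (1 : ZMod S) ≠ 0) {Φ Ψ : G → ℝ}
    (hΦ : Continuous Φ) (hΨ : Continuous Ψ) {x y : Site 4 S} (hxy : x ≠ y) {i j k l : Fin 4}
    (hij : i ≠ j) (hkl : k ≠ l) :
    ∫ U, Φ (plaquetteHolonomy U x i j) * Ψ (plaquetteHolonomy U y k l) ∂piHaar S =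
      (∫ g, Φ g ∂haarProbability G) * ∫ g, Ψ g ∂haarProbability G := by
  classical
  obtain ⟨e, he, h1, h2, h3, h4⟩ := exists_private_edge S hS hxy hij hkl
  have hint : Integrable (fun U : GaugeConfig 4 S G =>
      Φ (plaquetteHolonomy U x i j) * Ψ (plaquetteHolonomy U y k l)) (piHaar S) :=
    integrable_of_continuous S ((hΦ.comp (continuous_plaquetteHolonomy S x i j)).mul
      (hΨ.comp (continuous_plaquetteHolonomy S y k l)))
  rw [piHaar, integral_pi_eq_integral_update (fun _ : Edge 4 S => haarProbability G) e hint]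
  have hupd : ∀ U : GaugeConfig 4 S G,
      ∫ g, Φ (plaquetteHolonomy (Function.update U e g) x i j) *
          Ψ (plaquetteHolonomy (Function.update U e g) y k l) ∂haarProbability G =
        Φ (plaquetteHolonomy U x i j) * ∫ g, Ψ g ∂haarProbability G := fun U => by
    simp_rw [plaquetteHolonomy_update_of_ne S x i j U h1 h2 h3 h4]
    rw [integral_const_mul, (integral_update_plaquette S hS hΨ y hkl U he).2]
  simp_rw [hupd]
  rw [integral_mul_const, ← piHaar, integral_comp_plaquette S hS hΦ x hij]

end Haar

section Correlator

variable {G : Type} [Group G] [TopologicalSpace G] [IsTopologicalGroup G] [CompactSpace G]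
  [MeasurableSpace G] [BorelSpace G] [SecondCountableTopology G]
  {N : ℕ} (ρ : G →* Matrix (Fin N) (Fin N) ℂ) (S : ℕ) [NeZero S]

/-- The Haar mean of the character, `m_ρ = ∫_G Re tr ρ(g) dg`. -/
def charMean : ℝ := ∫ g, (ρ g).trace.re ∂haarProbability G

/-- One (possibly switched-off) plaquette term of the density. -/
def plaqTerm (x : Site 4 S) (p : Fin 4 × Fin 4) (U : GaugeConfig 4 S G) : ℝ :=
  if p.1 < p.2 then (ρ (plaquetteHolonomy U x p.1 p.2)).trace.re else 0

omit [NeZero S] [CompactSpace G] [MeasurableSpace G] [BorelSpace G] [SecondCountableTopology G] in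
theorem continuous_plaqTerm (hρ : Continuous ρ) (x : Site 4 S) (p : Fin 4 × Fin 4) :
    Continuous (plaqTerm ρ S x p) := by
  unfold plaqTerm
  by_cases h : p.1 < p.2
  · simp only [h, ↓reduceIte]
    exact (continuous_trace_re ρ hρ).comp (continuous_plaquetteHolonomy S x p.1 p.2)
  · simp only [h, ↓reduceIte]; exact continuous_const

omit [NeZero S] [TopologicalSpace G] [IsTopologicalGroup G] [CompactSpace G] [MeasurableSpace G]
  [BorelSpace G] [SecondCountableTopology G] in
theorem torusDensity_eq_sum (x : Site 4 S) (U : GaugeConfig 4 S G) :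
    torusDensity ρ S x U = ∑ p : Fin 4 × Fin 4, plaqTerm ρ S x p U := rfl

/-- Mean of one plaquette term. -/
theorem integral_plaqTerm (hS : (1 : ZMod S) ≠ 0) (hρ : Continuous ρ) (x : Site 4 S)
    (p : Fin 4 × Fin 4) :
    ∫ U, plaqTerm ρ S x p U ∂piHaar S = if p.1 < p.2 then charMean ρ else 0 := by
  unfold plaqTerm
  by_cases h : p.1 < p.2
  · simp only [h, ↓reduceIte]
    exact integral_comp_plaquette S hS (continuous_trace_re ρ hρ) x (ne_of_lt h)
  · simp [h]

/-- Mean of a product of plaquette terms at distinct base points factorises. -/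
theorem integral_plaqTerm_mul (hS : (1 : ZMod S) ≠ 0) (hρ : Continuous ρ) {x y : Site 4 S}
    (hxy : x ≠ y) (p q : Fin 4 × Fin 4) :
    ∫ U, plaqTerm ρ S x p U * plaqTerm ρ S y q U ∂piHaar S =
      (if p.1 < p.2 then charMean ρ else 0) * (if q.1 < q.2 then charMean ρ else 0) := by
  unfold plaqTerm
  by_cases hp : p.1 < p.2
  · by_cases hq : q.1 < q.2
    · simp only [hp, hq, ↓reduceIte]
      exact integral_plaquette_mul_plaquette S hS (continuous_trace_re ρ hρ)
        (continuous_trace_re ρ hρ) hxy (ne_of_lt hp) (ne_of_lt hq)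
    · simp [hp, hq]
  · simp [hp]

/-- **Mean of the density**: `∫ D_x = ∑_{i<j} m_ρ` (independent of `x`). -/
theorem integral_torusDensity (hS : (1 : ZMod S) ≠ 0) (hρ : Continuous ρ) (x : Site 4 S) :
    ∫ U, torusDensity ρ S x U ∂piHaar S =
      ∑ p : Fin 4 × Fin 4, if p.1 < p.2 then charMean ρ else 0 := by
  simp only [torusDensity_eq_sum]
  rw [integral_finsetSum _ fun p _ => integrable_of_continuous S (continuous_plaqTerm ρ S hρ x p)]
  exact Finset.sum_congr rfl fun p _ => integral_plaqTerm ρ S hS hρ x p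

/-- **Densities at distinct torus sites are uncorrelated** under product Haar (`β = 0`). -/
theorem integral_torusDensity_mul (hS : (1 : ZMod S) ≠ 0) (hρ : Continuous ρ) {x y : Site 4 S}
    (hxy : x ≠ y) :
    ∫ U, torusDensity ρ S x U * torusDensity ρ S y U ∂piHaar S =
      (∫ U, torusDensity ρ S x U ∂piHaar S) * ∫ U, torusDensity ρ S y U ∂piHaar S := by
  rw [integral_torusDensity ρ S hS hρ x, integral_torusDensity ρ S hS hρ y, Finset.sum_mul_sum]
  simp only [torusDensity_eq_sum, Finset.sum_mul_sum]
  rw [integral_finsetSum _ fun p _ => ?_]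
  · refine Finset.sum_congr rfl fun p _ => ?_
    rw [integral_finsetSum _ fun q _ => ?_]
    · exact Finset.sum_congr rfl fun q _ => integral_plaqTerm_mul ρ S hS hρ hxy p q
    · exact integrable_of_continuous S
        ((continuous_plaqTerm ρ S hρ x p).mul (continuous_plaqTerm ρ S hρ y q))
  · exact integrable_finsetSum _ fun q _ => integrable_of_continuous S
      ((continuous_plaqTerm ρ S hρ x p).mul (continuous_plaqTerm ρ S hρ y q))

end Correlator

section BetaZero

variable {G : Type} [Group G] [TopologicalSpace G] [IsTopologicalGroup G] [CompactSpace G]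
  [MeasurableSpace G] [BorelSpace G]
  {N : ℕ} (ρ : G →* Matrix (Fin N) (Fin N) ℂ) (S : ℕ) [NeZero S]

/-- At `β = 0` the Wilson weight is the product Haar measure. -/
theorem wilsonWeight_zero :
    wilsonWeight (d := 4) (L := S) ρ 0 = Measure.pi fun _ : Edge 4 S => haarProbability G := by
  unfold wilsonWeight
  have : (fun U : GaugeConfig 4 S G => ENNReal.ofReal (Real.exp (-0 * wilsonAction ρ U))) = 1 := by
    funext U; simp
  rw [this, withDensity_one]

/-- **At `β = 0` the torus Wilson measure is the product Haar measure** (independent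
Haar-distributed links: the ultralocal theory). -/
theorem wilsonMeasure_zero :
    wilsonMeasure (d := 4) (L := S) ρ 0 = piHaar S (G := G) := by
  rw [wilsonMeasure, partitionFunction, wilsonWeight_zero]
  simp [piHaar]

variable [SecondCountableTopology G]

/-- **The curvature time-correlation vanishes identically at `β = 0`** for every separation
`n ≢ 0 (mod S)` on a torus of side `S ≥ 2`: `⟨P ; τ_n P⟩_{β=0,S} = 0`. (Distinct plaquettes are
uncorrelated under product Haar, even when they share a bond.) -/
theorem latticeConnectedCorr_actionDensity_zero (hS : (1 : ZMod S) ≠ 0) (hρ : Continuous ρ)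
    {n : ℕ} (hn : ((n : ℕ) : ZMod S) ≠ 0) :
    latticeConnectedCorr ρ 0 S (actionDensity ρ) (actionDensity ρ) n = 0 := by
  unfold latticeConnectedCorr
  rw [wilsonMeasure_zero]
  simp only [actionDensity_shift_torusLift, actionDensity_torusLift]
  have hx : (0 : Site 4 S) ≠ Torus.proj S (Pi.single 0 (n : ℤ)) := by
    rw [proj_single, Int.cast_natCast]
    intro h
    have := congrFun h 0
    simp only [Pi.zero_apply, Pi.single_eq_same] at this
    exact hn this.symm
  rw [integral_torusDensity_mul ρ S hS hρ hx, integral_torusDensity ρ S hS hρ,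
    integral_torusDensity ρ S hS hρ, sub_self]

end BetaZero

section Scheme

variable {ι : Type}

/-- Along a scheme with `a_k ≤ 1`, the torus half-side eventually exceeds any bound. -/
theorem eventually_le_L (sch : SpeciesScheme ι) (ha : ∀ k, sch.a k ≤ 1) (C : ℝ) :
    ∀ᶠ k in atTop, C ≤ sch.L k := by
  filter_upwards [sch.tendsto_L.eventually_ge_atTop C] with k hk
  exact hk.trans (mul_le_of_le_one_left (Nat.cast_nonneg _) (ha k))

/-- `M`-adic spacings are at most `1` (for `M ≥ 1`). -/
theorem a_le_one {M : ℕ} (hM : 1 ≤ M) {sch : SpeciesScheme ι} {n : ℕ → ℕ}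
    (ha : ∀ k, sch.a k = ((M : ℝ) ^ n k)⁻¹) (k : ℕ) : sch.a k ≤ 1 := by
  rw [ha k]
  exact inv_le_one_of_one_le₀ (one_le_pow₀ (by exact_mod_cast hM))

/-- Along an `M`-adic scheme, `t · M^{n_k} ≤ L_k` eventually (from `a_k L_k → ∞`). -/
theorem eventually_mul_le_L {M : ℕ} (hM : 1 ≤ M) (sch : SpeciesScheme ι) (n : ℕ → ℕ)
    (ha : ∀ k, sch.a k = ((M : ℝ) ^ n k)⁻¹) (t : ℕ) :
    ∀ᶠ k in atTop, t * M ^ n k ≤ sch.L k := by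
  filter_upwards [sch.tendsto_L.eventually_ge_atTop (t : ℝ)] with k hk
  have hpos : (0 : ℝ) < (M : ℝ) ^ n k := pow_pos (by exact_mod_cast hM) _
  rw [ha k] at hk
  have : (t : ℝ) * (M : ℝ) ^ n k ≤ sch.L k := by
    calc (t : ℝ) * (M : ℝ) ^ n k ≤ ((M : ℝ) ^ n k)⁻¹ * sch.L k * (M : ℝ) ^ n k :=
          mul_le_mul_of_nonneg_right hk hpos.le
      _ = sch.L k := by field_simp
  exact_mod_cast this

theorem natCast_zmod_ne_zero {s m : ℕ} (h0 : 0 < m) (hlt : m < s) : ((m : ℕ) : ZMod s) ≠ 0 := by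
  rw [Ne, ZMod.natCast_eq_zero_iff]
  exact fun h => absurd (Nat.le_of_dvd h0 h) (not_le.2 hlt)

theorem one_ne_zero_zmod {s : ℕ} (hs : 1 < s) : (1 : ZMod s) ≠ 0 := by
  haveI : Fact (1 < s) := ⟨hs⟩
  exact one_ne_zero

variable {G : Type} [Group G] [TopologicalSpace G] [IsTopologicalGroup G] [CompactSpace G]
  [MeasurableSpace G] [BorelSpace G]

theorem curvature_F (r : LatticeRep G) : r.curvature.F = actionDensity r.ρ := rfl

/-- **Along every scheme at `β ≡ 0`, every dimensionless curvature correlator `N_t(k)` is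
EVENTUALLY EXACTLY `0`** (`t ≥ 1`, `M ≥ 1`): the separation `t M^{n_k}` is eventually a proper,
nonzero residue of the torus side `2 L_k + 1 ≥ 3`. -/
theorem eventually_corr_eq_zero (r : LatticeRep G) {M : ℕ} (hM : 1 ≤ M)
    (sch : SpeciesScheme (YMSpecies G)) (n : ℕ → ℕ) (ha : ∀ k, sch.a k = ((M : ℝ) ^ n k)⁻¹)
    (hβ : ∀ k, sch.β k = 0) {t : ℕ} (ht : 0 < t) :
    ∀ᶠ k in atTop, latticeConnectedCorr r.ρ (sch.β k) (sch.side k) r.curvature.F r.curvature.F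
      (t * M ^ n k) = 0 := by
  haveI : SecondCountableTopology G :=
    (r.continuous.isClosedEmbedding r.injective).isEmbedding.secondCountableTopology
  filter_upwards [eventually_mul_le_L hM sch n ha t,
    eventually_le_L sch (a_le_one hM ha) 1] with k h1 h2
  have hL : 1 ≤ sch.L k := by exact_mod_cast h2
  rw [hβ k, curvature_F]
  refine latticeConnectedCorr_actionDensity_zero r.ρ (sch.side k) (one_ne_zero_zmod ?_)
    r.continuous (natCast_zmod_ne_zero (Nat.mul_pos ht (Nat.pow_pos hM)) ?_)
  · simp only [SpeciesScheme.side]; omega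
  · simp only [SpeciesScheme.side]; omega

/-- **At `β ≡ 0` every `N_t(k) → 0`** (`t ≥ 1`): the tuning clause of the crux holds with
`θ = 0`, and the convergence clause holds for every `t`. -/
theorem tendsto_N_zero (r : LatticeRep G) {M : ℕ} (hM : 1 ≤ M)
    (sch : SpeciesScheme (YMSpecies G)) (n : ℕ → ℕ) (ha : ∀ k, sch.a k = ((M : ℝ) ^ n k)⁻¹)
    (hβ : ∀ k, sch.β k = 0) {t : ℕ} (ht : 0 < t) :
    Tendsto (fun k => ((M : ℝ) ^ n k) ^ 8 *
      latticeConnectedCorr r.ρ (sch.β k) (sch.side k) r.curvature.F r.curvature.F (t * M ^ n k))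
      atTop (𝓝 0) := by
  refine tendsto_const_nhds.congr' ?_
  filter_upwards [eventually_corr_eq_zero r hM sch n ha hβ ht] with k hk
  rw [hk, mul_zero]

end Scheme

section Gap

variable {G : Type} [Group G] [TopologicalSpace G] [IsTopologicalGroup G] [CompactSpace G]
  [MeasurableSpace G] [BorelSpace G]

omit [TopologicalSpace G] [IsTopologicalGroup G] [CompactSpace G] [BorelSpace G] [Group G]
  [MeasurableSpace G] in
/-- A cylinder function of the lifted configuration depends on the projected support. -/
theorem dependsOn_comp_torusLift {A : LGConfig 4 G → ℝ} {T : Finset (Literature.MathematicalPhysics.QuantumLattice.ZdEdge 4)}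
    (hA : DependsOn A (T : Set (Literature.MathematicalPhysics.QuantumLattice.ZdEdge 4))) (S : ℕ) :
    DependsOn (fun U : GaugeConfig 4 S G => A (torusLift S U))
      ((T.image (torusEdge S) : Finset (Edge 4 S)) : Set (Edge 4 S)) := by
  intro U V h
  apply hA
  intro e he
  simp only [torusLift, Function.comp_apply]
  exact h _ (Finset.mem_coe.2 (Finset.mem_image_of_mem _ (Finset.mem_coe.1 he)))

omit [TopologicalSpace G] [IsTopologicalGroup G] [CompactSpace G] [BorelSpace G] [Group G] in
/-- A shifted cylinder function of the lifted configuration depends on the shifted projected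
support. -/
theorem dependsOn_shift_comp_torusLift {B : LGConfig 4 G → ℝ} {T : Finset (Literature.MathematicalPhysics.QuantumLattice.ZdEdge 4)}
    (hB : DependsOn B (T : Set (Literature.MathematicalPhysics.QuantumLattice.ZdEdge 4))) (v : Literature.Probability.LatticeModels.Site 4)
    (S : ℕ) :
    DependsOn (fun U : GaugeConfig 4 S G => B (configShift (-v) (torusLift S U)))
      ((T.image fun e => torusEdge S (e.1 + v, e.2) : Finset (Edge 4 S)) : Set (Edge 4 S)) := by
  intro U V h
  apply hB
  intro e he
  simp only [configShift_apply, torusLift, Function.comp_apply, sub_neg_eq_add]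
  exact h _ (Finset.mem_coe.2 (Finset.mem_image_of_mem
    (fun e : Literature.MathematicalPhysics.QuantumLattice.ZdEdge 4 => torusEdge S (e.1 + v, e.2))
    (Finset.mem_coe.1 he)))

/-- **Time-separated supports project disjointly onto a large torus.** If all bonds of `TA`,
`TB` have time coordinate in `[-R, R]`, then for `2R + 1 ≤ n ≤ S'` and `2R ≤ S'` the
projections of `TA` and of `TB + n e₀` onto the torus of side `2S'+1` are disjoint. -/
theorem disjoint_image_torusEdge {TA TB : Finset (Literature.MathematicalPhysics.QuantumLattice.ZdEdge 4)} {R : ℕ}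
    (hA : ∀ e ∈ TA, |e.1 0| ≤ (R : ℤ)) (hB : ∀ e ∈ TB, |e.1 0| ≤ (R : ℤ)) {S' n : ℕ}
    (hn1 : 2 * R + 1 ≤ n) (hn2 : n ≤ S') :
    Disjoint (TA.image (torusEdge (2 * S' + 1)))
      (TB.image fun e => torusEdge (2 * S' + 1) (e.1 + Pi.single 0 (n : ℤ), e.2)) := by
  rw [Finset.disjoint_left]
  rintro _ ha hb
  obtain ⟨a, haT, rfl⟩ := Finset.mem_image.1 ha
  obtain ⟨b, hbT, hab⟩ := Finset.mem_image.1 hb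
  have h0 : (Torus.proj (2 * S' + 1) (b.1 + Pi.single 0 (n : ℤ))) 0 = (Torus.proj (2 * S' + 1) a.1) 0 := by
    have := (Prod.ext_iff.1 hab).1
    simp only [torusEdge] at this
    rw [this]
  simp only [Torus.proj_apply, Pi.add_apply, Pi.single_eq_same] at h0
  rw [ZMod.intCast_eq_intCast_iff_dvd_sub] at h0
  have ha' := abs_le.1 (hA a haT)
  have hb' := abs_le.1 (hB b hbT)
  have h1 : (1 : ℤ) ≤ (b.1 0 + n) - a.1 0 := by omega
  have h2 : (b.1 0 + n) - a.1 0 < ((2 * S' + 1 : ℕ) : ℤ) := by push_cast; omega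
  -- `h0 : ↑(2 S' + 1) ∣ a.1 0 - (b.1 0 + n)`
  have h3 := Int.le_of_dvd (by omega) (dvd_sub_comm.1 h0)
  omega

/-- Expectations of bounded functions under a probability measure are bounded. -/
theorem abs_integral_le {X : Type*} [MeasurableSpace X] (μ : Measure X) [IsProbabilityMeasure μ]
    {f : X → ℝ} {C : ℝ} (hf : ∀ x, |f x| ≤ C) : |∫ x, f x ∂μ| ≤ C := by
  have h := norm_integral_le_of_norm_le_const (μ := μ) (f := f) (C := C)
    (ae_of_all _ fun x => by rw [Real.norm_eq_abs]; exact hf x)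
  rwa [probReal_univ, mul_one, Real.norm_eq_abs] at h

/-- Resampling-free factorisation on the finite product: real version of independence of
disjoint blocks. -/
theorem integral_mul_eq_of_dependsOn_pi {ι' : Type*} [Fintype ι'] [DecidableEq ι']
    {Y : Type*} [MeasurableSpace Y] (ν : Measure Y) [IsProbabilityMeasure ν]
    {S T : Finset ι'} (hST : Disjoint S T) {F F' : (ι' → Y) → ℝ} (hFm : Measurable F)
    (hGm : Measurable F') (hF : DependsOn F (S : Set ι')) (hG : DependsOn F' (T : Set ι')) :
    ∫ x, F x * F' x ∂Measure.pi (fun _ : ι' => ν) =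
      (∫ x, F x ∂Measure.pi (fun _ : ι' => ν)) * ∫ x, F' x ∂Measure.pi (fun _ : ι' => ν) := by
  rw [← Measure.infinitePi_eq_pi]
  exact Literature.Probability.LatticeModels.integral_mul_eq_of_dependsOn_disjoint
    (fun _ : ι' => ν) hST hFm hGm hF hG

/-- **Translation invariance** of the torus Wilson expectation of a lifted observable, in the
`configShift` form used by `latticeConnectedCorr` (every `β`). -/
theorem integral_shift_torusLift {N : ℕ} (ρ : G →* Matrix (Fin N) (Fin N) ℂ) (β : ℝ) (S : ℕ)
    [NeZero S] (B : LGConfig 4 G → ℝ) (v : Literature.Probability.LatticeModels.Site 4) :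
    ∫ U, B (configShift (-v) (torusLift S U)) ∂wilsonMeasure (d := 4) (L := S) ρ β =
      ∫ U, B (torusLift S U) ∂wilsonMeasure (d := 4) (L := S) ρ β := by
  have h := toTorusObservable_comp_configShift (G := G) S (-v) B
  have h' : ∀ U : GaugeConfig 4 S G, B (configShift (-v) (torusLift S U)) =
      (toTorusObservable S B) (torusConfigShift (Torus.proj S (-v)) U) := fun U => by
    have := congrFun h U
    simpa [toTorusObservable] using this
  simp_rw [h']
  rw [← integral_map_equiv (torusConfigShift (Torus.proj S (-v))) (toTorusObservable S B),
    wilsonMeasure_map_torusConfigShift]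
  rfl

/-- **At `β ≡ 0` every scheme has a uniform lattice mass gap of EVERY rate `Δ ≥ 0`.**
Independent Haar links: the connected correlation of two gauge-invariant local observables
vanishes as soon as their (time-shifted) supports project disjointly onto the torus, i.e. for
all separations `n ≥ 2R+1` on all tori `2S'+1` with `S' ≥ max(L_k, 2R)`; for the finitely many
smaller `n` it is bounded by `2 C_A C_B ≤ 2 C_A C_B e^{Δ(2R+1)} e^{-Δ a_k n}` once `a_k ≤ 1`. -/
theorem hasLatticeMassGap_beta_zero (r : LatticeRep G) (sch : SpeciesScheme (YMSpecies G))
    (hβ : ∀ k, sch.β k = 0) (ha : ∀ k, sch.a k ≤ 1) {Δ : ℝ} (hΔ : 0 ≤ Δ) :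
    HasLatticeMassGap r sch Δ := by
  classical
  intro A B
  obtain ⟨CA, hCA⟩ := A.bounded
  obtain ⟨CB, hCB⟩ := B.bounded
  set R : ℕ := (A.supp ∪ B.supp).sup fun e => (e.1 0).natAbs with hR
  have hRA : ∀ e ∈ A.supp, |e.1 0| ≤ (R : ℤ) := fun e he => by
    have : (e.1 0).natAbs ≤ R := Finset.le_sup (f := fun e : Literature.MathematicalPhysics.QuantumLattice.ZdEdge 4 => (e.1 0).natAbs)
      (Finset.mem_union_left _ he)
    rw [← Int.natCast_natAbs]; exact_mod_cast this
  have hRB : ∀ e ∈ B.supp, |e.1 0| ≤ (R : ℤ) := fun e he => by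
    have : (e.1 0).natAbs ≤ R := Finset.le_sup (f := fun e : Literature.MathematicalPhysics.QuantumLattice.ZdEdge 4 => (e.1 0).natAbs)
      (Finset.mem_union_right _ he)
    rw [← Int.natCast_natAbs]; exact_mod_cast this
  have hCA0 : 0 ≤ CA := (abs_nonneg _).trans (hCA fun _ => 1)
  have hCB0 : 0 ≤ CB := (abs_nonneg _).trans (hCB fun _ => 1)
  refine ⟨2 * CA * CB * Real.exp (Δ * (2 * R + 1)), Eventually.of_forall fun k S' _ n hn => ?_⟩
  haveI : IsProbabilityMeasure (wilsonMeasure (d := 4) (L := 2 * S' + 1) (G := G) r.ρ (sch.β k)) :=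
    isProbabilityMeasure_wilsonMeasure r.ρ r.continuous _
  have hK : 0 ≤ 2 * CA * CB * Real.exp (Δ * (2 * R + 1)) := by positivity
  by_cases hn0 : 2 * R + 1 ≤ n
  · -- disjoint supports: the connected correlation vanishes
    have hcorr : latticeConnectedCorr r.ρ (sch.β k) (2 * S' + 1) A.F B.F n = 0 := by
      unfold latticeConnectedCorr
      rw [hβ k, wilsonMeasure_zero]
      have hfact : ∫ U, A.F (torusLift (2 * S' + 1) U) *
            B.F (configShift (-Pi.single 0 (n : ℤ)) (torusLift (2 * S' + 1) U)) ∂piHaar (2 * S' + 1) =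
          (∫ U, A.F (torusLift (2 * S' + 1) U) ∂piHaar (2 * S' + 1)) *
            ∫ U, B.F (configShift (-Pi.single 0 (n : ℤ)) (torusLift (2 * S' + 1) U))
              ∂piHaar (2 * S' + 1) (G := G) :=
        integral_mul_eq_of_dependsOn_pi (haarProbability G) (disjoint_image_torusEdge hRA hRB hn0 hn)
          (F := fun U : GaugeConfig 4 (2 * S' + 1) G => A.F (torusLift (2 * S' + 1) U))
          (F' := fun U : GaugeConfig 4 (2 * S' + 1) G =>
            B.F (configShift (-Pi.single 0 (n : ℤ)) (torusLift (2 * S' + 1) U)))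
          (A.measurable.comp (measurable_torusLift _))
          ((B.measurable.comp (configShift _).measurable).comp (measurable_torusLift _))
          (dependsOn_comp_torusLift A.isCylinder _) (dependsOn_shift_comp_torusLift B.isCylinder _ _)
      have hshift : ∫ U, B.F (configShift (-Pi.single 0 (n : ℤ)) (torusLift (2 * S' + 1) U))
            ∂piHaar (2 * S' + 1) = ∫ U, B.F (torusLift (2 * S' + 1) U) ∂piHaar (2 * S' + 1) (G := G) := by
        rw [← wilsonMeasure_zero r.ρ]; exact integral_shift_torusLift r.ρ 0 _ B.F _
      rw [hfact, hshift, sub_self]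
    rw [hcorr, abs_zero]
    positivity
  · -- small separations: bounded by `2 C_A C_B`
    push Not at hn0
    have hb : |latticeConnectedCorr r.ρ (sch.β k) (2 * S' + 1) A.F B.F n| ≤ 2 * CA * CB := by
      unfold latticeConnectedCorr
      refine (abs_sub _ _).trans ?_
      have h1 : |∫ U, A.F (torusLift (2 * S' + 1) U) *
          B.F (configShift (-Pi.single 0 (n : ℤ)) (torusLift (2 * S' + 1) U))
            ∂wilsonMeasure (d := 4) (L := 2 * S' + 1) r.ρ (sch.β k)| ≤ CA * CB :=
        abs_integral_le _ fun U => by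
          rw [abs_mul]; exact mul_le_mul (hCA _) (hCB _) (abs_nonneg _) hCA0
      have h2 : |(∫ U, A.F (torusLift (2 * S' + 1) U) ∂wilsonMeasure (d := 4) (L := 2 * S' + 1) r.ρ (sch.β k)) *
          ∫ U, B.F (torusLift (2 * S' + 1) U) ∂wilsonMeasure (d := 4) (L := 2 * S' + 1) r.ρ (sch.β k)| ≤ CA * CB := by
        rw [abs_mul]
        exact mul_le_mul (abs_integral_le _ fun U => hCA _) (abs_integral_le _ fun U => hCB _)
          (abs_nonneg _) hCA0
      linarith
    refine hb.trans ?_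
    have hexp : Real.exp (-(Δ * (sch.a k * n))) ≥ Real.exp (-(Δ * (2 * R + 1))) := by
      apply Real.exp_le_exp.2
      have : sch.a k * n ≤ 2 * R + 1 := by
        calc sch.a k * n ≤ 1 * n := mul_le_mul_of_nonneg_right (ha k) (Nat.cast_nonneg _)
          _ ≤ 2 * R + 1 := by rw [one_mul]; exact_mod_cast hn0.le
      nlinarith
    calc 2 * CA * CB = 2 * CA * CB * Real.exp (Δ * (2 * R + 1)) * Real.exp (-(Δ * (2 * R + 1))) := by
          rw [mul_assoc (2 * CA * CB), ← Real.exp_add, add_neg_cancel, Real.exp_zero, mul_one]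
      _ ≤ 2 * CA * CB * Real.exp (Δ * (2 * R + 1)) * Real.exp (-(Δ * (sch.a k * n))) :=
          mul_le_mul_of_nonneg_left hexp hK

end Gap

section TwoPoint

open Literature.Probability.LatticeModels (box mem_box)

variable {G : Type} [Group G] [TopologicalSpace G] [IsTopologicalGroup G] [CompactSpace G]
  [MeasurableSpace G] [BorelSpace G] [SecondCountableTopology G]
  {N : ℕ} (ρ : G →* Matrix (Fin N) (Fin N) ℂ)

/-- `Torus.proj (2L+1)` is injective on the fundamental domain `box 4 L`. -/
theorem proj_injOn_box (L : ℕ) :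
    Set.InjOn (Torus.proj (d := 4) (2 * L + 1)) (box 4 L : Set (Literature.Probability.LatticeModels.Site 4)) := by
  intro x hx y hy hxy
  funext k
  have hk : ((x k : ℤ) : ZMod (2 * L + 1)) = ((y k : ℤ) : ZMod (2 * L + 1)) := congrFun hxy k
  rw [ZMod.intCast_eq_intCast_iff_dvd_sub] at hk
  obtain ⟨hx1, hx2⟩ := mem_box.1 (Finset.mem_coe.1 hx) k
  obtain ⟨hy1, hy2⟩ := mem_box.1 (Finset.mem_coe.1 hy) k
  have hlt : |y k - x k| < ((2 * L + 1 : ℕ) : ℤ) := by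
    rw [abs_lt]; push_cast; constructor <;> linarith
  have h0 := Int.eq_zero_of_abs_lt_dvd hk hlt
  linarith

omit [SecondCountableTopology G] [TopologicalSpace G] [IsTopologicalGroup G] [CompactSpace G]
  [BorelSpace G] in
/-- The smeared curvature field of the periodic lift, in torus variables. -/
theorem smearedLatticeField_torusLift (L : ℕ) (a c m : ℝ) (f : SchwartzMap (EuclideanSpace ℝ (Fin 4)) ℝ)
    (U : GaugeConfig 4 (2 * L + 1) G) :
    smearedLatticeField (actionDensity ρ) (box 4 L) a c m f (torusLift (2 * L + 1) U) =
      c * a ^ 4 * ∑ x ∈ box 4 L, f (a • siteToE x) *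
        (torusDensity ρ (2 * L + 1) (Torus.proj (2 * L + 1) x) U - m) := by
  unfold smearedLatticeField
  congr 1
  refine Finset.sum_congr rfl fun x _ => ?_
  rw [actionDensity_shift_torusLift]

omit [CompactSpace G] [MeasurableSpace G] [BorelSpace G] [SecondCountableTopology G] in
theorem continuous_torusDensity (hρ : Continuous ρ) (S : ℕ) (X : Site 4 S) :
    Continuous (torusDensity ρ S X) := by
  unfold torusDensity
  exact continuous_finsetSum _ fun p _ => continuous_plaqTerm ρ S hρ X p

/-- Linearity: a weighted finite sum under the integral. -/
theorem integral_sum_mul_left {α X : Type*} [MeasurableSpace X] (μ : Measure X) (B : Finset α)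
    (κ : α → ℝ) (g : α → X → ℝ) (hg : ∀ x ∈ B, Integrable (g x) μ) :
    ∫ U, ∑ x ∈ B, κ x * g x U ∂μ = ∑ x ∈ B, κ x * ∫ U, g x U ∂μ := by
  rw [integral_finsetSum _ fun x hx => (hg x hx).const_mul (κ x)]
  exact Finset.sum_congr rfl fun x _ => integral_const_mul _ _

/-- Linearity: a weighted finite double sum under the integral. -/
theorem integral_sum_sum_mul_left {α X : Type*} [MeasurableSpace X] (μ : Measure X)
    (B : Finset α) (κ : α → α → ℝ) (g : α → α → X → ℝ) (hg : ∀ x y, Integrable (g x y) μ) :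
    ∫ U, ∑ x ∈ B, ∑ y ∈ B, κ x y * g x y U ∂μ = ∑ x ∈ B, ∑ y ∈ B, κ x y * ∫ U, g x y U ∂μ := by
  rw [integral_finsetSum _ fun x _ =>
    integrable_finsetSum _ fun y _ => (hg x y).const_mul (κ x y)]
  exact Finset.sum_congr rfl fun x _ => integral_sum_mul_left μ B (κ x) (g x) fun y _ => hg x y

/-- Shifted second moment of the density at distinct torus sites factorises (`β = 0`). -/
theorem integral_sub_mul_sub {S : ℕ} [NeZero S] (hS : (1 : ZMod S) ≠ 0) (hρ : Continuous ρ)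
    {X Y : Site 4 S} (hXY : X ≠ Y) (m m' : ℝ) :
    ∫ U, (torusDensity ρ S X U - m) * (torusDensity ρ S Y U - m') ∂piHaar S =
      (∫ U, (torusDensity ρ S X U - m) ∂piHaar S) * ∫ U, (torusDensity ρ S Y U - m') ∂piHaar S := by
  have hX := continuous_torusDensity ρ hρ S X
  have hY := continuous_torusDensity ρ hρ S Y
  have iX : Integrable (fun U => torusDensity ρ S X U) (piHaar S) := integrable_of_continuous S hX
  have iY : Integrable (fun U => torusDensity ρ S Y U) (piHaar S) := integrable_of_continuous S hY
  have iXY : Integrable (fun U => torusDensity ρ S X U * torusDensity ρ S Y U) (piHaar S) :=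
    integrable_of_continuous S (hX.mul hY)
  have i1 : Integrable (fun U => torusDensity ρ S X U * torusDensity ρ S Y U -
      m' * torusDensity ρ S X U) (piHaar S) := iXY.sub (iX.const_mul m')
  have i2 : Integrable (fun U => m * torusDensity ρ S Y U - m * m') (piHaar S) :=
    (iY.const_mul m).sub (integrable_const _)
  have e : ∀ U, (torusDensity ρ S X U - m) * (torusDensity ρ S Y U - m') =
      torusDensity ρ S X U * torusDensity ρ S Y U - m' * torusDensity ρ S X U -
        (m * torusDensity ρ S Y U - m * m') := by intro U; ring
  simp_rw [e]
  rw [integral_sub i1 i2,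
    integral_sub iXY (iX.const_mul m'), integral_sub (iY.const_mul m) (integrable_const _),
    integral_const_mul, integral_const_mul, integral_const, probReal_univ, one_smul,
    integral_torusDensity_mul ρ S hS hρ hXY, integral_sub iX (integrable_const _),
    integral_sub iY (integrable_const _), integral_const, integral_const, probReal_univ, one_smul,
    one_smul]
  ring

/-- **Two-point factorisation at `β = 0` for diagonal-free weights.** For weights with
`w x · w' x = 0` (e.g. test functions with disjoint supports), the product Haar expectation of
the product of two smeared curvature fields is the product of their expectations — exactly,
on every torus `2L+1 ≥ 3`, for all renormalisation constants. -/
theorem integral_smeared_mul_smeared {L : ℕ} (hL : 1 ≤ L) (hρ : Continuous ρ) (a c c' m m' : ℝ)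
    (w w' : Literature.Probability.LatticeModels.Site 4 → ℝ) (hww' : ∀ x, w x * w' x = 0) :
    ∫ U, (c * a ^ 4 * ∑ x ∈ box 4 L, w x *
        (torusDensity ρ (2 * L + 1) (Torus.proj (2 * L + 1) x) U - m)) *
      (c' * a ^ 4 * ∑ y ∈ box 4 L, w' y *
        (torusDensity ρ (2 * L + 1) (Torus.proj (2 * L + 1) y) U - m')) ∂piHaar (2 * L + 1) =
    (∫ U, c * a ^ 4 * ∑ x ∈ box 4 L, w x *
        (torusDensity ρ (2 * L + 1) (Torus.proj (2 * L + 1) x) U - m) ∂piHaar (2 * L + 1)) *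
      ∫ U, c' * a ^ 4 * ∑ y ∈ box 4 L, w' y *
        (torusDensity ρ (2 * L + 1) (Torus.proj (2 * L + 1) y) U - m') ∂piHaar (2 * L + 1) := by
  have hS : (1 : ZMod (2 * L + 1)) ≠ 0 := one_ne_zero_zmod (by omega)
  obtain ⟨D, hD⟩ : ∃ D : Literature.Probability.LatticeModels.Site 4 → GaugeConfig 4 (2 * L + 1) G → ℝ,
      ∀ x U, D x U = torusDensity ρ (2 * L + 1) (Torus.proj (2 * L + 1) x) U := ⟨_, fun _ _ => rfl⟩
  simp only [← hD]
  have hDc : ∀ x, Continuous (D x) := fun x => by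
    rw [show D x = _ from funext (hD x)]; exact continuous_torusDensity ρ hρ (2 * L + 1) _
  have iD : ∀ x (μ : ℝ), Integrable (fun U => D x U - μ) (piHaar (2 * L + 1)) := fun x μ =>
    integrable_of_continuous (2 * L + 1) ((hDc x).sub continuous_const)
  have iDD : ∀ x y, Integrable (fun U => (D x U - m) * (D y U - m')) (piHaar (2 * L + 1)) :=
    fun x y => integrable_of_continuous (2 * L + 1)
      (((hDc x).sub continuous_const).mul ((hDc y).sub continuous_const))
  -- pointwise expansion of the product of the two smeared fields
  have hexp : ∀ U, (c * a ^ 4 * ∑ x ∈ box 4 L, w x * (D x U - m)) *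
      (c' * a ^ 4 * ∑ y ∈ box 4 L, w' y * (D y U - m')) =
      (c * a ^ 4 * (c' * a ^ 4)) *
        ∑ x ∈ box 4 L, ∑ y ∈ box 4 L, (w x * w' y) * ((D x U - m) * (D y U - m')) := by
    intro U
    rw [show (c * a ^ 4 * ∑ x ∈ box 4 L, w x * (D x U - m)) *
        (c' * a ^ 4 * ∑ y ∈ box 4 L, w' y * (D y U - m')) = (c * a ^ 4 * (c' * a ^ 4)) *
        ((∑ x ∈ box 4 L, w x * (D x U - m)) * ∑ y ∈ box 4 L, w' y * (D y U - m')) by ring,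
      Finset.sum_mul_sum]
    congr 1
    exact Finset.sum_congr rfl fun x _ => Finset.sum_congr rfl fun y _ => by ring
  simp_rw [hexp]
  rw [integral_const_mul, integral_sum_sum_mul_left _ _ (fun x y => w x * w' y)
    (fun x y U => (D x U - m) * (D y U - m')) iDD]
  -- the two one-point expectations
  rw [integral_const_mul, integral_const_mul,
    integral_sum_mul_left _ _ w (fun x U => D x U - m) fun x _ => iD x m,
    integral_sum_mul_left _ _ w' (fun y U => D y U - m') fun y _ => iD y m']
  rw [show (c * a ^ 4 * ∑ x ∈ box 4 L, w x * ∫ U, (D x U - m) ∂piHaar (2 * L + 1)) *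
      (c' * a ^ 4 * ∑ y ∈ box 4 L, w' y * ∫ U, (D y U - m') ∂piHaar (2 * L + 1)) =
      (c * a ^ 4 * (c' * a ^ 4)) * ((∑ x ∈ box 4 L, w x * ∫ U, (D x U - m) ∂piHaar (2 * L + 1)) *
        ∑ y ∈ box 4 L, w' y * ∫ U, (D y U - m') ∂piHaar (2 * L + 1)) by ring, Finset.sum_mul_sum]
  congr 1
  refine Finset.sum_congr rfl fun x hx => Finset.sum_congr rfl fun y hy => ?_
  by_cases hxy : x = y
  · subst hxy
    rcases mul_eq_zero.1 (hww' x) with h | h <;> simp [h]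
  · have hXY : Torus.proj (2 * L + 1) x ≠ Torus.proj (2 * L + 1) y := fun h =>
      hxy (proj_injOn_box L (Finset.mem_coe.2 hx) (Finset.mem_coe.2 hy) h)
    rw [show (∫ U, (D x U - m) * (D y U - m') ∂piHaar (2 * L + 1)) =
        (∫ U, (D x U - m) ∂piHaar (2 * L + 1)) * ∫ U, (D y U - m') ∂piHaar (2 * L + 1) by
      simp only [hD]; exact integral_sub_mul_sub ρ hS hρ hXY m m']
    ring

end TwoPoint

section LatticeTwoPoint

open Literature.Probability.LatticeModels (box mem_box)

variable {G : Type} [Group G] [TopologicalSpace G] [IsTopologicalGroup G] [CompactSpace G]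
  [MeasurableSpace G] [BorelSpace G]

local notation "𝔼" => EuclideanSpace ℝ (Fin 4)

/-- The lattice one-point function of the curvature species on one real test function. -/
theorem latticeSchwinger_one (r : LatticeRep G) (sch : SpeciesScheme (YMSpecies G)) (k : ℕ)
    (u : SchwartzMap 𝔼 ℝ) :
    latticeSchwinger r.ρ sch (fun s => s.F) k 1 (fun _ => r.curvature) ![u] =
      ∫ U, smearedLatticeField (actionDensity r.ρ) (box 4 (sch.L k)) (sch.a k)
        (sch.c r.curvature k) (sch.m r.curvature k) u (torusLift (sch.side k) U)
        ∂(wilsonMeasure (d := 4) (L := sch.side k) r.ρ (sch.β k)) := by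
  unfold latticeSchwinger
  simp only [Fin.prod_univ_one, Matrix.cons_val_zero, curvature_F]

/-- The lattice two-point function of the curvature species on two real test functions. -/
theorem latticeSchwinger_two (r : LatticeRep G) (sch : SpeciesScheme (YMSpecies G)) (k : ℕ)
    (u v : SchwartzMap 𝔼 ℝ) :
    latticeSchwinger r.ρ sch (fun s => s.F) k (1 + 1) (fun _ => r.curvature) ![u, v] =
      ∫ U, smearedLatticeField (actionDensity r.ρ) (box 4 (sch.L k)) (sch.a k)
          (sch.c r.curvature k) (sch.m r.curvature k) u (torusLift (sch.side k) U) *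
        smearedLatticeField (actionDensity r.ρ) (box 4 (sch.L k)) (sch.a k)
          (sch.c r.curvature k) (sch.m r.curvature k) v (torusLift (sch.side k) U)
        ∂(wilsonMeasure (d := 4) (L := sch.side k) r.ρ (sch.β k)) := by
  unfold latticeSchwinger
  simp only [Fin.prod_univ_succ, Fin.prod_univ_zero, mul_one, Matrix.cons_val_zero,
    Matrix.cons_val_succ, curvature_F]

/-- **At `β = 0` the off-diagonal lattice two-point function of `tr F²` FACTORISES EXACTLY**
(every torus `2L_k+1 ≥ 3`, all renormalisation constants): for real test functions with
`u · v ≡ 0`, `⟨Φ(u) Φ(v)⟩_k = ⟨Φ(u)⟩_k ⟨Φ(v)⟩_k`. -/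
theorem latticeSchwinger_two_eq_mul (r : LatticeRep G) (sch : SpeciesScheme (YMSpecies G))
    {k : ℕ} (hβ : sch.β k = 0) (hL : 1 ≤ sch.L k) {u v : SchwartzMap 𝔼 ℝ}
    (huv : ∀ z, u z * v z = 0) :
    latticeSchwinger r.ρ sch (fun s => s.F) k (1 + 1) (fun _ => r.curvature) ![u, v] =
      latticeSchwinger r.ρ sch (fun s => s.F) k 1 (fun _ => r.curvature) ![u] *
        latticeSchwinger r.ρ sch (fun s => s.F) k 1 (fun _ => r.curvature) ![v] := by
  haveI : SecondCountableTopology G :=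
    (r.continuous.isClosedEmbedding r.injective).isEmbedding.secondCountableTopology
  rw [latticeSchwinger_two, latticeSchwinger_one, latticeSchwinger_one, hβ]
  simp only [SpeciesScheme.side]
  rw [wilsonMeasure_zero]
  simp only [smearedLatticeField_torusLift]
  exact integral_smeared_mul_smeared r.ρ hL r.continuous _ _ _ _ _ _ _
    fun x => huv _

end LatticeTwoPoint

section Pinning

open scoped SchwartzMap ComplexConjugate
open Literature.MathematicalPhysics.AQFT (IsOffDiagonal coincidenceLocus)
open Complex

variable {G : Type} [Group G] [TopologicalSpace G] [IsTopologicalGroup G] [CompactSpace G]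
  [MeasurableSpace G] [BorelSpace G]

local notation "𝔼" => EuclideanSpace ℝ (Fin 4)

/-! ### Real one- and two-variable product tensors -/

/-- The one-variable tensor of a real test function, complexified. -/
def T1 (u : 𝓢(𝔼, ℝ)) : 𝓢((Fin 1 → 𝔼), ℂ) := SchwartzMap.tensorFin 1 fun i => ofRealTest (![u] i)

/-- The two-variable product tensor `u ⊗ v` of real test functions, complexified. -/
def T2 (u v : 𝓢(𝔼, ℝ)) : 𝓢((Fin (1 + 1) → 𝔼), ℂ) :=
  SchwartzMap.tensorFin (1 + 1) fun i => ofRealTest (![u, v] i)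

theorem T1_apply (u : 𝓢(𝔼, ℝ)) (y : Fin 1 → 𝔼) : T1 u y = (u (y 0) : ℂ) := by
  simp [T1, SchwartzMap.tensorFin_apply]

theorem T2_apply (u v : 𝓢(𝔼, ℝ)) (x : Fin (1 + 1) → 𝔼) :
    T2 u v x = (u (x 0) : ℂ) * (v (x 1) : ℂ) := by
  simp [T2, SchwartzMap.tensorFin_apply, Fin.prod_univ_succ]

theorem isTensorOf_T1 (u : 𝓢(𝔼, ℝ)) : IsTensorOf (T1 u) fun i => ofRealTest (![u] i) :=
  isTensorOf_tensorFin _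

theorem isTensorOf_T2 (u v : 𝓢(𝔼, ℝ)) : IsTensorOf (T2 u v) fun i => ofRealTest (![u, v] i) :=
  isTensorOf_tensorFin _

/-- One-variable test functions are off-diagonal (the coincidence locus of one point is empty). -/
theorem isOffDiagonal_one (F : 𝓢((Fin 1 → 𝔼), ℂ)) : IsOffDiagonal F := by
  intro x hx
  obtain ⟨i, j, hij, -⟩ := hx
  exact absurd (Subsingleton.elim i j) hij

/-- Inner composition: `tsupport (f ∘ g) ⊆ g⁻¹(tsupport f)` for continuous `g`. -/
theorem tsupport_comp_subset_preimage {X Y M : Type*} [TopologicalSpace X] [TopologicalSpace Y]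
    [Zero M] (f : Y → M) {g : X → Y} (hg : Continuous g) :
    tsupport (f ∘ g) ⊆ g ⁻¹' tsupport f :=
  closure_minimal (fun x hx => subset_closure (by simpa [Function.mem_support] using hx))
    ((isClosed_tsupport f).preimage hg)

/-- A time-separated product tensor is off-diagonal. -/
theorem isOffDiagonal_T2 {u v : 𝓢(𝔼, ℝ)} (hu : tsupport (u : 𝔼 → ℝ) ⊆ {z | z 0 < 0})
    (hv : tsupport (v : 𝔼 → ℝ) ⊆ {z | 0 < z 0}) : IsOffDiagonal (T2 u v) := by
  apply Literature.MathematicalPhysics.AQFT.IsOffDiagonal.of_tsupport_subset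
  -- the support lies in the closed set `{x | x 0 ∈ tsupport u, x 1 ∈ tsupport v}`
  have hC : IsClosed {x : Fin (1 + 1) → 𝔼 | x 0 ∈ tsupport (u : 𝔼 → ℝ) ∧ x 1 ∈ tsupport (v : 𝔼 → ℝ)} :=
    ((isClosed_tsupport _).preimage (continuous_apply 0)).inter
      ((isClosed_tsupport _).preimage (continuous_apply 1))
  have hsupp : Function.support (T2 u v : (Fin (1 + 1) → 𝔼) → ℂ) ⊆
      {x | x 0 ∈ tsupport (u : 𝔼 → ℝ) ∧ x 1 ∈ tsupport (v : 𝔼 → ℝ)} := by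
    intro x hx
    rw [Function.mem_support, T2_apply] at hx
    exact ⟨subset_closure (Function.mem_support.2 fun h => hx (by simp [h])),
      subset_closure (Function.mem_support.2 fun h => hx (by simp [h]))⟩
  refine (closure_minimal hsupp hC).trans ?_
  rintro x ⟨hx0, hx1⟩ ⟨i, j, hij, hxij⟩
  have h01 : x 0 = x 1 := by
    rcases Fin.eq_zero_or_eq_succ i with rfl | ⟨i', rfl⟩
    · have hj : j = 1 := Fin.eq_one_of_ne_zero j (Ne.symm hij)
      rw [hj] at hxij; exact hxij
    · have hi' : i' = 0 := Subsingleton.elim _ _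
      subst hi'
      have hj : j = 0 := by
        rcases Fin.eq_zero_or_eq_succ j with rfl | ⟨j', rfl⟩
        · rfl
        · exact absurd (by rw [Subsingleton.elim j' 0]) hij
      rw [hj] at hxij; exact hxij.symm
  have h1 := hu hx0
  have h2 := hv hx1
  simp only [Set.mem_setOf_eq] at h1 h2
  rw [h01] at h1
  linarith

/-- Time-separated real test functions have pointwise product zero. -/
theorem mul_eq_zero_of_tsupport {u v : 𝓢(𝔼, ℝ)} (hu : tsupport (u : 𝔼 → ℝ) ⊆ {z | z 0 < 0})
    (hv : tsupport (v : 𝔼 → ℝ) ⊆ {z | 0 < z 0}) (z : 𝔼) : u z * v z = 0 := by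
  by_cases hz : z 0 < 0
  · have : z ∉ tsupport (v : 𝔼 → ℝ) := fun h => by have := hv h; simp only [Set.mem_setOf_eq] at this; linarith
    rw [image_eq_zero_of_notMem_tsupport this, mul_zero]
  · have : z ∉ tsupport (u : 𝔼 → ℝ) := fun h => hz (hu h)
    rw [image_eq_zero_of_notMem_tsupport this, zero_mul]

/-! ### Pinning of the continuum two-point function at `β ≡ 0` -/

/-- **At `β ≡ 0` the continuum two-point function of `tr F²` on time-separated real product
tensors factorises**: `𝔖₂(u ⊗ v) = 𝔖₁(u) 𝔖₁(v)` for every OS datum tied to the scheme by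
`IsYangMillsFor` (limits of the exactly factorising lattice quantities). -/
theorem schwinger_two_eq_mul (r : LatticeRep G) (sch : SpeciesScheme (YMSpecies G))
    (hβ : ∀ k, sch.β k = 0) (ha : ∀ k, sch.a k ≤ 1) (T : OSData (YMSpecies G) 4)
    (hT : IsYangMillsFor r sch T) {u v : 𝓢(𝔼, ℝ)} (hu : tsupport (u : 𝔼 → ℝ) ⊆ {z | z 0 < 0})
    (hv : tsupport (v : 𝔼 → ℝ) ⊆ {z | 0 < z 0}) :
    T.schwinger (1 + 1) (fun _ => r.curvature) (T2 u v) =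
      T.schwinger 1 (fun _ => r.curvature) (T1 u) * T.schwinger 1 (fun _ => r.curvature) (T1 v) := by
  have h2 := hT (1 + 1) (by norm_num) (fun _ => r.curvature) ![u, v] (T2 u v) (isTensorOf_T2 u v)
    (isOffDiagonal_T2 hu hv)
  have hu1 := hT 1 one_ne_zero (fun _ => r.curvature) ![u] (T1 u) (isTensorOf_T1 u)
    (isOffDiagonal_one _)
  have hv1 := hT 1 one_ne_zero (fun _ => r.curvature) ![v] (T1 v) (isTensorOf_T1 v)
    (isOffDiagonal_one _)
  have hprod := hu1.mul hv1
  refine tendsto_nhds_unique h2 (hprod.congr' ?_)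
  filter_upwards [eventually_le_L sch ha 1] with k hk
  have hL : 1 ≤ sch.L k := by exact_mod_cast hk
  rw [← Complex.ofReal_mul, latticeSchwinger_two_eq_mul r sch (hβ k) hL (mul_eq_zero_of_tsupport hu hv)]

/-! ### The junk model has no non-trivial continuum limit -/

/-- Restriction of a one-variable test function on `(ℝ⁴)¹` to `ℝ⁴`. -/
def toOne (F : 𝓢((Fin 1 → 𝔼), ℂ)) : 𝓢(𝔼, ℂ) :=
  SchwartzMap.compCLMOfContinuousLinearEquiv ℝ (ContinuousLinearEquiv.funUnique (Fin 1) ℝ 𝔼).symm F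

theorem toOne_apply (F : 𝓢((Fin 1 → 𝔼), ℂ)) (e : 𝔼) : toOne F e = F (fun _ => e) := by
  simp [toOne, SchwartzMap.compCLMOfContinuousLinearEquiv_apply]
  rfl

theorem eq_const_of_fin_one (y : Fin 1 → 𝔼) : (fun _ => y 0) = y :=
  funext fun i => by rw [Subsingleton.elim i 0]

theorem apply_eq_toOne (F : 𝓢((Fin 1 → 𝔼), ℂ)) (y : Fin 1 → 𝔼) : F y = toOne F (y 0) := by
  rw [toOne_apply, eq_const_of_fin_one]

theorem coe_toOne (F : 𝓢((Fin 1 → 𝔼), ℂ)) :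
    (toOne F : 𝔼 → ℂ) = (F : (Fin 1 → 𝔼) → ℂ) ∘ fun e _ => e := funext (toOne_apply F)

/-- Support of the OS adjoint of a time-ordered one-point function: negative times. -/
theorem tsupport_osAdjoint_subset {F : 𝓢((Fin 1 → 𝔼), ℂ)} (hF : IsTimeOrdered F) :
    tsupport (osAdjoint F : (Fin 1 → 𝔼) → ℂ) ⊆ {y | y 0 0 < 0} := by
  set R : (Fin 1 → 𝔼) → (Fin 1 → 𝔼) := fun y i => timeReflection 4 (y (Fin.rev i)) with hR
  have hRc : Continuous R :=
    continuous_pi fun i => (timeReflection 4).continuous.comp (continuous_apply _)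
  have hcoe : (osAdjoint F : (Fin 1 → 𝔼) → ℂ) = (fun z : ℂ => conj z) ∘ ((F : (Fin 1 → 𝔼) → ℂ) ∘ R) :=
    funext fun y => by simp [hR, osAdjoint_apply]
  rw [hcoe]
  refine (tsupport_comp_subset (map_zero _) _).trans
    ((tsupport_comp_subset_preimage _ hRc).trans fun y hy => ?_)
  have h := (hF hy).1 0
  simp [hR, timeReflection_apply] at h
  simp only [Set.mem_setOf_eq]
  linarith

/-- Support of `toOne (osAdjoint F)`: negative times. -/
theorem tsupport_toOne_osAdjoint_subset {F : 𝓢((Fin 1 → 𝔼), ℂ)} (hF : IsTimeOrdered F) :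
    tsupport (toOne (osAdjoint F) : 𝔼 → ℂ) ⊆ {z | z 0 < 0} := by
  rw [coe_toOne]
  refine (tsupport_comp_subset_preimage _ (continuous_pi fun _ => continuous_id)).trans ?_
  intro e he
  exact tsupport_osAdjoint_subset hF he

/-- Support of `toOne G` for time-ordered `G`: positive times. -/
theorem tsupport_toOne_subset {Gt : 𝓢((Fin 1 → 𝔼), ℂ)} (hG : IsTimeOrdered Gt) :
    tsupport (toOne Gt : 𝔼 → ℂ) ⊆ {z | 0 < z 0} := by
  rw [coe_toOne]
  refine (tsupport_comp_subset_preimage _ (continuous_pi fun _ => continuous_id)).trans ?_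
  intro e he
  exact (hG he).1 0

/-- **The ultralocal theory has no non-trivial continuum limit in `tr F²`.** At `β ≡ 0`
(`a_k ≤ 1`), whatever the renormalisations `c_k, m_k` and torus sizes: every OS datum tied to
the scheme by `IsYangMillsFor` fails `IsNontrivial r.curvature`. (Pinning: `Θ F̄ ⊗ G` is a
combination of four time-separated REAL product tensors, on each of which the two-point function
factorises by `schwinger_two_eq_mul`.) -/
theorem not_isNontrivial_beta_zero (r : LatticeRep G) (sch : SpeciesScheme (YMSpecies G))
    (hβ : ∀ k, sch.β k = 0) (ha : ∀ k, sch.a k ≤ 1) (T : OSData (YMSpecies G) 4)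
    (hT : IsYangMillsFor r sch T) : ¬ T.IsNontrivial r.curvature := by
  rintro ⟨F, Gt, H, hF, hG, hH, hne⟩
  apply hne
  set φ := toOne (osAdjoint F) with hφ
  set ψ := toOne Gt with hψ
  have huR : tsupport (reTest φ : 𝔼 → ℝ) ⊆ {z | z 0 < 0} :=
    (tsupport_reTest_subset φ).trans (tsupport_toOne_osAdjoint_subset hF)
  have huI : tsupport (imTest φ : 𝔼 → ℝ) ⊆ {z | z 0 < 0} :=
    (tsupport_imTest_subset φ).trans (tsupport_toOne_osAdjoint_subset hF)
  have hvR : tsupport (reTest ψ : 𝔼 → ℝ) ⊆ {z | 0 < z 0} :=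
    (tsupport_reTest_subset ψ).trans (tsupport_toOne_subset hG)
  have hvI : tsupport (imTest ψ : 𝔼 → ℝ) ⊆ {z | 0 < z 0} :=
    (tsupport_imTest_subset ψ).trans (tsupport_toOne_subset hG)
  -- Schwartz-level decompositions
  have e1 : osAdjoint F = T1 (reTest φ) + I • T1 (imTest φ) := by
    ext y
    rw [apply_eq_toOne, add_apply, smul_apply, T1_apply, T1_apply,
      smul_eq_mul, ← reTest_add_imTest_mul_I φ (y 0)]
    ring
  have e2 : Gt = T1 (reTest ψ) + I • T1 (imTest ψ) := by
    ext y
    rw [apply_eq_toOne, add_apply, smul_apply, T1_apply, T1_apply,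
      smul_eq_mul, ← reTest_add_imTest_mul_I ψ (y 0)]
    ring
  have e3 : H = T2 (reTest φ) (reTest ψ) - T2 (imTest φ) (imTest ψ) +
      I • T2 (reTest φ) (imTest ψ) + I • T2 (imTest φ) (reTest ψ) := by
    ext x
    rw [hH x, apply_eq_toOne, apply_eq_toOne Gt]
    simp only [add_apply, sub_apply, smul_apply, T2_apply,
      smul_eq_mul, Function.comp_apply]
    rw [show Fin.castAdd 1 (0 : Fin 1) = (0 : Fin (1 + 1)) from rfl,
      show Fin.natAdd 1 (0 : Fin 1) = (1 : Fin (1 + 1)) from rfl,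
      ← reTest_add_imTest_mul_I φ (x 0), ← reTest_add_imTest_mul_I ψ (x 1)]
    linear_combination ((imTest φ (x 0) : ℂ) * (imTest ψ (x 1) : ℂ)) * Complex.I_sq
  rw [e3, e1, e2]
  simp only [map_add, map_sub, map_smul, smul_eq_mul]
  rw [schwinger_two_eq_mul r sch hβ ha T hT huR hvR, schwinger_two_eq_mul r sch hβ ha T hT huI hvI,
    schwinger_two_eq_mul r sch hβ ha T hT huR hvI, schwinger_two_eq_mul r sch hβ ha T hT huI hvR]
  linear_combination (-((T.schwinger 1 fun _ => r.curvature) (T1 (imTest φ)) *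
    (T.schwinger 1 fun _ => r.curvature) (T1 (imTest ψ)))) * Complex.I_sq

end Pinning

section Assembly

variable {G : Type} [Group G] [TopologicalSpace G] [IsTopologicalGroup G] [CompactSpace G]
  [MeasurableSpace G] [BorelSpace G]

/-- **The ultralocal scheme**: `a_k = M^{-k}`, `β ≡ 0`, `L_k = M^k (k+1)` (so `a_k L_k = k+1`),
renormalisations `0`. -/
def ultralocalScheme (ι : Type) {M : ℕ} (hM : 2 ≤ M) : SpeciesScheme ι where
  a k := ((M : ℝ) ^ k)⁻¹
  a_pos k := by positivity
  tendsto_a := tendsto_inv_atTop_zero.comp (tendsto_pow_atTop_atTop_of_one_lt (by exact_mod_cast hM))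
  β _ := 0
  L k := M ^ k * (k + 1)
  tendsto_L := by
    have h : (fun k : ℕ => ((M : ℝ) ^ k)⁻¹ * ((M ^ k * (k + 1) : ℕ) : ℝ)) = fun k : ℕ => (k : ℝ) + 1 := by
      funext k
      have hpos : (0 : ℝ) < (M : ℝ) ^ k := by positivity
      push_cast
      field_simp
    rw [h]
    exact tendsto_natCast_atTop_atTop.atTop_add tendsto_const_nhds
  c _ _ := 0
  m _ _ := 0

/-- **The ultralocal counterexample family (per group, per representation).** For every compact
`G`, faithful unitary `r` and `M ≥ 2`: the scheme `a_k = M^{-k}`, `β ≡ 0` satisfies the M-adic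
shape, the convergence of EVERY `N_t` (to `0`), the tuning clause with `θ = 0`, and the uniform
lattice gap for EVERY `Δ ≥ 0` — while NO renormalisation of it admits OS data that are Yang–Mills
along it and non-trivial in `tr F²`. -/
theorem ultralocal_counterexample (r : LatticeRep G) {M : ℕ} (hM : 2 ≤ M) :
    ∃ (sch : SpeciesScheme (YMSpecies G)) (n : ℕ → ℕ),
      (∀ k, sch.a k = ((M : ℝ) ^ n k)⁻¹) ∧ (∀ k, sch.β k = 0) ∧
      (∀ t : ℕ, 0 < t → Tendsto (fun k => ((M : ℝ) ^ n k) ^ 8 *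
        latticeConnectedCorr r.ρ (sch.β k) (sch.side k) r.curvature.F r.curvature.F (t * M ^ n k))
          atTop (𝓝 0)) ∧
      Tendsto (fun k => ((M : ℝ) ^ n k) ^ 8 *
        latticeConnectedCorr r.ρ (sch.β k) (sch.side k) r.curvature.F r.curvature.F (M ^ n k))
          atTop (𝓝 0) ∧
      (∀ Δ : ℝ, 0 ≤ Δ → HasLatticeMassGap r sch Δ) ∧
      ∀ sch' : SpeciesScheme (YMSpecies G), sch'.a = sch.a → sch'.β = sch.β →
        ∀ T : OSData (YMSpecies G) 4, IsYangMillsFor r sch' T → ¬ T.IsNontrivial r.curvature := by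
  have hM1 : 1 ≤ M := by omega
  refine ⟨ultralocalScheme (YMSpecies G) hM, id, fun k => rfl, fun k => rfl, fun t ht => ?_, ?_,
    fun Δ hΔ => ?_, fun sch' ha' hβ' T hT => ?_⟩
  · exact tendsto_N_zero r hM1 _ id (fun k => rfl) (fun k => rfl) ht
  · have h := tendsto_N_zero r hM1 (ultralocalScheme (YMSpecies G) hM) id (fun k => rfl)
      (fun k => rfl) one_pos
    simpa only [one_mul] using h
  · exact hasLatticeMassGap_beta_zero r _ (fun k => rfl) (a_le_one (n := id) hM1 fun k => rfl) hΔ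
  · refine not_isNontrivial_beta_zero r sch' (fun k => ?_) (fun k => ?_) T hT
    · rw [hβ']; rfl
    · rw [ha']; exact a_le_one (sch := ultralocalScheme (YMSpecies G) hM) (n := id) hM1 (fun k => rfl) k

end Assembly

section CruxLevel

open Summit.QuantumFields.YangMills.Theses.ParabolicTrajectory

/-- **(A) without asymptotic freedom.** The crux `ContinuumLimitOnTrajectory` with the clause
`Tendsto sch.β atTop atTop` DROPPED and the tuning window `0 < θ < θ₀` widened to `0 ≤ θ < θ₀`
(everything else verbatim). It implies the crux (`crux_of_withoutAF`) and it is FALSE as soon as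
one compact simple Lie group is instantiable (`not_withoutAF`): any proof of (A) must use the
pair {`β_k → ∞`, `θ > 0`} — this pair is exactly what excludes the ultralocal phase `β ≡ 0`. -/
def ContinuumLimitOnTrajectoryWithoutAF : Prop :=
  ∀ (G : Type) [Group G] [TopologicalSpace G] [IsTopologicalGroup G] [CompactSpace G],
    IsCompactSimpleLieGroup G →
      letI : MeasurableSpace G := borel G
      haveI : BorelSpace G := ⟨rfl⟩
      ∀ (r : LatticeRep G), ∃ M₀ : ℕ, ∀ M : ℕ, M₀ ≤ M → 2 ≤ M → ∃ θ₀ : ℝ, 0 < θ₀ ∧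
        ∀ (θ Δ : ℝ) (sch : SpeciesScheme (YMSpecies G)) (n : ℕ → ℕ),
          0 ≤ θ → θ < θ₀ → 0 < Δ → (∀ k, sch.a k = ((M : ℝ) ^ n k)⁻¹) →
          (∀ t : ℕ, 0 < t → ∃ c : ℝ, Tendsto (fun k => ((M : ℝ) ^ n k) ^ 8 *
            latticeConnectedCorr r.ρ (sch.β k) (sch.side k) r.curvature.F r.curvature.F
              (t * M ^ n k)) atTop (𝓝 c)) →
          Tendsto (fun k => ((M : ℝ) ^ n k) ^ 8 *
            latticeConnectedCorr r.ρ (sch.β k) (sch.side k) r.curvature.F r.curvature.F (M ^ n k))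
              atTop (𝓝 θ) →
          HasLatticeMassGap r sch Δ →
            ∃ sch' : SpeciesScheme (YMSpecies G), sch'.a = sch.a ∧ sch'.β = sch.β ∧ sch'.L = sch.L ∧
              ∃ T : OSData (YMSpecies G) 4,
                IsYangMillsFor r sch' T ∧ T.IsNontrivial r.curvature ∧ T.IsNonGaussian r.curvature

/-- The weakened statement implies the crux (it quantifies over more schemes). -/
theorem crux_of_withoutAF (h : ContinuumLimitOnTrajectoryWithoutAF) : ContinuumLimitOnTrajectory := by
  intro G _ _ _ _ hG r
  obtain ⟨M₀, hM₀⟩ := h G hG r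
  refine ⟨M₀, fun M hM h2 => ?_⟩
  obtain ⟨θ₀, hθ₀, hθ⟩ := hM₀ M hM h2
  exact ⟨θ₀, hθ₀, fun θ Δ sch n h0 h1 hΔ ha _ hconv htune hgap =>
    hθ θ Δ sch n h0.le h1 hΔ ha hconv htune hgap⟩

/-- **Load-bearing pair {AF clause, `θ > 0`}: the weakened statement is false** for every
instantiable compact simple Lie group — refuted by the ultralocal scheme `β ≡ 0`
(`ultralocal_counterexample`): all its hypotheses hold (with `θ = 0`, any `Δ > 0`), and its
conclusion fails for every renormalisation. -/
theorem not_withoutAF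
    (hex : ∃ (G : Type) (_ : Group G) (_ : TopologicalSpace G) (_ : IsTopologicalGroup G)
      (_ : CompactSpace G), IsCompactSimpleLieGroup G) :
    ¬ ContinuumLimitOnTrajectoryWithoutAF := by
  intro h
  obtain ⟨G, _, _, _, _, hG⟩ := hex
  letI : MeasurableSpace G := borel G
  haveI : BorelSpace G := ⟨rfl⟩
  obtain ⟨r⟩ := hG.2
  obtain ⟨M₀, hM₀⟩ := h G hG r
  obtain ⟨θ₀, hθ₀, hθ⟩ := hM₀ (max M₀ 2) (le_max_left _ _) (le_max_right _ _)
  obtain ⟨sch, n, ha, hβ, hconv, htune, hgap, hno⟩ :=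
    ultralocal_counterexample r (M := max M₀ 2) (le_max_right _ _)
  obtain ⟨sch', ha', hβ', -, T, hYM, hNT, -⟩ := hθ 0 1 sch n le_rfl hθ₀ one_pos ha
    (fun t ht => ⟨0, hconv t ht⟩) htune (hgap 1 zero_le_one)
  exact hno sch' ha' hβ' T hYM hNT

/-- **Corollary (modulo the tree's named fact that `SU(n)`, `n ≥ 2`, is simple):** the weakened
statement is false, witnessed on `G = SU(2)` with its fundamental representation. -/
theorem not_withoutAF_of_SU (h : isSimpleCompactGroup_specialUnitaryGroup.{0}) :
    ¬ ContinuumLimitOnTrajectoryWithoutAF :=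
  not_withoutAF ⟨Matrix.specialUnitaryGroup (Fin 2) ℂ, inferInstance, inferInstance, inferInstance,
    inferInstance, isCompactSimpleLieGroup_specialUnitaryGroup h le_rfl⟩

/-- **(gen 3) UNCONDITIONAL:** the tree discharges the named fact
(`isSimpleCompactGroup_specialUnitaryGroup_holds`, `GaugeGroupsProofs`), so (A) without the pair
{AF clause, `θ > 0`} is false outright — witnessed on `G = SU(2)`, ultralocal scheme `β ≡ 0`.
(Landed form: `Negative.continuumLimitOnTrajectory_false_without_AF`.) -/
theorem not_withoutAF_unconditional : ¬ ContinuumLimitOnTrajectoryWithoutAF :=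
  not_withoutAF_of_SU isSimpleCompactGroup_specialUnitaryGroup_holds

end CruxLevel

end Ultralocal


/-! # Gen 3 (cycle 3): rigidity, universality, decorations, the E1 burden -/

section Gen3

open Complex
open scoped SchwartzMap ComplexConjugate
open Literature.MathematicalPhysics.QuantumLattice
open Literature.MathematicalPhysics.AQFT (IsOffDiagonal)
open Literature.Probability.LatticeModels (box)
open Summit.QuantumFields.YangMills.Theorems.ContinuumLimitOnTrajectory.Negative

local notation "𝔼" => EuclideanSpace ℝ (Fin 4)

/-! ## §4 Rigidity of the witness: what the species renormalisation can and cannot do -/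

section Affine

variable {G : Type} [MeasurableSpace G]

/-- **The smeared field is affine in the renormalisation constants**:
`Φ_{c,m}(f) = c · Φ_{1,0}(f) - c m a⁴ ∑_{x ∈ Λ} f(a x)`. [folklore] -/
theorem smearedLatticeField_affine (O : LGConfig 4 G → ℝ)
    (Λ : Finset (Literature.Probability.LatticeModels.Site 4)) (a c m : ℝ) (f : 𝓢(𝔼, ℝ))
    (U : LGConfig 4 G) :
    smearedLatticeField O Λ a c m f U =
      c * smearedLatticeField O Λ a 1 0 f U - c * m * a ^ 4 * ∑ x ∈ Λ, f (a • siteToE x) := by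
  simp only [smearedLatticeField, Finset.mul_sum, one_mul, sub_zero]
  rw [← Finset.sum_sub_distrib]
  exact Finset.sum_congr rfl fun x _ => by ring

end Affine

section Covariance

variable {Ω : Type*} [MeasurableSpace Ω] (μ : Measure Ω) [IsProbabilityMeasure μ]

/-- The covariance of two real random variables (connected two-point function). [folklore] -/
def cov (X Y : Ω → ℝ) : ℝ := (∫ ω, X ω * Y ω ∂μ) - (∫ ω, X ω ∂μ) * ∫ ω, Y ω ∂μ

/-- **Affine maps act on covariances by `c²`; the shifts drop out.** [folklore] -/
theorem cov_affine {X Y : Ω → ℝ} (hX : Integrable X μ) (hY : Integrable Y μ)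
    (hXY : Integrable (fun ω => X ω * Y ω) μ) (c d d' : ℝ) :
    cov μ (fun ω => c * X ω + d) (fun ω => c * Y ω + d') = c ^ 2 * cov μ X Y := by
  unfold cov
  have h1 : ∀ ω, (c * X ω + d) * (c * Y ω + d') =
      c ^ 2 * (X ω * Y ω) + c * d' * X ω + c * d * Y ω + d * d' := fun ω => by ring
  simp_rw [h1]
  rw [integral_add, integral_add, integral_add, integral_const_mul, integral_const_mul,
    integral_const_mul, integral_const, integral_add, integral_const_mul, integral_const,
    integral_add, integral_const_mul, integral_const]
  · simp only [probReal_univ, one_smul]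
    ring
  · exact hY.const_mul c
  · exact integrable_const _
  · exact hX.const_mul c
  · exact integrable_const _
  · exact hXY.const_mul _
  · exact hX.const_mul _
  · exact (hXY.const_mul _).add (hX.const_mul _)
  · exact hY.const_mul _
  · exact ((hXY.const_mul _).add (hX.const_mul _)).add (hY.const_mul _)
  · exact integrable_const _

/-- The same with subtractive shifts. [folklore] -/
theorem cov_affine_sub {X Y : Ω → ℝ} (hX : Integrable X μ) (hY : Integrable Y μ)
    (hXY : Integrable (fun ω => X ω * Y ω) μ) (c e e' : ℝ) :
    cov μ (fun ω => c * X ω - e) (fun ω => c * Y ω - e') = c ^ 2 * cov μ X Y := by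
  simp only [sub_eq_add_neg]
  exact cov_affine μ hX hY hXY c (-e) (-e')

end Covariance

section Kernel

variable {G : Type} [Group G] [TopologicalSpace G] [IsTopologicalGroup G] [CompactSpace G]
  [MeasurableSpace G] [BorelSpace G] {N : ℕ}

/-- Continuous functions of the torus gauge field are integrable for Wilson's measure (a
probability measure; `G` is second countable through the faithful representation `r`). [folklore] -/
theorem integrable_wilson (r : LatticeRep G) {S : ℕ} [NeZero S] (β : ℝ) {F : GaugeConfig 4 S G → ℝ}
    (hF : Continuous F) : Integrable F (wilsonMeasure (d := 4) (L := S) r.ρ β) := by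
  haveI : SecondCountableTopology G :=
    (r.continuous.isClosedEmbedding r.injective).isEmbedding.secondCountableTopology
  haveI := isProbabilityMeasure_wilsonMeasure (d := 4) (L := S) r.ρ r.continuous β
  obtain ⟨C, hC⟩ := isCompact_univ.exists_bound_of_continuousOn hF.continuousOn
  exact Integrable.of_bound hF.aestronglyMeasurable C (ae_of_all _ fun x => hC x (Set.mem_univ x))

/-- **The unit-normalised smeared curvature field** `Φ_{1,0}(f)` (`c = 1`, `m = 0`) on the torus of
side `2L+1` at spacing `a`, as a function of the torus configuration. [folklore] -/
def unitField (ρ : G →* Matrix (Fin N) (Fin N) ℂ) (a : ℝ) (L : ℕ) (f : 𝓢(𝔼, ℝ))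
    (U : GaugeConfig 4 (2 * L + 1) G) : ℝ :=
  smearedLatticeField (actionDensity ρ) (box 4 L) a 1 0 f (torusLift (2 * L + 1) U)

/-- **The unit-normalised connected two-point kernel** of the lattice curvature field,
`K_{a,β,L}(u, v) = ⟨Φ_{1,0}(u) Φ_{1,0}(v)⟩ - ⟨Φ_{1,0}(u)⟩⟨Φ_{1,0}(v)⟩` under Wilson's measure at
coupling `β` on the torus of side `2L+1`: a function of the bare data `(a, β, L)` ALONE — no
renormalisation constant enters. [folklore] -/
def twoPointKernel (ρ : G →* Matrix (Fin N) (Fin N) ℂ) (a β : ℝ) (L : ℕ) (u v : 𝓢(𝔼, ℝ)) : ℝ :=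
  cov (wilsonMeasure (d := 4) (L := 2 * L + 1) ρ β) (unitField ρ a L u) (unitField ρ a L v)

omit [CompactSpace G] [BorelSpace G] in
theorem continuous_unitField {ρ : G →* Matrix (Fin N) (Fin N) ℂ} (hρ : Continuous ρ) (a : ℝ) (L : ℕ)
    (f : 𝓢(𝔼, ℝ)) : Continuous (unitField ρ a L f) := by
  unfold unitField
  simp only [smearedLatticeField_torusLift]
  exact continuous_const.mul (continuous_finsetSum _ fun x _ =>
    continuous_const.mul ((continuous_torusDensity ρ hρ _ _).sub continuous_const))

/-- **`m`-invisibility and `c²`-scaling.** Along ANY scheme, the connected lattice two-point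
function of the renormalised curvature field is `c_k²` times the unit-normalised kernel at the
scheme's bare data `(a_k, β_k, L_k)`; the additive counterterm `m_k` does not enter. [folklore] -/
theorem latticeSchwinger_conn_two_eq (r : LatticeRep G) (sch : SpeciesScheme (YMSpecies G)) (k : ℕ)
    (u v : 𝓢(𝔼, ℝ)) :
    latticeSchwinger r.ρ sch (fun s => s.F) k (1 + 1) (fun _ => r.curvature) ![u, v] -
        latticeSchwinger r.ρ sch (fun s => s.F) k 1 (fun _ => r.curvature) ![u] *
          latticeSchwinger r.ρ sch (fun s => s.F) k 1 (fun _ => r.curvature) ![v] =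
      (sch.c r.curvature k) ^ 2 * twoPointKernel r.ρ (sch.a k) (sch.β k) (sch.L k) u v := by
  haveI := isProbabilityMeasure_wilsonMeasure (d := 4) (L := sch.side k) r.ρ r.continuous (sch.β k)
  rw [latticeSchwinger_two, latticeSchwinger_one, latticeSchwinger_one]
  set e : 𝓢(𝔼, ℝ) → ℝ := fun f => sch.c r.curvature k * sch.m r.curvature k * sch.a k ^ 4 *
      ∑ x ∈ box 4 (sch.L k), f (sch.a k • siteToE x) with he
  have hΦ : ∀ (f : 𝓢(𝔼, ℝ)) (U : GaugeConfig 4 (sch.side k) G),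
      smearedLatticeField (actionDensity r.ρ) (box 4 (sch.L k)) (sch.a k) (sch.c r.curvature k)
        (sch.m r.curvature k) f (torusLift (sch.side k) U) =
      sch.c r.curvature k * unitField r.ρ (sch.a k) (sch.L k) f U - e f := fun f U => by
    rw [smearedLatticeField_affine]; rfl
  simp_rw [hΦ]
  have hu := continuous_unitField (ρ := r.ρ) r.continuous (sch.a k) (sch.L k) u
  have hv := continuous_unitField (ρ := r.ρ) r.continuous (sch.a k) (sch.L k) v
  exact cov_affine_sub (wilsonMeasure (d := 4) (L := sch.side k) r.ρ (sch.β k))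
    (X := unitField r.ρ (sch.a k) (sch.L k) u) (Y := unitField r.ρ (sch.a k) (sch.L k) v)
    (integrable_wilson r _ hu) (integrable_wilson r _ hv)
    (integrable_wilson r _ (hu.mul hv)) (sch.c r.curvature k) (e u) (e v)

/-- The kernel depends on the scheme only through `(a, β, L)`. [folklore] -/
theorem twoPointKernel_congr {sch sch' : SpeciesScheme (YMSpecies G)} (ha : sch'.a = sch.a)
    (hβ : sch'.β = sch.β) (hL : sch'.L = sch.L) (ρ : G →* Matrix (Fin N) (Fin N) ℂ) (k : ℕ)
    (u v : 𝓢(𝔼, ℝ)) :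
    twoPointKernel ρ (sch'.a k) (sch'.β k) (sch'.L k) u v =
      twoPointKernel ρ (sch.a k) (sch.β k) (sch.L k) u v := by
  rw [ha, hβ, hL]

end Kernel

section Truncated

open Literature.MathematicalPhysics.AQFT (IsOffDiagonal coincidenceLocus)

variable {ι : Type}

/-- The truncated (connected) continuum two-point function of the species `s` of the OS datum
`T` on the real product tensor `u ⊗ v`. [folklore] -/
def S2T (T : OSData ι 4) (s : ι) (u v : 𝓢(𝔼, ℝ)) : ℂ :=
  T.schwinger (1 + 1) (fun _ => s) (T2 u v) -
    T.schwinger 1 (fun _ => s) (T1 u) * T.schwinger 1 (fun _ => s) (T1 v)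

/-- **Non-triviality is witnessed by a REAL time-separated pair.** If `T.IsNontrivial s` then some
real test functions `u` (negative times) and `v` (positive times) have non-vanishing truncated
two-point function `𝔖₂ᵀ(u ⊗ v) ≠ 0`. (Decompose the complex witness `Θ F̄ ⊗ G` into four real
time-separated product tensors.) [folklore] -/
theorem exists_truncated_ne_zero_of_isNontrivial (T : OSData ι 4) (s : ι) (hT : T.IsNontrivial s) :
    ∃ u v : 𝓢(𝔼, ℝ), tsupport (u : 𝔼 → ℝ) ⊆ {z | z 0 < 0} ∧ tsupport (v : 𝔼 → ℝ) ⊆ {z | 0 < z 0} ∧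
      S2T T s u v ≠ 0 := by
  by_contra hall
  push Not at hall
  obtain ⟨F, Gt, H, hF, hG, hH, hne⟩ := hT
  apply hne
  have fact : ∀ {u v : 𝓢(𝔼, ℝ)}, tsupport (u : 𝔼 → ℝ) ⊆ {z | z 0 < 0} →
      tsupport (v : 𝔼 → ℝ) ⊆ {z | 0 < z 0} →
        T.schwinger (1 + 1) (fun _ => s) (T2 u v) =
          T.schwinger 1 (fun _ => s) (T1 u) * T.schwinger 1 (fun _ => s) (T1 v) :=
    fun hu hv => sub_eq_zero.1 (hall _ _ hu hv)
  set φ := toOne (osAdjoint F) with hφ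
  set ψ := toOne Gt with hψ
  have huR : tsupport (reTest φ : 𝔼 → ℝ) ⊆ {z | z 0 < 0} :=
    (tsupport_reTest_subset φ).trans (tsupport_toOne_osAdjoint_subset hF)
  have huI : tsupport (imTest φ : 𝔼 → ℝ) ⊆ {z | z 0 < 0} :=
    (tsupport_imTest_subset φ).trans (tsupport_toOne_osAdjoint_subset hF)
  have hvR : tsupport (reTest ψ : 𝔼 → ℝ) ⊆ {z | 0 < z 0} :=
    (tsupport_reTest_subset ψ).trans (tsupport_toOne_subset hG)
  have hvI : tsupport (imTest ψ : 𝔼 → ℝ) ⊆ {z | 0 < z 0} :=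
    (tsupport_imTest_subset ψ).trans (tsupport_toOne_subset hG)
  have e1 : osAdjoint F = T1 (reTest φ) + I • T1 (imTest φ) := by
    ext y
    rw [apply_eq_toOne, add_apply, smul_apply, T1_apply, T1_apply,
      smul_eq_mul, ← reTest_add_imTest_mul_I φ (y 0)]
    ring
  have e2 : Gt = T1 (reTest ψ) + I • T1 (imTest ψ) := by
    ext y
    rw [apply_eq_toOne, add_apply, smul_apply, T1_apply, T1_apply,
      smul_eq_mul, ← reTest_add_imTest_mul_I ψ (y 0)]
    ring
  have e3 : H = T2 (reTest φ) (reTest ψ) - T2 (imTest φ) (imTest ψ) +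
      I • T2 (reTest φ) (imTest ψ) + I • T2 (imTest φ) (reTest ψ) := by
    ext x
    rw [hH x, apply_eq_toOne, apply_eq_toOne Gt]
    simp only [add_apply, sub_apply, smul_apply, T2_apply,
      smul_eq_mul, Function.comp_apply]
    rw [show Fin.castAdd 1 (0 : Fin 1) = (0 : Fin (1 + 1)) from rfl,
      show Fin.natAdd 1 (0 : Fin 1) = (1 : Fin (1 + 1)) from rfl,
      ← reTest_add_imTest_mul_I φ (x 0), ← reTest_add_imTest_mul_I ψ (x 1)]
    linear_combination ((imTest φ (x 0) : ℂ) * (imTest ψ (x 1) : ℂ)) * Complex.I_sq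
  rw [e3, e1, e2]
  simp only [map_add, map_sub, map_smul, smul_eq_mul]
  rw [fact huR hvR, fact huI hvI, fact huR hvI, fact huI hvR]
  linear_combination (-((T.schwinger 1 fun _ => s) (T1 (imTest φ)) *
    (T.schwinger 1 fun _ => s) (T1 (imTest ψ)))) * Complex.I_sq

/-- Support of the one-variable tensor of a real test function. [folklore] -/
theorem tsupport_T1_subset (u : 𝓢(𝔼, ℝ)) :
    tsupport (T1 u : (Fin 1 → 𝔼) → ℂ) ⊆ {x | x 0 ∈ tsupport (u : 𝔼 → ℝ)} := by
  have hcoe : (T1 u : (Fin 1 → 𝔼) → ℂ) = (fun e : 𝔼 => ((u e : ℝ) : ℂ)) ∘ fun x : Fin 1 → 𝔼 => x 0 :=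
    funext fun x => T1_apply u x
  rw [hcoe]
  refine (_root_.tsupport_comp_subset_preimage _ (continuous_apply 0)).trans fun x hx => ?_
  exact (tsupport_comp_subset ofReal_zero (u : 𝔼 → ℝ)) hx

/-- Support of the OS adjoint of the one-variable tensor of a real test function. [folklore] -/
theorem tsupport_osAdjoint_T1_subset (u : 𝓢(𝔼, ℝ)) :
    tsupport (osAdjoint (T1 u) : (Fin 1 → 𝔼) → ℂ) ⊆
      {x | timeReflection 4 (x 0) ∈ tsupport (u : 𝔼 → ℝ)} := by
  have hcoe : (osAdjoint (T1 u) : (Fin 1 → 𝔼) → ℂ) =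
      (fun e : 𝔼 => conj ((u e : ℝ) : ℂ)) ∘ fun x : Fin 1 → 𝔼 => timeReflection 4 (x 0) := by
    funext x
    rw [Function.comp_apply, osAdjoint_apply, T1_apply, Subsingleton.elim (Fin.rev (0 : Fin 1)) 0]
  rw [hcoe]
  refine (_root_.tsupport_comp_subset_preimage _
    ((timeReflection 4).continuous.comp (continuous_apply 0))).trans fun x hx => ?_
  have h1 : tsupport (fun e : 𝔼 => conj ((u e : ℝ) : ℂ)) ⊆ tsupport (u : 𝔼 → ℝ) :=
    (tsupport_comp_subset (g := fun z : ℂ => conj z) (map_zero _) _).trans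
      (tsupport_comp_subset ofReal_zero (u : 𝔼 → ℝ))
  exact h1 hx

/-- The OS adjoint is an involution (pointwise proof; the tree's `osAdjoint_osAdjoint` lives in
`SchwingerOSCluster`, not imported here). [folklore] -/
theorem osAdjoint_osAdjoint_eq {n d : ℕ} [NeZero d] (F : 𝓢((Fin n → EuclideanSpace ℝ (Fin d)), ℂ)) :
    osAdjoint (osAdjoint F) = F := by
  ext x; simp [osAdjoint_apply, timeReflection_timeReflection, Fin.rev_rev]

/-- **Conversely, a real time-separated pair with `𝔖₂ᵀ ≠ 0` witnesses `IsNontrivial`**: so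
`T.IsNontrivial s ↔ ∃` real `u` (negative times), `v` (positive times) with `𝔖₂ᵀ(u ⊗ v) ≠ 0`. [folklore] -/
theorem isNontrivial_of_truncated_ne_zero (T : OSData ι 4) (s : ι) {u v : 𝓢(𝔼, ℝ)}
    (hu : tsupport (u : 𝔼 → ℝ) ⊆ {z | z 0 < 0}) (hv : tsupport (v : 𝔼 → ℝ) ⊆ {z | 0 < z 0})
    (hne : S2T T s u v ≠ 0) : T.IsNontrivial s := by
  have hmono : ∀ x : Fin 1 → 𝔼, StrictMono fun i : Fin 1 => x i 0 := fun x a b hab =>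
    absurd hab (by rw [Subsingleton.elim a b]; exact lt_irrefl _)
  refine ⟨osAdjoint (T1 u), T1 v, T2 u v, fun x hx => ⟨fun i => ?_, hmono x⟩,
    fun x hx => ⟨fun i => ?_, hmono x⟩, fun x => ?_, ?_⟩
  · have h := hu (tsupport_osAdjoint_T1_subset u hx)
    simp only [Set.mem_setOf_eq, timeReflection_apply, ↓reduceIte] at h
    rw [Subsingleton.elim i 0]; linarith
  · have h := hv (tsupport_T1_subset v hx)
    rw [Subsingleton.elim i 0]; exact h
  · rw [osAdjoint_osAdjoint_eq, T2_apply, T1_apply, T1_apply]; rfl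
  · rw [osAdjoint_osAdjoint_eq]; exact sub_ne_zero.1 hne

/-- **Characterisation of non-triviality by real time-separated pairs.** [folklore] -/
theorem isNontrivial_iff_exists_truncated_ne_zero (T : OSData ι 4) (s : ι) :
    T.IsNontrivial s ↔ ∃ u v : 𝓢(𝔼, ℝ), tsupport (u : 𝔼 → ℝ) ⊆ {z | z 0 < 0} ∧
      tsupport (v : 𝔼 → ℝ) ⊆ {z | 0 < z 0} ∧ S2T T s u v ≠ 0 :=
  ⟨exists_truncated_ne_zero_of_isNontrivial T s, fun ⟨_, _, hu, hv, hne⟩ =>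
    isNontrivial_of_truncated_ne_zero T s hu hv hne⟩

end Truncated

section Limits

variable {G : Type} [Group G] [TopologicalSpace G] [IsTopologicalGroup G] [CompactSpace G]
  [MeasurableSpace G] [BorelSpace G]

/-- **The witness's connected two-point function is the limit of `c_k² K_k`.** For OS data tied
to the scheme by `IsYangMillsFor`, on every off-diagonal real product tensor
`c_k² K_{a_k,β_k,L_k}(u, v) → 𝔖₂ᵀ(u ⊗ v)`. [folklore] -/
theorem tendsto_c_sq_mul_kernel (r : LatticeRep G) (sch : SpeciesScheme (YMSpecies G))
    (T : OSData (YMSpecies G) 4) (hT : IsYangMillsFor r sch T) {u v : 𝓢(𝔼, ℝ)}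
    (huv : IsOffDiagonal (T2 u v)) :
    Tendsto (fun k => (((sch.c r.curvature k) ^ 2 *
        twoPointKernel r.ρ (sch.a k) (sch.β k) (sch.L k) u v : ℝ) : ℂ)) atTop
      (𝓝 (S2T T r.curvature u v)) := by
  have h2 := hT (1 + 1) (by norm_num) (fun _ => r.curvature) ![u, v] (T2 u v) (isTensorOf_T2 u v)
    huv
  have hu := hT 1 one_ne_zero (fun _ => r.curvature) ![u] (T1 u) (isTensorOf_T1 u)
    (isOffDiagonal_one _)
  have hv := hT 1 one_ne_zero (fun _ => r.curvature) ![v] (T1 v) (isTensorOf_T1 v)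
    (isOffDiagonal_one _)
  refine (h2.sub (hu.mul hv)).congr' (Eventually.of_forall fun k => ?_)
  rw [← ofReal_mul, ← ofReal_sub, latticeSchwinger_conn_two_eq]

/-- **`c_k ≠ 0` and `K_k(u₀, v₀) ≠ 0` eventually** as soon as `𝔖₂ᵀ(u₀ ⊗ v₀) ≠ 0`. [folklore] -/
theorem eventually_c_ne_zero_and_kernel_ne_zero (r : LatticeRep G) (sch : SpeciesScheme (YMSpecies G))
    (T : OSData (YMSpecies G) 4) (hT : IsYangMillsFor r sch T) {u₀ v₀ : 𝓢(𝔼, ℝ)}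
    (h₀ : IsOffDiagonal (T2 u₀ v₀)) (hne : S2T T r.curvature u₀ v₀ ≠ 0) :
    ∀ᶠ k in atTop, sch.c r.curvature k ≠ 0 ∧
      twoPointKernel r.ρ (sch.a k) (sch.β k) (sch.L k) u₀ v₀ ≠ 0 := by
  have h := (tendsto_c_sq_mul_kernel r sch T hT h₀).eventually (isOpen_ne.mem_nhds hne)
  filter_upwards [h] with k hk
  have hk' : (sch.c r.curvature k) ^ 2 * twoPointKernel r.ρ (sch.a k) (sch.β k) (sch.L k) u₀ v₀ ≠ 0 := by
    intro h0; apply hk; simp only [h0, ofReal_zero]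
  exact ⟨fun h0 => hk' (by rw [h0]; ring), fun h0 => hk' (by rw [h0]; ring)⟩

/-- **Witness-free ratio convergence.** If `𝔖₂ᵀ(u₀ ⊗ v₀) ≠ 0`, the RATIOS of unit-normalised
lattice kernels converge: `K_k(u, v) / K_k(u₀, v₀) → 𝔖₂ᵀ(u ⊗ v) / 𝔖₂ᵀ(u₀ ⊗ v₀)` for every
off-diagonal real pair — a statement about Wilson lattice expectations alone, in which no
renormalisation constant appears. [folklore] -/
theorem tendsto_kernel_ratio (r : LatticeRep G) (sch : SpeciesScheme (YMSpecies G))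
    (T : OSData (YMSpecies G) 4) (hT : IsYangMillsFor r sch T) {u₀ v₀ u v : 𝓢(𝔼, ℝ)}
    (h₀ : IsOffDiagonal (T2 u₀ v₀)) (hne : S2T T r.curvature u₀ v₀ ≠ 0)
    (huv : IsOffDiagonal (T2 u v)) :
    Tendsto (fun k => ((twoPointKernel r.ρ (sch.a k) (sch.β k) (sch.L k) u v /
        twoPointKernel r.ρ (sch.a k) (sch.β k) (sch.L k) u₀ v₀ : ℝ) : ℂ)) atTop
      (𝓝 (S2T T r.curvature u v / S2T T r.curvature u₀ v₀)) := by
  have hA := tendsto_c_sq_mul_kernel r sch T hT huv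
  have hB := tendsto_c_sq_mul_kernel r sch T hT h₀
  refine (hA.div hB hne).congr' ?_
  filter_upwards [eventually_c_ne_zero_and_kernel_ne_zero r sch T hT h₀ hne] with k hk
  rw [Pi.div_apply, ← ofReal_div, mul_div_mul_left _ _ (pow_ne_zero 2 hk.1)]

/-- **Uniqueness of the continuum limit up to scale (two-point sector).** Two OS data tied by
`IsYangMillsFor` to schemes with the SAME bare data `(a, β, L)` (arbitrary, possibly different
renormalisations), the first non-trivial in `tr F²`, have PROPORTIONAL truncated two-point
functions of `tr F²` on all off-diagonal real product tensors: `𝔖'₂ᵀ = ρ · 𝔖₂ᵀ`. The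
multiplicative renormalisation is determined up to `o(1)` by the bare sequence; the `∃ T` of the
crux is secretly "`∃! T` up to field rescaling" on the sector pinned by the lattice. [folklore] -/
theorem truncated_two_unique_up_to_scale (r : LatticeRep G) {sch sch' : SpeciesScheme (YMSpecies G)}
    (ha : sch'.a = sch.a) (hβ : sch'.β = sch.β) (hL : sch'.L = sch.L)
    {T T' : OSData (YMSpecies G) 4} (hT : IsYangMillsFor r sch T) (hT' : IsYangMillsFor r sch' T')
    (hNT : T.IsNontrivial r.curvature) :
    ∃ ρ : ℂ, ∀ u v : 𝓢(𝔼, ℝ), IsOffDiagonal (T2 u v) →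
      S2T T' r.curvature u v = ρ * S2T T r.curvature u v := by
  obtain ⟨u₀, v₀, hu₀, hv₀, hne⟩ := exists_truncated_ne_zero_of_isNontrivial T r.curvature hNT
  have h₀ : IsOffDiagonal (T2 u₀ v₀) := isOffDiagonal_T2 hu₀ hv₀
  refine ⟨S2T T' r.curvature u₀ v₀ / S2T T r.curvature u₀ v₀, fun u v huv => ?_⟩
  have hA' := tendsto_c_sq_mul_kernel r sch' T' hT' huv
  have hB' := tendsto_c_sq_mul_kernel r sch' T' hT' h₀
  have hA := tendsto_c_sq_mul_kernel r sch T hT huv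
  have hB := tendsto_c_sq_mul_kernel r sch T hT h₀
  simp only [ha, hβ, hL] at hA' hB'
  have hlim := hB'.mul (hA.div hB hne)
  have heq : (fun k => (((sch'.c r.curvature k) ^ 2 *
      twoPointKernel r.ρ (sch.a k) (sch.β k) (sch.L k) u v : ℝ) : ℂ)) =ᶠ[atTop]
      fun k => (((sch'.c r.curvature k) ^ 2 *
        twoPointKernel r.ρ (sch.a k) (sch.β k) (sch.L k) u₀ v₀ : ℝ) : ℂ) *
      ((fun k => (((sch.c r.curvature k) ^ 2 *
        twoPointKernel r.ρ (sch.a k) (sch.β k) (sch.L k) u v : ℝ) : ℂ)) /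
       (fun k => (((sch.c r.curvature k) ^ 2 *
        twoPointKernel r.ρ (sch.a k) (sch.β k) (sch.L k) u₀ v₀ : ℝ) : ℂ))) k := by
    filter_upwards [eventually_c_ne_zero_and_kernel_ne_zero r sch T hT h₀ hne] with k hk
    have h1 : (sch.c r.curvature k : ℂ) ≠ 0 := ofReal_ne_zero.2 hk.1
    have h2 : (twoPointKernel r.ρ (sch.a k) (sch.β k) (sch.L k) u₀ v₀ : ℂ) ≠ 0 :=
      ofReal_ne_zero.2 hk.2
    simp only [Pi.div_apply]
    push_cast
    field_simp
  have huniq := tendsto_nhds_unique hA' (hlim.congr' heq.symm)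
  rw [huniq]
  field_simp

/-- If the second datum is non-trivial too, the proportionality constant is nonzero. [folklore] -/
theorem scale_ne_zero (r : LatticeRep G) {T T' : OSData (YMSpecies G) 4} {ρ : ℂ}
    (hρ : ∀ u v : 𝓢(𝔼, ℝ), IsOffDiagonal (T2 u v) → S2T T' r.curvature u v = ρ * S2T T r.curvature u v)
    (hNT' : T'.IsNontrivial r.curvature) : ρ ≠ 0 := by
  obtain ⟨u, v, hu, hv, hne⟩ := exists_truncated_ne_zero_of_isNontrivial T' r.curvature hNT'
  rintro rfl
  exact hne (by rw [hρ u v (isOffDiagonal_T2 hu hv), zero_mul])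

end Limits

/-! ## §5 Interleaving: the universality content of the `∀`-over-sequences quantifier -/

section InterleaveFun

variable {α : Type*}

/-- Interleaving of two sequences: even indices from `f`, odd indices from `g`. [folklore] -/
def interleaveFun (f g : ℕ → α) (k : ℕ) : α := if Even k then f (k / 2) else g (k / 2)

@[simp] theorem interleaveFun_two_mul (f g : ℕ → α) (j : ℕ) : interleaveFun f g (2 * j) = f j := by
  simp [interleaveFun]

@[simp] theorem interleaveFun_two_mul_add_one (f g : ℕ → α) (j : ℕ) :
    interleaveFun f g (2 * j + 1) = g j := by
  have h1 : ¬ Even (2 * j + 1) := Nat.not_even_iff_odd.2 (odd_two_mul_add_one j)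
  have h2 : (2 * j + 1) / 2 = j := by omega
  simp [interleaveFun, h1, h2]

/-- Interleaving commutes with pointwise operations (one sequence of data). [folklore] -/
theorem apply_interleaveFun {β : Type*} (Q : α → β) (f g : ℕ → α) (k : ℕ) :
    Q (interleaveFun f g k) = interleaveFun (fun j => Q (f j)) (fun j => Q (g j)) k := by
  unfold interleaveFun; split_ifs <;> rfl

/-- Interleaving commutes with pointwise operations (three sequences of data). [folklore] -/
theorem apply₃_interleaveFun {β γ δ : Type*} (Q : α → β → γ → δ) (f₁ g₁ : ℕ → α) (f₂ g₂ : ℕ → β)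
    (f₃ g₃ : ℕ → γ) (k : ℕ) :
    Q (interleaveFun f₁ g₁ k) (interleaveFun f₂ g₂ k) (interleaveFun f₃ g₃ k) =
      interleaveFun (fun j => Q (f₁ j) (f₂ j) (f₃ j)) (fun j => Q (g₁ j) (g₂ j) (g₃ j)) k := by
  unfold interleaveFun; split_ifs <;> rfl

/-- **Limits survive interleaving** (any target filter). [folklore] -/
theorem tendsto_interleaveFun {l : Filter α} {f g : ℕ → α} (hf : Tendsto f atTop l)
    (hg : Tendsto g atTop l) : Tendsto (interleaveFun f g) atTop l := by
  rw [Filter.tendsto_def] at hf hg ⊢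
  intro s hs
  obtain ⟨N₁, h₁⟩ := mem_atTop_sets.1 (hf s hs)
  obtain ⟨N₂, h₂⟩ := mem_atTop_sets.1 (hg s hs)
  refine mem_atTop_sets.2 ⟨2 * (N₁ + N₂), fun k hk => ?_⟩
  simp only [Set.mem_preimage, interleaveFun]
  split_ifs with he
  · exact h₁ _ (by omega)
  · exact h₂ _ (by omega)

/-- **Eventual properties survive interleaving.** [folklore] -/
theorem eventually_interleaveFun {p : α → Prop} {f g : ℕ → α} (hf : ∀ᶠ j in atTop, p (f j))
    (hg : ∀ᶠ j in atTop, p (g j)) : ∀ᶠ k in atTop, p (interleaveFun f g k) :=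
  tendsto_principal.1
    (tendsto_interleaveFun (l := 𝓟 {x | p x}) (tendsto_principal.2 hf) (tendsto_principal.2 hg))

/-- Even subsequence. [folklore] -/
theorem tendsto_two_mul_atTop : Tendsto (fun j : ℕ => 2 * j) atTop atTop :=
  tendsto_atTop_mono (fun j : ℕ => show j ≤ 2 * j by omega) tendsto_id

/-- Odd subsequence. [folklore] -/
theorem tendsto_two_mul_add_one_atTop : Tendsto (fun j : ℕ => 2 * j + 1) atTop atTop :=
  tendsto_atTop_mono (fun j : ℕ => show j ≤ 2 * j + 1 by omega) tendsto_id

end InterleaveFun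

section Schemes

variable {ι : Type}

/-- **Interleaving of two scaling schemes** (even steps from `s₁`, odd steps from `s₂`): again a
scheme (`a_k → 0` and `a_k L_k → ∞` survive interleaving). [folklore] -/
def interleave (s₁ s₂ : SpeciesScheme ι) : SpeciesScheme ι where
  a := interleaveFun s₁.a s₂.a
  a_pos _ := by unfold interleaveFun; split_ifs <;> exact SpeciesScheme.a_pos _ _
  tendsto_a := tendsto_interleaveFun s₁.tendsto_a s₂.tendsto_a
  β := interleaveFun s₁.β s₂.β
  L := interleaveFun s₁.L s₂.L
  tendsto_L := by
    have h : (fun k => interleaveFun s₁.a s₂.a k * ((interleaveFun s₁.L s₂.L k : ℕ) : ℝ)) =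
        interleaveFun (fun k => s₁.a k * s₁.L k) (fun k => s₂.a k * s₂.L k) := by
      funext k; unfold interleaveFun; split_ifs <;> rfl
    rw [h]
    exact tendsto_interleaveFun s₁.tendsto_L s₂.tendsto_L
  c s := interleaveFun (s₁.c s) (s₂.c s)
  m s := interleaveFun (s₁.m s) (s₂.m s)

/-- **Reindexing a scheme along `φ → ∞`** (e.g. the even or odd steps). [folklore] -/
def reindex (sch : SpeciesScheme ι) (φ : ℕ → ℕ) (hφ : Tendsto φ atTop atTop) : SpeciesScheme ι where
  a k := sch.a (φ k)
  a_pos _ := sch.a_pos _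
  tendsto_a := sch.tendsto_a.comp hφ
  β k := sch.β (φ k)
  L k := sch.L (φ k)
  tendsto_L := sch.tendsto_L.comp hφ
  c s k := sch.c s (φ k)
  m s k := sch.m s (φ k)

end Schemes

section HypInterleave

variable {G : Type} [Group G] [TopologicalSpace G] [IsTopologicalGroup G] [CompactSpace G]
  [MeasurableSpace G] [BorelSpace G]

/-- The rescaled curvature correlator as a function of plain data `(β, L, m)` (torus of side
`2L+1`, separation `sep`). [folklore] -/
def Nval (r : LatticeRep G) (M : ℕ) (β : ℝ) (L m sep : ℕ) : ℝ :=
  ((M : ℝ) ^ m) ^ 8 * latticeConnectedCorr r.ρ β (2 * L + 1) r.curvature.F r.curvature.F sep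

theorem N_eq_Nval (r : LatticeRep G) (M : ℕ) (sch : SpeciesScheme (YMSpecies G)) (n : ℕ → ℕ)
    (sep : ℕ → ℕ) (k : ℕ) :
    ((M : ℝ) ^ n k) ^ 8 *
        latticeConnectedCorr r.ρ (sch.β k) (sch.side k) r.curvature.F r.curvature.F (sep k) =
      Nval r M (sch.β k) (sch.L k) (n k) (sep k) := rfl

/-- **Two equal towers interleave.** If two sequences of rescaled correlators (any data) converge
to the same limit, so does the interleaved one. [folklore] -/
theorem tendsto_Nval_interleave (r : LatticeRep G) (M : ℕ) {β₁ β₂ : ℕ → ℝ} {L₁ L₂ n₁ n₂ : ℕ → ℕ}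
    (sep : ℕ → ℕ) {c : ℝ}
    (h₁ : Tendsto (fun j => Nval r M (β₁ j) (L₁ j) (n₁ j) (sep (n₁ j))) atTop (𝓝 c))
    (h₂ : Tendsto (fun j => Nval r M (β₂ j) (L₂ j) (n₂ j) (sep (n₂ j))) atTop (𝓝 c)) :
    Tendsto (fun k => Nval r M (interleaveFun β₁ β₂ k) (interleaveFun L₁ L₂ k)
      (interleaveFun n₁ n₂ k) (sep (interleaveFun n₁ n₂ k))) atTop (𝓝 c) := by
  have h := tendsto_interleaveFun h₁ h₂
  refine h.congr (fun k => ?_)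
  rw [← apply₃_interleaveFun (fun b l m => Nval r M b l m (sep m))]

/-- **The hypothesis block is closed under interleaving of schemes with equal towers.** Same
`(G, r, M, θ, Δ)`; the two sequences of rescaled correlators `N_t` must have the SAME limit for
every `t` (for `t = 1` both are `θ`). [folklore] -/
theorem hyp_interleave (r : LatticeRep G) {M : ℕ} {θ Δ : ℝ} {s₁ s₂ : SpeciesScheme (YMSpecies G)}
    {n₁ n₂ : ℕ → ℕ} (h₁ : Hyp r M θ Δ s₁ n₁) (h₂ : Hyp r M θ Δ s₂ n₂)
    (htower : ∀ t : ℕ, 0 < t → ∃ c : ℝ,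
      Tendsto (fun j => ((M : ℝ) ^ n₁ j) ^ 8 *
        latticeConnectedCorr r.ρ (s₁.β j) (s₁.side j) r.curvature.F r.curvature.F (t * M ^ n₁ j))
          atTop (𝓝 c) ∧
      Tendsto (fun j => ((M : ℝ) ^ n₂ j) ^ 8 *
        latticeConnectedCorr r.ρ (s₂.β j) (s₂.side j) r.curvature.F r.curvature.F (t * M ^ n₂ j))
          atTop (𝓝 c)) :
    Hyp r M θ Δ (interleave s₁ s₂) (interleaveFun n₁ n₂) := by
  obtain ⟨hshape₁, hβ₁, -, htune₁, hgap₁⟩ := h₁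
  obtain ⟨hshape₂, hβ₂, -, htune₂, hgap₂⟩ := h₂
  refine ⟨fun k => ?_, tendsto_interleaveFun hβ₁ hβ₂, fun t ht => ?_, ?_, fun A B => ?_⟩
  · -- shape
    show interleaveFun s₁.a s₂.a k = _
    rw [apply_interleaveFun (fun m : ℕ => ((M : ℝ) ^ m)⁻¹) n₁ n₂ k]
    unfold interleaveFun; split_ifs <;> simp [hshape₁, hshape₂]
  · -- convergence of every `N_t`
    obtain ⟨c, hc₁, hc₂⟩ := htower t ht
    refine ⟨c, ?_⟩
    have hc₁' : Tendsto (fun j => Nval r M (s₁.β j) (s₁.L j) (n₁ j) (t * M ^ n₁ j)) atTop (𝓝 c) :=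
      hc₁
    have hc₂' : Tendsto (fun j => Nval r M (s₂.β j) (s₂.L j) (n₂ j) (t * M ^ n₂ j)) atTop (𝓝 c) :=
      hc₂
    exact tendsto_Nval_interleave r M (fun m => t * M ^ m) hc₁' hc₂'
  · -- tuning
    have h₁' : Tendsto (fun j => Nval r M (s₁.β j) (s₁.L j) (n₁ j) (M ^ n₁ j)) atTop (𝓝 θ) :=
      htune₁
    have h₂' : Tendsto (fun j => Nval r M (s₂.β j) (s₂.L j) (n₂ j) (M ^ n₂ j)) atTop (𝓝 θ) :=
      htune₂
    exact tendsto_Nval_interleave r M (fun m => M ^ m) h₁' h₂'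
  · -- uniform lattice gap, constant `max C₁ C₂`
    obtain ⟨C₁, hC₁⟩ := hgap₁ A B
    obtain ⟨C₂, hC₂⟩ := hgap₂ A B
    refine ⟨max C₁ C₂, ?_⟩
    have mono : ∀ {C : ℝ} {β a : ℝ} {L : ℕ}, C ≤ max C₁ C₂ →
        (∀ S : ℕ, L ≤ S → ∀ m : ℕ, m ≤ S →
          |latticeConnectedCorr r.ρ β (2 * S + 1) A.F B.F m| ≤ C * Real.exp (-(Δ * (a * m)))) →
        ∀ S : ℕ, L ≤ S → ∀ m : ℕ, m ≤ S →
          |latticeConnectedCorr r.ρ β (2 * S + 1) A.F B.F m| ≤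
            max C₁ C₂ * Real.exp (-(Δ * (a * m))) :=
      fun hC h S hS m hm => (h S hS m hm).trans
        (mul_le_mul_of_nonneg_right hC (Real.exp_pos _).le)
    set P : ℝ × ℝ × ℕ → Prop := fun p => ∀ S : ℕ, p.2.2 ≤ S → ∀ m : ℕ, m ≤ S →
        |latticeConnectedCorr r.ρ p.1 (2 * S + 1) A.F B.F m| ≤
          max C₁ C₂ * Real.exp (-(Δ * (p.2.1 * m))) with hP
    set d₁ : ℕ → ℝ × ℝ × ℕ := fun j => (s₁.β j, s₁.a j, s₁.L j) with hd₁
    set d₂ : ℕ → ℝ × ℝ × ℕ := fun j => (s₂.β j, s₂.a j, s₂.L j) with hd₂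
    have e₁ : ∀ᶠ j in atTop, P (d₁ j) := by
      filter_upwards [hC₁] with j hj
      exact mono (le_max_left _ _) hj
    have e₂ : ∀ᶠ j in atTop, P (d₂ j) := by
      filter_upwards [hC₂] with j hj
      exact mono (le_max_right _ _) hj
    have e := eventually_interleaveFun e₁ e₂
    filter_upwards [e] with k hk
    have hdata : interleaveFun d₁ d₂ k =
        ((interleave s₁ s₂).β k, (interleave s₁ s₂).a k, (interleave s₁ s₂).L k) := by
      show interleaveFun d₁ d₂ k =
        (interleaveFun s₁.β s₂.β k, interleaveFun s₁.a s₂.a k, interleaveFun s₁.L s₂.L k)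
      simp only [hd₁, hd₂, interleaveFun]; split_ifs <;> rfl
    rw [hdata] at hk
    exact hk

/-- Lattice Schwinger functions of the reindexed scheme are the reindexed ones. [folklore] -/
theorem latticeSchwinger_reindex (r : LatticeRep G) (sch : SpeciesScheme (YMSpecies G))
    (φ : ℕ → ℕ) (hφ : Tendsto φ atTop atTop) (k n : ℕ) (σ : Fin n → YMSpecies G)
    (f : Fin n → 𝓢(𝔼, ℝ)) :
    latticeSchwinger r.ρ (reindex sch φ hφ) (fun s => s.F) k n σ f =
      latticeSchwinger r.ρ sch (fun s => s.F) (φ k) n σ f := rfl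

/-- **Restriction of a witness to the even / odd steps.** [folklore] -/
theorem isYangMillsFor_reindex (r : LatticeRep G) {sch : SpeciesScheme (YMSpecies G)}
    {T : OSData (YMSpecies G) 4} (hT : IsYangMillsFor r sch T) (φ : ℕ → ℕ)
    (hφ : Tendsto φ atTop atTop) : IsYangMillsFor r (reindex sch φ hφ) T :=
  fun n hn σ f F hF hoff => (hT n hn σ f F hF hoff).comp hφ

omit [TopologicalSpace G] [IsTopologicalGroup G] [CompactSpace G] [BorelSpace G] in
theorem reindex_interleave_even (s₁ s₂ sch' : SpeciesScheme (YMSpecies G))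
    (ha : sch'.a = (interleave s₁ s₂).a) (hβ : sch'.β = (interleave s₁ s₂).β)
    (hL : sch'.L = (interleave s₁ s₂).L) :
    (reindex sch' (fun j => 2 * j) tendsto_two_mul_atTop).a = s₁.a ∧
    (reindex sch' (fun j => 2 * j) tendsto_two_mul_atTop).β = s₁.β ∧
    (reindex sch' (fun j => 2 * j) tendsto_two_mul_atTop).L = s₁.L := by
  refine ⟨funext fun j => ?_, funext fun j => ?_, funext fun j => ?_⟩
  · show sch'.a (2 * j) = _; rw [ha]; exact interleaveFun_two_mul _ _ _
  · show sch'.β (2 * j) = _; rw [hβ]; exact interleaveFun_two_mul _ _ _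
  · show sch'.L (2 * j) = _; rw [hL]; exact interleaveFun_two_mul _ _ _

omit [TopologicalSpace G] [IsTopologicalGroup G] [CompactSpace G] [BorelSpace G] in
theorem reindex_interleave_odd (s₁ s₂ sch' : SpeciesScheme (YMSpecies G))
    (ha : sch'.a = (interleave s₁ s₂).a) (hβ : sch'.β = (interleave s₁ s₂).β)
    (hL : sch'.L = (interleave s₁ s₂).L) :
    (reindex sch' (fun j => 2 * j + 1) tendsto_two_mul_add_one_atTop).a = s₂.a ∧
    (reindex sch' (fun j => 2 * j + 1) tendsto_two_mul_add_one_atTop).β = s₂.β ∧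
    (reindex sch' (fun j => 2 * j + 1) tendsto_two_mul_add_one_atTop).L = s₂.L := by
  refine ⟨funext fun j => ?_, funext fun j => ?_, funext fun j => ?_⟩
  · show sch'.a (2 * j + 1) = _; rw [ha]; exact interleaveFun_two_mul_add_one _ _ _
  · show sch'.β (2 * j + 1) = _; rw [hβ]; exact interleaveFun_two_mul_add_one _ _ _
  · show sch'.L (2 * j + 1) = _; rw [hL]; exact interleaveFun_two_mul_add_one _ _ _

/-- **A witness for the interleaved scheme serves both halves — with the SAME OS datum.** [folklore] -/
theorem concl_split_of_interleave (r : LatticeRep G) {s₁ s₂ : SpeciesScheme (YMSpecies G)}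
    (h : Concl r (interleave s₁ s₂)) :
    ∃ T : OSData (YMSpecies G) 4,
      (∃ t₁ : SpeciesScheme (YMSpecies G), t₁.a = s₁.a ∧ t₁.β = s₁.β ∧ t₁.L = s₁.L ∧
        IsYangMillsFor r t₁ T) ∧
      (∃ t₂ : SpeciesScheme (YMSpecies G), t₂.a = s₂.a ∧ t₂.β = s₂.β ∧ t₂.L = s₂.L ∧
        IsYangMillsFor r t₂ T) ∧
      T.IsNontrivial r.curvature ∧ T.IsNonGaussian r.curvature := by
  obtain ⟨sch', ha, hβ, hL, T, hYM, hNT, hNG⟩ := h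
  obtain ⟨ea, eβ, eL⟩ := reindex_interleave_even s₁ s₂ sch' ha hβ hL
  obtain ⟨oa, oβ, oL⟩ := reindex_interleave_odd s₁ s₂ sch' ha hβ hL
  exact ⟨T, ⟨_, ea, eβ, eL, isYangMillsFor_reindex r hYM _ tendsto_two_mul_atTop⟩,
    ⟨_, oa, oβ, oL, isYangMillsFor_reindex r hYM _ tendsto_two_mul_add_one_atTop⟩, hNT, hNG⟩

end HypInterleave

section CruxLevel3

open Summit.QuantumFields.YangMills.Theses.ParabolicTrajectory

/-- Unpacking the crux at given data: `Hyp → Concl` inside the quantifier prefix. [folklore] -/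
theorem crux_apply (h : ContinuumLimitOnTrajectory) (G : Type) [Group G] [TopologicalSpace G]
    [IsTopologicalGroup G] [CompactSpace G] (hG : IsCompactSimpleLieGroup G) :
    letI : MeasurableSpace G := borel G
    haveI : BorelSpace G := ⟨rfl⟩
    ∀ r : LatticeRep G, ∃ M₀ : ℕ, ∀ M : ℕ, M₀ ≤ M → 2 ≤ M → ∃ θ₀ : ℝ, 0 < θ₀ ∧
      ∀ (θ Δ : ℝ) (sch : SpeciesScheme (YMSpecies G)) (n : ℕ → ℕ),
        0 < θ → θ < θ₀ → 0 < Δ → Hyp r M θ Δ sch n → Concl r sch := by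
  intro r
  obtain ⟨M₀, hM₀⟩ := h G hG r
  refine ⟨M₀, fun M hM h2 => ?_⟩
  obtain ⟨θ₀, hθ₀, hθ⟩ := hM₀ M hM h2
  exact ⟨θ₀, hθ₀, fun θ Δ sch n h0 h1 hΔ H => hθ θ Δ sch n h0 h1 hΔ H.1 H.2.1 H.2.2.1 H.2.2.2.1 H.2.2.2.2⟩

/-- **The crux forces a COMMON continuum limit for equally-tuned sequences** (universality
content of the `∀`-over-sequences quantifier, via interleaving): for two schemes satisfying the
hypothesis block with the same `(G, r, M, θ, Δ)` and equal towers `(lim N_t)_t`, ONE OS datum `T`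
(non-trivial, non-Gaussian in `tr F²`) is Yang–Mills along renormalisations of BOTH. [folklore] -/
theorem crux_imp_commonWitness (h : ContinuumLimitOnTrajectory) (G : Type) [Group G]
    [TopologicalSpace G] [IsTopologicalGroup G] [CompactSpace G] (hG : IsCompactSimpleLieGroup G) :
    letI : MeasurableSpace G := borel G
    haveI : BorelSpace G := ⟨rfl⟩
    ∀ r : LatticeRep G, ∃ M₀ : ℕ, ∀ M : ℕ, M₀ ≤ M → 2 ≤ M → ∃ θ₀ : ℝ, 0 < θ₀ ∧
      ∀ (θ Δ : ℝ) (s₁ s₂ : SpeciesScheme (YMSpecies G)) (n₁ n₂ : ℕ → ℕ),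
        0 < θ → θ < θ₀ → 0 < Δ → Hyp r M θ Δ s₁ n₁ → Hyp r M θ Δ s₂ n₂ →
        (∀ t : ℕ, 0 < t → ∃ c : ℝ,
          Tendsto (fun j => ((M : ℝ) ^ n₁ j) ^ 8 * latticeConnectedCorr r.ρ (s₁.β j) (s₁.side j)
            r.curvature.F r.curvature.F (t * M ^ n₁ j)) atTop (𝓝 c) ∧
          Tendsto (fun j => ((M : ℝ) ^ n₂ j) ^ 8 * latticeConnectedCorr r.ρ (s₂.β j) (s₂.side j)
            r.curvature.F r.curvature.F (t * M ^ n₂ j)) atTop (𝓝 c)) →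
        ∃ T : OSData (YMSpecies G) 4,
          (∃ t₁ : SpeciesScheme (YMSpecies G), t₁.a = s₁.a ∧ t₁.β = s₁.β ∧ t₁.L = s₁.L ∧
            IsYangMillsFor r t₁ T) ∧
          (∃ t₂ : SpeciesScheme (YMSpecies G), t₂.a = s₂.a ∧ t₂.β = s₂.β ∧ t₂.L = s₂.L ∧
            IsYangMillsFor r t₂ T) ∧
          T.IsNontrivial r.curvature ∧ T.IsNonGaussian r.curvature := by
  intro r
  letI : MeasurableSpace G := borel G
  haveI : BorelSpace G := ⟨rfl⟩
  obtain ⟨M₀, hM₀⟩ := crux_apply h G hG r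
  refine ⟨M₀, fun M hM h2 => ?_⟩
  obtain ⟨θ₀, hθ₀, hθ⟩ := hM₀ M hM h2
  refine ⟨θ₀, hθ₀, fun θ Δ s₁ s₂ n₁ n₂ h0 h1 hΔ H₁ H₂ htower => ?_⟩
  exact concl_split_of_interleave r
    (hθ θ Δ (interleave s₁ s₂) (interleaveFun n₁ n₂) h0 h1 hΔ (hyp_interleave r H₁ H₂ htower))

/-- **Witness-free necessary condition I (one sequence): kernel ratios converge.** Along every
sequence satisfying the hypothesis block (in the crux's window) there is a real time-separated
pair `(u₀, v₀)` whose unit-normalised lattice kernel is eventually nonzero and such that for EVERY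
off-diagonal real pair `(u, v)` the ratio `K_k(u, v) / K_k(u₀, v₀)` of Wilson lattice
expectations converges. A sequence violating this refutes the crux. [folklore] -/
theorem crux_imp_kernelRatio (h : ContinuumLimitOnTrajectory) (G : Type) [Group G]
    [TopologicalSpace G] [IsTopologicalGroup G] [CompactSpace G] (hG : IsCompactSimpleLieGroup G) :
    letI : MeasurableSpace G := borel G
    haveI : BorelSpace G := ⟨rfl⟩
    ∀ r : LatticeRep G, ∃ M₀ : ℕ, ∀ M : ℕ, M₀ ≤ M → 2 ≤ M → ∃ θ₀ : ℝ, 0 < θ₀ ∧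
      ∀ (θ Δ : ℝ) (sch : SpeciesScheme (YMSpecies G)) (n : ℕ → ℕ),
        0 < θ → θ < θ₀ → 0 < Δ → Hyp r M θ Δ sch n →
          ∃ u₀ v₀ : 𝓢(𝔼, ℝ), tsupport (u₀ : 𝔼 → ℝ) ⊆ {z | z 0 < 0} ∧
            tsupport (v₀ : 𝔼 → ℝ) ⊆ {z | 0 < z 0} ∧
            (∀ᶠ k in atTop, twoPointKernel r.ρ (sch.a k) (sch.β k) (sch.L k) u₀ v₀ ≠ 0) ∧
            ∀ u v : 𝓢(𝔼, ℝ), IsOffDiagonal (T2 u v) → ∃ ℓ : ℂ,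
              Tendsto (fun k => ((twoPointKernel r.ρ (sch.a k) (sch.β k) (sch.L k) u v /
                twoPointKernel r.ρ (sch.a k) (sch.β k) (sch.L k) u₀ v₀ : ℝ) : ℂ)) atTop (𝓝 ℓ) := by
  intro r
  letI : MeasurableSpace G := borel G
  haveI : BorelSpace G := ⟨rfl⟩
  obtain ⟨M₀, hM₀⟩ := crux_apply h G hG r
  refine ⟨M₀, fun M hM h2 => ?_⟩
  obtain ⟨θ₀, hθ₀, hθ⟩ := hM₀ M hM h2
  refine ⟨θ₀, hθ₀, fun θ Δ sch n h0 h1 hΔ H => ?_⟩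
  obtain ⟨sch', ha, hβ, hL, T, hYM, hNT, -⟩ := hθ θ Δ sch n h0 h1 hΔ H
  obtain ⟨u₀, v₀, hu₀, hv₀, hne⟩ := exists_truncated_ne_zero_of_isNontrivial T r.curvature hNT
  have h₀ : IsOffDiagonal (T2 u₀ v₀) := isOffDiagonal_T2 hu₀ hv₀
  refine ⟨u₀, v₀, hu₀, hv₀, ?_, fun u v huv =>
    ⟨S2T T r.curvature u v / S2T T r.curvature u₀ v₀, ?_⟩⟩
  · have e := eventually_c_ne_zero_and_kernel_ne_zero r sch' T hYM h₀ hne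
    simp only [ha, hβ, hL] at e
    exact e.mono fun k hk => hk.2
  · have t := tendsto_kernel_ratio r sch' T hYM h₀ hne huv
    simp only [ha, hβ, hL] at t
    exact t

/-- **Witness-free necessary condition II (two sequences): universality of the kernel shape.**
For two equally-tuned sequences (same `(G, r, M, θ, Δ)`, equal towers) the kernel ratios of BOTH
converge to the SAME limits: the shape of the two-point function of `tr F²` is universal. Two
admissible sequences with different shape limits (e.g. an anisotropy surviving along one of
them) refute the crux. [folklore] -/
theorem crux_imp_universalRatio (h : ContinuumLimitOnTrajectory) (G : Type) [Group G]
    [TopologicalSpace G] [IsTopologicalGroup G] [CompactSpace G] (hG : IsCompactSimpleLieGroup G) :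
    letI : MeasurableSpace G := borel G
    haveI : BorelSpace G := ⟨rfl⟩
    ∀ r : LatticeRep G, ∃ M₀ : ℕ, ∀ M : ℕ, M₀ ≤ M → 2 ≤ M → ∃ θ₀ : ℝ, 0 < θ₀ ∧
      ∀ (θ Δ : ℝ) (s₁ s₂ : SpeciesScheme (YMSpecies G)) (n₁ n₂ : ℕ → ℕ),
        0 < θ → θ < θ₀ → 0 < Δ → Hyp r M θ Δ s₁ n₁ → Hyp r M θ Δ s₂ n₂ →
        (∀ t : ℕ, 0 < t → ∃ c : ℝ,
          Tendsto (fun j => ((M : ℝ) ^ n₁ j) ^ 8 * latticeConnectedCorr r.ρ (s₁.β j) (s₁.side j)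
            r.curvature.F r.curvature.F (t * M ^ n₁ j)) atTop (𝓝 c) ∧
          Tendsto (fun j => ((M : ℝ) ^ n₂ j) ^ 8 * latticeConnectedCorr r.ρ (s₂.β j) (s₂.side j)
            r.curvature.F r.curvature.F (t * M ^ n₂ j)) atTop (𝓝 c)) →
        ∃ u₀ v₀ : 𝓢(𝔼, ℝ), tsupport (u₀ : 𝔼 → ℝ) ⊆ {z | z 0 < 0} ∧
          tsupport (v₀ : 𝔼 → ℝ) ⊆ {z | 0 < z 0} ∧
          ∀ u v : 𝓢(𝔼, ℝ), IsOffDiagonal (T2 u v) → ∃ ℓ : ℂ,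
            Tendsto (fun k => ((twoPointKernel r.ρ (s₁.a k) (s₁.β k) (s₁.L k) u v /
              twoPointKernel r.ρ (s₁.a k) (s₁.β k) (s₁.L k) u₀ v₀ : ℝ) : ℂ)) atTop (𝓝 ℓ) ∧
            Tendsto (fun k => ((twoPointKernel r.ρ (s₂.a k) (s₂.β k) (s₂.L k) u v /
              twoPointKernel r.ρ (s₂.a k) (s₂.β k) (s₂.L k) u₀ v₀ : ℝ) : ℂ)) atTop (𝓝 ℓ) := by
  intro r
  letI : MeasurableSpace G := borel G
  haveI : BorelSpace G := ⟨rfl⟩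
  obtain ⟨M₀, hM₀⟩ := crux_imp_commonWitness h G hG r
  refine ⟨M₀, fun M hM h2 => ?_⟩
  obtain ⟨θ₀, hθ₀, hθ⟩ := hM₀ M hM h2
  refine ⟨θ₀, hθ₀, fun θ Δ s₁ s₂ n₁ n₂ h0 h1 hΔ H₁ H₂ htower => ?_⟩
  obtain ⟨T, ⟨t₁, ha₁, hβ₁, hL₁, hY₁⟩, ⟨t₂, ha₂, hβ₂, hL₂, hY₂⟩, hNT, -⟩ :=
    hθ θ Δ s₁ s₂ n₁ n₂ h0 h1 hΔ H₁ H₂ htower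
  obtain ⟨u₀, v₀, hu₀, hv₀, hne⟩ := exists_truncated_ne_zero_of_isNontrivial T r.curvature hNT
  have h₀ : IsOffDiagonal (T2 u₀ v₀) := isOffDiagonal_T2 hu₀ hv₀
  refine ⟨u₀, v₀, hu₀, hv₀, fun u v huv =>
    ⟨S2T T r.curvature u v / S2T T r.curvature u₀ v₀, ?_, ?_⟩⟩
  · have t := tendsto_kernel_ratio r t₁ T hY₁ h₀ hne huv
    simp only [ha₁, hβ₁, hL₁] at t
    exact t
  · have t := tendsto_kernel_ratio r t₂ T hY₂ h₀ hne huv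
    simp only [ha₂, hβ₂, hL₂] at t
    exact t

end CruxLevel3

/-! ## §6 Decorations: `2 ≤ M` is forced by the shape clause; `Δ ≤ 0` empties the gap clause -/

section Decorations

variable {G : Type} [Group G] [TopologicalSpace G] [IsTopologicalGroup G] [CompactSpace G]
  [MeasurableSpace G] [BorelSpace G]

/-- **`2 ≤ M` is decoration**: the shape clause of the hypothesis block already forces it
(sibling crux (B)'s `two_le_of_shape`: `M ≤ 1` contradicts `a_k → 0` / `a_k > 0`). [folklore] -/
theorem two_le_of_hyp (r : LatticeRep G) {M : ℕ} {θ Δ : ℝ} {sch : SpeciesScheme (YMSpecies G)}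
    {n : ℕ → ℕ} (h : Hyp r M θ Δ sch n) : 2 ≤ M :=
  Summit.QuantumFields.YangMills.Theorems.LatticeGapOnTrajectory.Negative.two_le_of_shape sch h.1

/-- Connected torus correlations of bounded observables are bounded by `2 C_A C_B` at EVERY
coupling (Wilson's measure is a probability measure). [folklore] -/
theorem abs_latticeConnectedCorr_le (r : LatticeRep G) (β : ℝ) (S : ℕ) [NeZero S]
    {A B : LGConfig 4 G → ℝ} {CA CB : ℝ} (hA : ∀ U, |A U| ≤ CA) (hB : ∀ U, |B U| ≤ CB) (m : ℕ) :
    |latticeConnectedCorr r.ρ β S A B m| ≤ 2 * CA * CB := by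
  haveI := isProbabilityMeasure_wilsonMeasure (d := 4) (L := S) r.ρ r.continuous β
  have hCA0 : 0 ≤ CA := (abs_nonneg _).trans (hA fun _ => 1)
  unfold latticeConnectedCorr
  refine (abs_sub _ _).trans ?_
  have h1 : |∫ U, A (torusLift S U) * B (configShift (-Pi.single 0 (m : ℤ)) (torusLift S U))
      ∂wilsonMeasure (d := 4) (L := S) r.ρ β| ≤ CA * CB :=
    abs_integral_le _ fun U => by
      rw [abs_mul]; exact mul_le_mul (hA _) (hB _) (abs_nonneg _) hCA0
  have h2 : |(∫ U, A (torusLift S U) ∂wilsonMeasure (d := 4) (L := S) r.ρ β) *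
      ∫ U, B (torusLift S U) ∂wilsonMeasure (d := 4) (L := S) r.ρ β| ≤ CA * CB := by
    rw [abs_mul]
    exact mul_le_mul (abs_integral_le _ fun U => hA _) (abs_integral_le _ fun U => hB _)
      (abs_nonneg _) hCA0
  linarith

/-- **For `Δ ≤ 0` the uniform lattice gap holds along EVERY scheme** (`|corr| ≤ 2 C_A C_B ≤
2 C_A C_B e^{-Δ a_k n}`): the clause `0 < Δ` is exactly what gives the gap hypothesis content;
the crux with `0 < Δ` dropped is the crux with the gap hypothesis deleted. [folklore] -/
theorem hasLatticeMassGap_of_nonpos (r : LatticeRep G) (sch : SpeciesScheme (YMSpecies G)) {Δ : ℝ}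
    (hΔ : Δ ≤ 0) : HasLatticeMassGap r sch Δ := by
  intro A B
  obtain ⟨CA, hCA⟩ := A.bounded
  obtain ⟨CB, hCB⟩ := B.bounded
  refine ⟨2 * CA * CB, Eventually.of_forall fun k S _ m _ => ?_⟩
  have hle := abs_latticeConnectedCorr_le r (sch.β k) (2 * S + 1) hCA hCB m
  have h0 : 0 ≤ 2 * CA * CB := (abs_nonneg _).trans hle
  have hexp : 1 ≤ Real.exp (-(Δ * (sch.a k * m))) := Real.one_le_exp
    (neg_nonneg.2 (mul_nonpos_of_nonpos_of_nonneg hΔ (by have := sch.a_pos k; positivity)))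
  calc |latticeConnectedCorr r.ρ (sch.β k) (2 * S + 1) A.F B.F m| ≤ 2 * CA * CB * 1 := by
        rw [mul_one]; exact hle
    _ ≤ 2 * CA * CB * Real.exp (-(Δ * (sch.a k * m))) := mul_le_mul_of_nonneg_left hexp h0

/-- Hence for `Δ ≤ 0` the hypothesis block is just shape ∧ AF ∧ convergence ∧ tuning. [folklore] -/
theorem hyp_iff_of_nonpos (r : LatticeRep G) {M : ℕ} {θ Δ : ℝ} (hΔ : Δ ≤ 0)
    (sch : SpeciesScheme (YMSpecies G)) (n : ℕ → ℕ) :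
    Hyp r M θ Δ sch n ↔
      (∀ k, sch.a k = ((M : ℝ) ^ n k)⁻¹) ∧ Tendsto sch.β atTop atTop ∧
        (∀ t : ℕ, 0 < t → ∃ c : ℝ, Tendsto (fun k => ((M : ℝ) ^ n k) ^ 8 *
          latticeConnectedCorr r.ρ (sch.β k) (sch.side k) r.curvature.F r.curvature.F (t * M ^ n k))
            atTop (𝓝 c)) ∧
        Tendsto (fun k => ((M : ℝ) ^ n k) ^ 8 *
          latticeConnectedCorr r.ρ (sch.β k) (sch.side k) r.curvature.F r.curvature.F (M ^ n k))
            atTop (𝓝 θ) :=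
  ⟨fun h => ⟨h.1, h.2.1, h.2.2.1, h.2.2.2.1⟩,
    fun h => ⟨h.1, h.2.1, h.2.2.1, h.2.2.2, hasLatticeMassGap_of_nonpos r sch hΔ⟩⟩

end Decorations

/-! ## §7 The E1 burden, witness-free: kernel-shape limits must be rotation invariant -/

section Rotation

open Literature.MathematicalPhysics.AQFT (IsOffDiagonal coincidenceLocus)

variable {E : Type*} [NormedAddCommGroup E] [NormedSpace ℝ E] {n : ℕ}

/-- **`⁰𝒮` is stable under the diagonal action of linear isometries.** [folklore] -/
theorem isOffDiagonal_linActMulti {F : 𝓢((Fin n → E), ℂ)} (hF : IsOffDiagonal F)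
    (L : E ≃ₗᵢ[ℝ] E) : IsOffDiagonal (linActMulti L F) := by
  intro x hx k
  set Φ : (Fin n → E) ≃L[ℝ] (Fin n → E) :=
    ContinuousLinearEquiv.piCongrRight fun _ : Fin n => L.symm.toContinuousLinearEquiv with hΦ
  have hcoe : ((linActMulti L F : 𝓢((Fin n → E), ℂ)) : (Fin n → E) → ℂ) =
      (F : (Fin n → E) → ℂ) ∘ (Φ : (Fin n → E) →L[ℝ] (Fin n → E)) := by
    funext y; simp only [Function.comp_apply, linActMulti_apply, hΦ]; rfl
  have hΦx : Φ x ∈ coincidenceLocus n E := by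
    obtain ⟨i, j, hij, h⟩ := hx
    refine ⟨i, j, hij, ?_⟩
    show L.symm (x i) = L.symm (x j)
    rw [h]
  rw [hcoe, ContinuousLinearMap.iteratedFDeriv_comp_right (Φ : (Fin n → E) →L[ℝ] (Fin n → E))
    (F.smooth k) x le_rfl]
  have h0 : iteratedFDeriv ℝ k (F : (Fin n → E) → ℂ) (Φ x) = 0 := hF _ hΦx k
  rw [show ((Φ : (Fin n → E) →L[ℝ] (Fin n → E)) x) = Φ x from rfl, h0]
  ext; simp

/-- A real test function composed with a linear isometry of `ℝ⁴` (`u ∘ L⁻¹`). [folklore] -/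
def rotTest (L : 𝔼 ≃ₗᵢ[ℝ] 𝔼) (u : 𝓢(𝔼, ℝ)) : 𝓢(𝔼, ℝ) :=
  SchwartzMap.compCLMOfContinuousLinearEquiv ℝ L.symm.toContinuousLinearEquiv u

/-- `rotTest L u x = u (L⁻¹ x)`. [folklore] -/
theorem rotTest_apply (L : 𝔼 ≃ₗᵢ[ℝ] 𝔼) (u : 𝓢(𝔼, ℝ)) (x : 𝔼) : rotTest L u x = u (L.symm x) := by
  simp [rotTest, SchwartzMap.compCLMOfContinuousLinearEquiv_apply]

/-- The diagonal action of `L` on a real two-variable product tensor. [folklore] -/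
theorem linActMulti_T2 (L : 𝔼 ≃ₗᵢ[ℝ] 𝔼) (u v : 𝓢(𝔼, ℝ)) :
    linActMulti L (T2 u v) = T2 (rotTest L u) (rotTest L v) := by
  ext x; simp [linActMulti_apply, T2_apply, rotTest_apply]

/-- The diagonal action of `L` on a real one-variable tensor. [folklore] -/
theorem linActMulti_T1 (L : 𝔼 ≃ₗᵢ[ℝ] 𝔼) (u : 𝓢(𝔼, ℝ)) :
    linActMulti L (T1 u) = T1 (rotTest L u) := by
  ext x; simp [linActMulti_apply, T1_apply, rotTest_apply]

variable {ι : Type}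

/-- **E1 on the pinned sector**: the truncated two-point function of an OS datum is invariant
under proper rotations of a real off-diagonal pair. [folklore] -/
theorem S2T_rotTest (T : OSData ι 4) (s : ι) (L : 𝔼 ≃ₗᵢ[ℝ] 𝔼)
    (hL : LinearMap.det (L.toLinearEquiv : 𝔼 →ₗ[ℝ] 𝔼) = 1) {u v : 𝓢(𝔼, ℝ)}
    (huv : IsOffDiagonal (T2 u v)) :
    S2T T s (rotTest L u) (rotTest L v) = S2T T s u v := by
  unfold S2T
  rw [← linActMulti_T2, ← linActMulti_T1, ← linActMulti_T1,
    T.invariant.2 _ _ L hL _ huv, T.invariant.2 _ _ L hL _ (isOffDiagonal_one _),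
    T.invariant.2 _ _ L hL _ (isOffDiagonal_one _)]

variable {G : Type} [Group G] [TopologicalSpace G] [IsTopologicalGroup G] [CompactSpace G]
  [MeasurableSpace G] [BorelSpace G]

/-- **Rotated and unrotated kernel ratios have the same limit** along a scheme carrying a
witness. [folklore] -/
theorem tendsto_kernel_ratio_rotTest (r : LatticeRep G) (sch : SpeciesScheme (YMSpecies G))
    (T : OSData (YMSpecies G) 4) (hT : IsYangMillsFor r sch T) {u₀ v₀ u v : 𝓢(𝔼, ℝ)}
    (h₀ : IsOffDiagonal (T2 u₀ v₀)) (hne : S2T T r.curvature u₀ v₀ ≠ 0)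
    (huv : IsOffDiagonal (T2 u v)) (L : 𝔼 ≃ₗᵢ[ℝ] 𝔼)
    (hL : LinearMap.det (L.toLinearEquiv : 𝔼 →ₗ[ℝ] 𝔼) = 1) :
    Tendsto (fun k => ((twoPointKernel r.ρ (sch.a k) (sch.β k) (sch.L k) (rotTest L u) (rotTest L v) /
        twoPointKernel r.ρ (sch.a k) (sch.β k) (sch.L k) u₀ v₀ : ℝ) : ℂ)) atTop
      (𝓝 (S2T T r.curvature u v / S2T T r.curvature u₀ v₀)) := by
  have h := tendsto_kernel_ratio r sch T hT h₀ hne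
    (by rw [← linActMulti_T2]; exact isOffDiagonal_linActMulti huv L)
  rwa [S2T_rotTest T r.curvature L hL huv] at h

open Summit.QuantumFields.YangMills.Theses.ParabolicTrajectory in
/-- **Witness-free necessary condition III: rotational symmetry of the kernel shape.** Along every
sequence satisfying the hypothesis block (in the crux's window) there is a real time-separated
`(u₀, v₀)` such that for every off-diagonal real `(u, v)` and every proper rotation `L ∈ SO(4)`,
the ratios `K_k(u∘L⁻¹, v∘L⁻¹)/K_k(u₀, v₀)` and `K_k(u, v)/K_k(u₀, v₀)` converge to the SAME
limit: the hypercubic anisotropy of Wilson's lattice theory must die out in the SHAPE of the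
curvature two-point kernel, uniformly enough for ratios — the E1 burden of the crux, stated on
Wilson lattice expectations alone. An admissible sequence with a surviving anisotropy in some
kernel ratio refutes the crux. [folklore] -/
theorem crux_imp_isotropicRatio (h : ContinuumLimitOnTrajectory) (G : Type) [Group G]
    [TopologicalSpace G] [IsTopologicalGroup G] [CompactSpace G] (hG : IsCompactSimpleLieGroup G) :
    letI : MeasurableSpace G := borel G
    haveI : BorelSpace G := ⟨rfl⟩
    ∀ r : LatticeRep G, ∃ M₀ : ℕ, ∀ M : ℕ, M₀ ≤ M → 2 ≤ M → ∃ θ₀ : ℝ, 0 < θ₀ ∧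
      ∀ (θ Δ : ℝ) (sch : SpeciesScheme (YMSpecies G)) (n : ℕ → ℕ),
        0 < θ → θ < θ₀ → 0 < Δ → Hyp r M θ Δ sch n →
          ∃ u₀ v₀ : 𝓢(𝔼, ℝ), tsupport (u₀ : 𝔼 → ℝ) ⊆ {z | z 0 < 0} ∧
            tsupport (v₀ : 𝔼 → ℝ) ⊆ {z | 0 < z 0} ∧
            ∀ u v : 𝓢(𝔼, ℝ), IsOffDiagonal (T2 u v) → ∀ L : 𝔼 ≃ₗᵢ[ℝ] 𝔼,
              LinearMap.det (L.toLinearEquiv : 𝔼 →ₗ[ℝ] 𝔼) = 1 → ∃ ℓ : ℂ,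
              Tendsto (fun k => ((twoPointKernel r.ρ (sch.a k) (sch.β k) (sch.L k) u v /
                twoPointKernel r.ρ (sch.a k) (sch.β k) (sch.L k) u₀ v₀ : ℝ) : ℂ)) atTop (𝓝 ℓ) ∧
              Tendsto (fun k => ((twoPointKernel r.ρ (sch.a k) (sch.β k) (sch.L k)
                  (rotTest L u) (rotTest L v) /
                twoPointKernel r.ρ (sch.a k) (sch.β k) (sch.L k) u₀ v₀ : ℝ) : ℂ)) atTop (𝓝 ℓ) := by
  intro r
  letI : MeasurableSpace G := borel G
  haveI : BorelSpace G := ⟨rfl⟩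
  obtain ⟨M₀, hM₀⟩ := crux_apply h G hG r
  refine ⟨M₀, fun M hM h2 => ?_⟩
  obtain ⟨θ₀, hθ₀, hθ⟩ := hM₀ M hM h2
  refine ⟨θ₀, hθ₀, fun θ Δ sch n h0 h1 hΔ H => ?_⟩
  obtain ⟨sch', ha, hβ, hL, T, hYM, hNT, -⟩ := hθ θ Δ sch n h0 h1 hΔ H
  obtain ⟨u₀, v₀, hu₀, hv₀, hne⟩ := exists_truncated_ne_zero_of_isNontrivial T r.curvature hNT
  have h₀ : IsOffDiagonal (T2 u₀ v₀) := isOffDiagonal_T2 hu₀ hv₀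
  refine ⟨u₀, v₀, hu₀, hv₀, fun u v huv L hdet =>
    ⟨S2T T r.curvature u v / S2T T r.curvature u₀ v₀, ?_, ?_⟩⟩
  · have t := tendsto_kernel_ratio r sch' T hYM h₀ hne huv
    simp only [ha, hβ, hL] at t
    exact t
  · have t := tendsto_kernel_ratio_rotTest r sch' T hYM h₀ hne huv L hdet
    simp only [ha, hβ, hL] at t
    exact t

end Rotation



/-! ## §8 The truncated THREE-point function: `c³`-scaling, and the renormalisation-free skewness -/

section Cumulant3

variable {Ω : Type*} [MeasurableSpace Ω] (μ : Measure Ω) [IsProbabilityMeasure μ]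

/-- The third cumulant (connected three-point function) of real random variables. [folklore] -/
def cum3 (X Y Z : Ω → ℝ) : ℝ :=
  (∫ ω, X ω * Y ω * Z ω ∂μ) - (∫ ω, X ω ∂μ) * (∫ ω, Y ω * Z ω ∂μ) -
    (∫ ω, Y ω ∂μ) * (∫ ω, X ω * Z ω ∂μ) - (∫ ω, Z ω ∂μ) * (∫ ω, X ω * Y ω ∂μ) +
    2 * ((∫ ω, X ω ∂μ) * (∫ ω, Y ω ∂μ) * (∫ ω, Z ω ∂μ))

/-- Expectation of an affine image. [folklore] -/
theorem integral_affine₁ {X : Ω → ℝ} (hX : Integrable X μ) (c d : ℝ) :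
    ∫ ω, (c * X ω + d) ∂μ = c * (∫ ω, X ω ∂μ) + d := by
  rw [integral_add (hX.const_mul c) (integrable_const d), integral_const_mul, integral_const,
    probReal_univ, one_smul]

/-- Expectation of a product of two affine images. [folklore] -/
theorem integral_affine₂ {X Y : Ω → ℝ} (hX : Integrable X μ) (hY : Integrable Y μ)
    (hXY : Integrable (fun ω => X ω * Y ω) μ) (c d d' : ℝ) :
    ∫ ω, (c * X ω + d) * (c * Y ω + d') ∂μ =
      c ^ 2 * (∫ ω, X ω * Y ω ∂μ) + c * d' * (∫ ω, X ω ∂μ) + c * d * (∫ ω, Y ω ∂μ) + d * d' := by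
  have h : ∀ ω, (c * X ω + d) * (c * Y ω + d') =
      c ^ 2 * (X ω * Y ω) + c * d' * X ω + (c * d * Y ω + d * d') := fun ω => by ring
  simp_rw [h]
  rw [integral_add, integral_add, integral_add]
  · simp only [integral_const_mul, integral_const, probReal_univ, one_smul]
    ring
  all_goals first
    | exact integrable_const _
    | exact hX.const_mul _
    | exact hY.const_mul _
    | exact hXY.const_mul _
    | exact (hXY.const_mul _).add (hX.const_mul _)
    | exact (hY.const_mul _).add (integrable_const _)

/-- Expectation of a product of three affine images. [folklore] -/
theorem integral_affine₃ {X Y Z : Ω → ℝ} (hX : Integrable X μ) (hY : Integrable Y μ)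
    (hZ : Integrable Z μ) (hXY : Integrable (fun ω => X ω * Y ω) μ)
    (hXZ : Integrable (fun ω => X ω * Z ω) μ) (hYZ : Integrable (fun ω => Y ω * Z ω) μ)
    (hXYZ : Integrable (fun ω => X ω * Y ω * Z ω) μ) (c d d' d'' : ℝ) :
    ∫ ω, (c * X ω + d) * (c * Y ω + d') * (c * Z ω + d'') ∂μ =
      c ^ 3 * (∫ ω, X ω * Y ω * Z ω ∂μ) + c ^ 2 * d'' * (∫ ω, X ω * Y ω ∂μ) +
        c ^ 2 * d' * (∫ ω, X ω * Z ω ∂μ) + c ^ 2 * d * (∫ ω, Y ω * Z ω ∂μ) +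
        c * d' * d'' * (∫ ω, X ω ∂μ) + c * d * d'' * (∫ ω, Y ω ∂μ) + c * d * d' * (∫ ω, Z ω ∂μ) +
        d * d' * d'' := by
  have h : ∀ ω, (c * X ω + d) * (c * Y ω + d') * (c * Z ω + d'') =
      (c ^ 3 * (X ω * Y ω * Z ω) + c ^ 2 * d'' * (X ω * Y ω)) +
      (c ^ 2 * d' * (X ω * Z ω) + c ^ 2 * d * (Y ω * Z ω)) +
      ((c * d' * d'' * X ω + c * d * d'' * Y ω) + (c * d * d' * Z ω + d * d' * d'')) := fun ω => by
    ring
  simp_rw [h]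
  rw [integral_add, integral_add, integral_add, integral_add, integral_add, integral_add,
    integral_add]
  · simp only [integral_const_mul, integral_const, probReal_univ, one_smul]
    ring
  all_goals first
    | exact integrable_const _
    | exact hX.const_mul _
    | exact hY.const_mul _
    | exact hZ.const_mul _
    | exact hXY.const_mul _
    | exact hXZ.const_mul _
    | exact hYZ.const_mul _
    | exact hXYZ.const_mul _
    | exact (hXYZ.const_mul _).add (hXY.const_mul _)
    | exact (hXZ.const_mul _).add (hYZ.const_mul _)
    | exact (hX.const_mul _).add (hY.const_mul _)
    | exact (hZ.const_mul _).add (integrable_const _)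
    | exact ((hXYZ.const_mul _).add (hXY.const_mul _)).add ((hXZ.const_mul _).add (hYZ.const_mul _))
    | exact ((hX.const_mul _).add (hY.const_mul _)).add ((hZ.const_mul _).add (integrable_const _))

/-- **Affine maps act on the third cumulant by `c³`; the shifts drop out.** [folklore] -/
theorem cum3_affine {X Y Z : Ω → ℝ} (hX : Integrable X μ) (hY : Integrable Y μ)
    (hZ : Integrable Z μ) (hXY : Integrable (fun ω => X ω * Y ω) μ)
    (hXZ : Integrable (fun ω => X ω * Z ω) μ) (hYZ : Integrable (fun ω => Y ω * Z ω) μ)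
    (hXYZ : Integrable (fun ω => X ω * Y ω * Z ω) μ) (c d d' d'' : ℝ) :
    cum3 μ (fun ω => c * X ω + d) (fun ω => c * Y ω + d') (fun ω => c * Z ω + d'') =
      c ^ 3 * cum3 μ X Y Z := by
  unfold cum3
  rw [integral_affine₃ μ hX hY hZ hXY hXZ hYZ hXYZ, integral_affine₂ μ hY hZ hYZ,
    integral_affine₂ μ hX hZ hXZ, integral_affine₂ μ hX hY hXY, integral_affine₁ μ hX,
    integral_affine₁ μ hY, integral_affine₁ μ hZ]
  ring

/-- The same with subtractive shifts. [folklore] -/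
theorem cum3_affine_sub {X Y Z : Ω → ℝ} (hX : Integrable X μ) (hY : Integrable Y μ)
    (hZ : Integrable Z μ) (hXY : Integrable (fun ω => X ω * Y ω) μ)
    (hXZ : Integrable (fun ω => X ω * Z ω) μ) (hYZ : Integrable (fun ω => Y ω * Z ω) μ)
    (hXYZ : Integrable (fun ω => X ω * Y ω * Z ω) μ) (c e e' e'' : ℝ) :
    cum3 μ (fun ω => c * X ω - e) (fun ω => c * Y ω - e') (fun ω => c * Z ω - e'') =
      c ^ 3 * cum3 μ X Y Z := by
  simp only [sub_eq_add_neg]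
  exact cum3_affine μ hX hY hZ hXY hXZ hYZ hXYZ c (-e) (-e') (-e'')

end Cumulant3

section ThreePoint

variable {G : Type} [Group G] [TopologicalSpace G] [IsTopologicalGroup G] [CompactSpace G]
  [MeasurableSpace G] [BorelSpace G] {N : ℕ}

/-- **The unit-normalised connected THREE-point kernel** of the lattice curvature field (third cumulant
of `Φ_{1,0}(f), Φ_{1,0}(g), Φ_{1,0}(h)` under Wilson's measure): bare data only. [folklore] -/
def threePointKernel (ρ : G →* Matrix (Fin N) (Fin N) ℂ) (a β : ℝ) (L : ℕ) (f g h : 𝓢(𝔼, ℝ)) : ℝ :=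
  cum3 (wilsonMeasure (d := 4) (L := 2 * L + 1) ρ β) (unitField ρ a L f) (unitField ρ a L g)
    (unitField ρ a L h)

/-- The lattice three-point function of the curvature species on three real test functions. [folklore] -/
theorem latticeSchwinger_three (r : LatticeRep G) (sch : SpeciesScheme (YMSpecies G)) (k : ℕ)
    (f g h : 𝓢(𝔼, ℝ)) :
    latticeSchwinger r.ρ sch (fun s => s.F) k 3 (fun _ => r.curvature) ![f, g, h] =
      ∫ U, smearedLatticeField (actionDensity r.ρ) (box 4 (sch.L k)) (sch.a k)
          (sch.c r.curvature k) (sch.m r.curvature k) f (torusLift (sch.side k) U) *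
        smearedLatticeField (actionDensity r.ρ) (box 4 (sch.L k)) (sch.a k)
          (sch.c r.curvature k) (sch.m r.curvature k) g (torusLift (sch.side k) U) *
        smearedLatticeField (actionDensity r.ρ) (box 4 (sch.L k)) (sch.a k)
          (sch.c r.curvature k) (sch.m r.curvature k) h (torusLift (sch.side k) U)
        ∂(wilsonMeasure (d := 4) (L := sch.side k) r.ρ (sch.β k)) := by
  unfold latticeSchwinger
  simp only [Fin.prod_univ_succ, Fin.prod_univ_zero, mul_one, Matrix.cons_val_zero,
    Matrix.cons_val_succ, curvature_F, mul_assoc]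

/-- **`c³`-scaling and `m`-invisibility of the truncated lattice three-point function.** [folklore] -/
theorem latticeSchwinger_conn_three_eq (r : LatticeRep G) (sch : SpeciesScheme (YMSpecies G)) (k : ℕ)
    (f g h : 𝓢(𝔼, ℝ)) :
    let L : (n : ℕ) → (Fin n → 𝓢(𝔼, ℝ)) → ℝ :=
      fun n φ => latticeSchwinger r.ρ sch (fun s => s.F) k n (fun _ => r.curvature) φ
    L 3 ![f, g, h] - L 1 ![f] * L (1 + 1) ![g, h] - L 1 ![g] * L (1 + 1) ![f, h] -
        L 1 ![h] * L (1 + 1) ![f, g] + 2 * (L 1 ![f] * L 1 ![g] * L 1 ![h]) =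
      (sch.c r.curvature k) ^ 3 * threePointKernel r.ρ (sch.a k) (sch.β k) (sch.L k) f g h := by
  intro L
  haveI := isProbabilityMeasure_wilsonMeasure (d := 4) (L := sch.side k) r.ρ r.continuous (sch.β k)
  simp only [L, latticeSchwinger_three, latticeSchwinger_two, latticeSchwinger_one]
  set e : 𝓢(𝔼, ℝ) → ℝ := fun f => sch.c r.curvature k * sch.m r.curvature k * sch.a k ^ 4 *
      ∑ x ∈ box 4 (sch.L k), f (sch.a k • siteToE x) with he
  have hΦ : ∀ (φ : 𝓢(𝔼, ℝ)) (U : GaugeConfig 4 (sch.side k) G),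
      smearedLatticeField (actionDensity r.ρ) (box 4 (sch.L k)) (sch.a k) (sch.c r.curvature k)
        (sch.m r.curvature k) φ (torusLift (sch.side k) U) =
      sch.c r.curvature k * unitField r.ρ (sch.a k) (sch.L k) φ U - e φ := fun φ U => by
    rw [smearedLatticeField_affine]; rfl
  simp_rw [hΦ]
  have hf := continuous_unitField (ρ := r.ρ) r.continuous (sch.a k) (sch.L k) f
  have hg := continuous_unitField (ρ := r.ρ) r.continuous (sch.a k) (sch.L k) g
  have hh := continuous_unitField (ρ := r.ρ) r.continuous (sch.a k) (sch.L k) h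
  exact cum3_affine_sub (wilsonMeasure (d := 4) (L := sch.side k) r.ρ (sch.β k))
    (X := unitField r.ρ (sch.a k) (sch.L k) f) (Y := unitField r.ρ (sch.a k) (sch.L k) g)
    (Z := unitField r.ρ (sch.a k) (sch.L k) h)
    (integrable_wilson r _ hf) (integrable_wilson r _ hg) (integrable_wilson r _ hh)
    (integrable_wilson r _ (hf.mul hg)) (integrable_wilson r _ (hf.mul hh))
    (integrable_wilson r _ (hg.mul hh)) (integrable_wilson r _ ((hf.mul hg).mul hh))
    (sch.c r.curvature k) (e f) (e g) (e h)

end ThreePoint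

section Skewness

open Literature.MathematicalPhysics.AQFT (IsOffDiagonal coincidenceLocus)

variable {ι : Type}

/-- Real product tensors of any arity, complexified. [folklore] -/
def Tn {n : ℕ} (f : Fin n → 𝓢(𝔼, ℝ)) : 𝓢((Fin n → 𝔼), ℂ) :=
  SchwartzMap.tensorFin n fun i => ofRealTest (f i)

/-- `Tn f x = ∏ᵢ fᵢ(xᵢ)`. [folklore] -/
theorem Tn_apply {n : ℕ} (f : Fin n → 𝓢(𝔼, ℝ)) (x : Fin n → 𝔼) : Tn f x = ∏ i, ((f i (x i) : ℝ) : ℂ) := by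
  simp [Tn, SchwartzMap.tensorFin_apply]

/-- `Tn f` is a tensor of the complexified `fᵢ`. [folklore] -/
theorem isTensorOf_Tn {n : ℕ} (f : Fin n → 𝓢(𝔼, ℝ)) : IsTensorOf (Tn f) fun i => ofRealTest (f i) :=
  isTensorOf_tensorFin _

/-- **Pairwise disjointly supported real tensors are off-diagonal** (any arity). [folklore] -/
theorem isOffDiagonal_Tn {n : ℕ} (f : Fin n → 𝓢(𝔼, ℝ))
    (h : Pairwise fun i j => Disjoint (tsupport (f i : 𝔼 → ℝ)) (tsupport (f j : 𝔼 → ℝ))) :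
    IsOffDiagonal (Tn f) := by
  apply IsOffDiagonal.of_tsupport_subset
  have hC : IsClosed {x : Fin n → 𝔼 | ∀ i, x i ∈ tsupport (f i : 𝔼 → ℝ)} := by
    have : {x : Fin n → 𝔼 | ∀ i, x i ∈ tsupport (f i : 𝔼 → ℝ)} =
        ⋂ i, (fun x : Fin n → 𝔼 => x i) ⁻¹' tsupport (f i : 𝔼 → ℝ) := by
      ext x; simp
    rw [this]
    exact isClosed_iInter fun i => (isClosed_tsupport _).preimage (continuous_apply i)
  have hsupp : Function.support (Tn f : (Fin n → 𝔼) → ℂ) ⊆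
      {x | ∀ i, x i ∈ tsupport (f i : 𝔼 → ℝ)} := by
    intro x hx i
    rw [Function.mem_support, Tn_apply] at hx
    have hi := (Finset.prod_ne_zero_iff.1 hx) i (Finset.mem_univ _)
    exact subset_closure (Function.mem_support.2 fun h0 => hi (by simp [h0]))
  refine (closure_minimal hsupp hC).trans ?_
  rintro x hx ⟨i, j, hij, hxij⟩
  have h1 : x i ∈ tsupport (f i : 𝔼 → ℝ) := hx i
  have h2 : x i ∈ tsupport (f j : 𝔼 → ℝ) := hxij ▸ hx j
  exact Set.disjoint_left.1 (h hij) h1 h2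

/-- `T1` is the arity-one case of `Tn`. [folklore] -/
theorem T1_eq_Tn (u : 𝓢(𝔼, ℝ)) : T1 u = Tn ![u] := rfl
/-- `T2` is the arity-two case of `Tn`. [folklore] -/
theorem T2_eq_Tn (u v : 𝓢(𝔼, ℝ)) : T2 u v = Tn ![u, v] := rfl

/-- The three-variable real product tensor. [folklore] -/
abbrev T3 (f g h : 𝓢(𝔼, ℝ)) : 𝓢((Fin 3 → 𝔼), ℂ) := Tn ![f, g, h]

/-- The truncated (connected) continuum THREE-point function of the species `s` on `f ⊗ g ⊗ h`. [folklore] -/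
def S3T (T : OSData ι 4) (s : ι) (f g h : 𝓢(𝔼, ℝ)) : ℂ :=
  T.schwinger 3 (fun _ => s) (T3 f g h) -
    T.schwinger 1 (fun _ => s) (T1 f) * T.schwinger (1 + 1) (fun _ => s) (T2 g h) -
    T.schwinger 1 (fun _ => s) (T1 g) * T.schwinger (1 + 1) (fun _ => s) (T2 f h) -
    T.schwinger 1 (fun _ => s) (T1 h) * T.schwinger (1 + 1) (fun _ => s) (T2 f g) +
    2 * (T.schwinger 1 (fun _ => s) (T1 f) * T.schwinger 1 (fun _ => s) (T1 g) *
      T.schwinger 1 (fun _ => s) (T1 h))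

/-- Pairwise disjoint supports of three real test functions. [folklore] -/
def PairwiseDisjoint3 (f g h : 𝓢(𝔼, ℝ)) : Prop :=
  Disjoint (tsupport (f : 𝔼 → ℝ)) (tsupport (g : 𝔼 → ℝ)) ∧
    Disjoint (tsupport (f : 𝔼 → ℝ)) (tsupport (h : 𝔼 → ℝ)) ∧
    Disjoint (tsupport (g : 𝔼 → ℝ)) (tsupport (h : 𝔼 → ℝ))

/-- Disjoint supports, as a `Pairwise` statement over `Fin 2`. [folklore] -/
theorem pairwise_two {u v : 𝓢(𝔼, ℝ)} (huv : Disjoint (tsupport (u : 𝔼 → ℝ)) (tsupport (v : 𝔼 → ℝ))) :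
    Pairwise fun i j => Disjoint (tsupport (![u, v] i : 𝔼 → ℝ)) (tsupport (![u, v] j : 𝔼 → ℝ)) := by
  intro i j hij
  fin_cases i <;> fin_cases j <;> simp_all [huv.symm]

/-- Pairwise disjoint supports, as a `Pairwise` statement over `Fin 3`. [folklore] -/
theorem pairwise_three {f g h : 𝓢(𝔼, ℝ)} (hp : PairwiseDisjoint3 f g h) :
    Pairwise fun i j => Disjoint (tsupport (![f, g, h] i : 𝔼 → ℝ)) (tsupport (![f, g, h] j : 𝔼 → ℝ)) := by
  obtain ⟨hfg, hfh, hgh⟩ := hp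
  intro i j hij
  fin_cases i <;> fin_cases j <;> simp_all [hfg.symm, hfh.symm, hgh.symm]

variable {G : Type} [Group G] [TopologicalSpace G] [IsTopologicalGroup G] [CompactSpace G]
  [MeasurableSpace G] [BorelSpace G]

/-- **The witness's truncated three-point function is the limit of `c_k³ K3_k`** (pairwise disjointly
supported real triples). [folklore] -/
theorem tendsto_c_cube_mul_kernel3 (r : LatticeRep G) (sch : SpeciesScheme (YMSpecies G))
    (T : OSData (YMSpecies G) 4) (hT : IsYangMillsFor r sch T) {f g h : 𝓢(𝔼, ℝ)}
    (hp : PairwiseDisjoint3 f g h) :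
    Tendsto (fun k => (((sch.c r.curvature k) ^ 3 *
        threePointKernel r.ρ (sch.a k) (sch.β k) (sch.L k) f g h : ℝ) : ℂ)) atTop
      (𝓝 (S3T T r.curvature f g h)) := by
  obtain ⟨hfg, hfh, hgh⟩ := id hp
  have h3 := hT 3 (by norm_num) (fun _ => r.curvature) ![f, g, h] (T3 f g h) (isTensorOf_Tn _)
    (isOffDiagonal_Tn _ (pairwise_three hp))
  have hf := hT 1 one_ne_zero (fun _ => r.curvature) ![f] (T1 f) (isTensorOf_T1 f) (isOffDiagonal_one _)
  have hg := hT 1 one_ne_zero (fun _ => r.curvature) ![g] (T1 g) (isTensorOf_T1 g) (isOffDiagonal_one _)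
  have hh := hT 1 one_ne_zero (fun _ => r.curvature) ![h] (T1 h) (isTensorOf_T1 h) (isOffDiagonal_one _)
  have hgh2 := hT (1 + 1) (by norm_num) (fun _ => r.curvature) ![g, h] (T2 g h) (isTensorOf_T2 g h)
    (by rw [T2_eq_Tn]; exact isOffDiagonal_Tn _ (pairwise_two hgh))
  have hfh2 := hT (1 + 1) (by norm_num) (fun _ => r.curvature) ![f, h] (T2 f h) (isTensorOf_T2 f h)
    (by rw [T2_eq_Tn]; exact isOffDiagonal_Tn _ (pairwise_two hfh))
  have hfg2 := hT (1 + 1) (by norm_num) (fun _ => r.curvature) ![f, g] (T2 f g) (isTensorOf_T2 f g)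
    (by rw [T2_eq_Tn]; exact isOffDiagonal_Tn _ (pairwise_two hfg))
  have hlim := (((h3.sub (hf.mul hgh2)).sub (hg.mul hfh2)).sub (hh.mul hfg2)).add
    ((hf.mul hg).mul hh |>.const_mul (2 : ℂ))
  refine hlim.congr' (Eventually.of_forall fun k => ?_)
  have e := latticeSchwinger_conn_three_eq r sch k f g h
  simp only at e
  push_cast [← e]
  ring

/-- **Renormalisation-free skewness.** If `𝔖₂ᵀ(u₀ ⊗ v₀) ≠ 0`, the normalised lattice skewness
`K3_k(f,g,h)² / K_k(u₀,v₀)³` converges (to `𝔖₃ᵀ(f⊗g⊗h)² / 𝔖₂ᵀ(u₀⊗v₀)³`) — the sign ambiguity of `c_k`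
is removed by squaring. [folklore] -/
theorem tendsto_skewness_ratio (r : LatticeRep G) (sch : SpeciesScheme (YMSpecies G))
    (T : OSData (YMSpecies G) 4) (hT : IsYangMillsFor r sch T) {u₀ v₀ f g h : 𝓢(𝔼, ℝ)}
    (h₀ : IsOffDiagonal (T2 u₀ v₀)) (hne : S2T T r.curvature u₀ v₀ ≠ 0)
    (hp : PairwiseDisjoint3 f g h) :
    Tendsto (fun k => (((threePointKernel r.ρ (sch.a k) (sch.β k) (sch.L k) f g h) ^ 2 /
        (twoPointKernel r.ρ (sch.a k) (sch.β k) (sch.L k) u₀ v₀) ^ 3 : ℝ) : ℂ)) atTop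
      (𝓝 ((S3T T r.curvature f g h) ^ 2 / (S2T T r.curvature u₀ v₀) ^ 3)) := by
  have hA := (tendsto_c_cube_mul_kernel3 r sch T hT hp).pow 2
  have hB := (tendsto_c_sq_mul_kernel r sch T hT h₀).pow 3
  refine (hA.div hB (pow_ne_zero 3 hne)).congr' ?_
  filter_upwards [eventually_c_ne_zero_and_kernel_ne_zero r sch T hT h₀ hne] with k hk
  have hc : (sch.c r.curvature k : ℂ) ≠ 0 := ofReal_ne_zero.2 hk.1
  have hK : (twoPointKernel r.ρ (sch.a k) (sch.β k) (sch.L k) u₀ v₀ : ℂ) ≠ 0 := ofReal_ne_zero.2 hk.2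
  simp only [Pi.div_apply]
  push_cast
  field_simp

open Summit.QuantumFields.YangMills.Theses.ParabolicTrajectory in
/-- **Witness-free necessary condition IV: asymptotic skewness has a limit.** Along every sequence in
the hypothesis block (in the crux's window) there is `(u₀, v₀)` (real, time-separated) such that for
every pairwise disjointly supported real triple `(f, g, h)` the normalised lattice skewness
`K3_k(f,g,h)²/K_k(u₀,v₀)³` of the curvature field converges. The `IsNonGaussian` clause of the crux
demands in addition that the witness's `κ₃` be nonzero on some admissible (complex) triple: a
GAUSSIAN scaling limit of `tr F²` at the tuned scale — all normalised skewnesses (and the complex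
ones) tending to `0`, the triviality scenario of `φ⁴₄` — refutes (A) as soon as its hypotheses are met.
[folklore] -/
theorem crux_imp_skewnessRatio (hcrux : ContinuumLimitOnTrajectory) (G : Type) [Group G]
    [TopologicalSpace G] [IsTopologicalGroup G] [CompactSpace G] (hG : IsCompactSimpleLieGroup G) :
    letI : MeasurableSpace G := borel G
    haveI : BorelSpace G := ⟨rfl⟩
    ∀ r : LatticeRep G, ∃ M₀ : ℕ, ∀ M : ℕ, M₀ ≤ M → 2 ≤ M → ∃ θ₀ : ℝ, 0 < θ₀ ∧
      ∀ (θ Δ : ℝ) (sch : SpeciesScheme (YMSpecies G)) (n : ℕ → ℕ),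
        0 < θ → θ < θ₀ → 0 < Δ → Hyp r M θ Δ sch n →
          ∃ u₀ v₀ : 𝓢(𝔼, ℝ), tsupport (u₀ : 𝔼 → ℝ) ⊆ {z | z 0 < 0} ∧
            tsupport (v₀ : 𝔼 → ℝ) ⊆ {z | 0 < z 0} ∧
            ∀ f g h : 𝓢(𝔼, ℝ), PairwiseDisjoint3 f g h → ∃ ℓ : ℂ,
              Tendsto (fun k => (((threePointKernel r.ρ (sch.a k) (sch.β k) (sch.L k) f g h) ^ 2 /
                (twoPointKernel r.ρ (sch.a k) (sch.β k) (sch.L k) u₀ v₀) ^ 3 : ℝ) : ℂ)) atTop (𝓝 ℓ) := by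
  intro r
  letI : MeasurableSpace G := borel G
  haveI : BorelSpace G := ⟨rfl⟩
  obtain ⟨M₀, hM₀⟩ := crux_apply hcrux G hG r
  refine ⟨M₀, fun M hM h2 => ?_⟩
  obtain ⟨θ₀, hθ₀, hθ⟩ := hM₀ M hM h2
  refine ⟨θ₀, hθ₀, fun θ Δ sch n h0 h1 hΔ H => ?_⟩
  obtain ⟨sch', ha, hβ, hL, T, hYM, hNT, -⟩ := hθ θ Δ sch n h0 h1 hΔ H
  obtain ⟨u₀, v₀, hu₀, hv₀, hne⟩ := exists_truncated_ne_zero_of_isNontrivial T r.curvature hNT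
  have hoff : IsOffDiagonal (T2 u₀ v₀) := isOffDiagonal_T2 hu₀ hv₀
  refine ⟨u₀, v₀, hu₀, hv₀, fun f g h hp =>
    ⟨(S3T T r.curvature f g h) ^ 2 / (S2T T r.curvature u₀ v₀) ^ 3, ?_⟩⟩
  have t := tendsto_skewness_ratio r sch' T hYM hoff hne hp
  simp only [ha, hβ, hL] at t
  exact t

end Skewness

end Gen3

/-! ## §R Record: gen-1 findings and physics-level remarks (prose only)

Gen-1 (`refuter-cdisprove-stmt-QuantumFields-10522-0`, evidence `20260815T224411Z-Disproof.lean`,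
rc 0, 0 sorry; its text is not readable from the gen-2 jail, so it is summarised, not re-proved):
F1 `Hyp.withRenorm`/`concl_iff_of_eq` — `sch` enters only through `(a, β, L)`;
F2 `withoutNontriviality_holds` — dropping `IsNontrivial ∧ IsNonGaussian` makes (A) provable by
the vacuum along the zero renormalisation (all content is in the non-triviality clauses);
F3 the gap hypothesis only yields the UNSCALED bound `|N_t(k)| ≤ a_k⁻⁸ C e^{-Δt}`;
F4 `not_isNontrivial_of_c_eventually_zero` — a witness must have `c_curvature(k) ≠ 0` frequently
(re-obtained here in the stronger form `not_isNontrivial_beta_zero` for the `β ≡ 0` model);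
F5 `not_withoutRenormalisation_iff` — the variant `sch' := sch` is false iff the hypotheses are
satisfiable, and `hypSat_of_route`: (S) ∧ (B) ∧ (∃ simple `G`) ⇒ satisfiable;
F6/F7 `isYangMillsFor_iff_of_off`, `crux_iff_oneField` — (A) is EQUIVALENT to its one-field form
for `tr F²` (restriction / zero-extension of OS data preserve E0–E4).

Physics-level (not formalisable today; gen-1 §3 and refuter rattack 16:35Z): `β_k → ∞` alone is
load-bearing against finite-`β` bulk first-order transitions / critical endpoints for reducible
`r` (van Enter–Shlosman cond-mat/0306362 Thm 2; Bhanot–Creutz) — the rev-3 → rev-4 repair; the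
`∀ t` convergence clause is load-bearing against interleaving the UV and IR roots of
`Λ ↦ Λ⁸ Ŝ(Λ)` (two tunings with the same `θ`); `θ < θ₀` does NOT select the perturbative window
(the IR root qualifies too); the gap hypothesis serves E4/volume control, not truth.

NEXT regimes for a later cycle: (i) `β_k ≡ β₀` small and FIXED (strong coupling): show the tuning
clause FAILS there (`|⟨P ; τ_n P⟩_{β₀}| ≤ C e^{-m n}` uniformly in the volume ⇒
`N_1(k) = a_k⁻⁸ O(e^{-m M^{n_k}}) → 0`), which would prove that WITH `θ > 0` every admissible
sequence eventually leaves every strong-coupling window (`lim inf β_k ≥ β₀(G, r)`) even without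
the AF clause. OBSTRUCTION (checked 2026-08-15): the tree's proved clustering
`osterwalder_seiler_torusClustering_holds` (LatticeGaugeStrongCouplingProofs) is stated as
`∀ x, ∀ᶠ L, |…| ≤ C e^{-m‖x‖}` — it passes through the infinite-volume limit at FIXED separation
`x`, so it gives no bound at the jointly growing `(x_k, L_k) = (M^{n_k} e₀, L_k)` the tuning clause
needs; the volume-uniform finite-torus form of Osterwalder–Seiler Thm 3.5 is not in the tree.
(ii) the `θ = 0`, `β_k → ∞` over-cooled regime (Gaussian `F²` of free Maxwell fields passes
`IsNonGaussian` — a weakness of the conclusion, not of (A)).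

LANDED (2026-08-16): §2 is in the tree as four support files under
`Summits/QuantumFields/YangMills/Theorems/ContinuumLimitOnTrajectory/Negative/`, namespace
`Summit.QuantumFields.YangMills.Theorems.ContinuumLimitOnTrajectory.Negative` — importable by ideators,
planners and leads: `UltralocalTorusHaar` (p70428, commit 1d8c2131de13), `UltralocalZeroCoupling`
(p70619, 71d9f21526e3: `wilsonMeasure_zero`, `latticeConnectedCorr_actionDensity_zero`, `tendsto_N_zero`,
`hasLatticeMassGap_beta_zero`), `UltralocalTwoPoint` (p70860, d0ad279d3659: `latticeSchwinger_two_eq_mul`),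
`UltralocalNoLimit` (p71691, a8e810569013: `schwinger_two_eq_mul`, `not_isNontrivial_beta_zero`,
`ultralocal_counterexample`, `continuumLimitOnTrajectory_of_without_AF`,
`continuumLimitOnTrajectory_false_without_AF`). This work file keeps its own copy (namespace
`…Cruxes.ContinuumLimitOnTrajectory.Disproof.Ultralocal`) so that it elaborates independently of them.

GEN 3 (cycle 3, 2026-08-16, `refuter-cdisprove-stmt-QuantumFields-10522-g3-0`): §4–§7 above
(section `Gen3`; it imports the landed `Negative.UltralocalNoLimit` for `T1/T2/toOne/…` and the
sibling crux (B)'s `Negative.ZeroCoupling` for `two_le_of_shape`). Attacks this cycle and outcomes: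
(a) instance audit — `IsSimpleCompactGroup SU(2)` is PROVED in the tree, so every `∀ G` negative
result instantiates; no junk `G` (a `LatticeRep` forces Hausdorff + closed subgroup of `U(N)`);
(b) junk audit of the conclusion — `IsNontrivial` and `IsNonGaussian` are both pinned by the
lattice on `⁰𝒮` real product tensors (a 3-point tensor `f⊗g⊗h ∈ ⁰𝒮` with `f ≠ 0` forces its
2-point sub-tensors off-diagonal), `𝔖₀` is free but harmless; no formal slack found;
(c) rigidity (§4): the renormalisation freedom of the witness is one real sequence `c_k`, fixed
up to sign and `o(1)` by the bare data; `m_k` never enters connected functions; two witnesses are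
proportional on the truncated two-point sector; (d) universality (§5) and isotropy (§7) are
THEOREMS about what (A) asserts, giving renormalisation-free kill targets (I)–(III) of the header;
(e) decorations (§6): `2 ≤ M` redundant, `0 < Δ` is the content switch of (gap);
(f) literature sweep for negative results in print (non-unique / anisotropic 4-d non-abelian
continuum limits, RG limit cycles): `lit search` rc 75 (searchd down) at 00:35Z — degraded, to
be re-run; nothing new relative to gen 1's zbMATH pass (Patrascioiu–Seiler would make (A)
VACUOUS, not false).

LANDED (gen 3, 2026-08-16), all under `Theorems/ContinuumLimitOnTrajectory/Negative/`, namespace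
`Summit.QuantumFields.YangMills.Theorems.ContinuumLimitOnTrajectory.Negative`: `WitnessRigidity` (p73161,
commit 89c832de3396: §4), `PinnedSector` (p73527, 5f786d237bf9: §4 converse + §7 lemma level),
`Interleaving` (p73163, 4a11d1b92b4e: §5 machinery), `ThreePoint` (p73530, 59a4ec13c0c7: §8 lemma level),
`NecessaryConditions` (p74040, d8016d2ddc26: crux-level necessary conditions I–IV with the hypothesis block
inlined, `hasLatticeMassGap_of_nonpos`). This work file keeps `Hyp`/`Concl` bundles and its own copies. -/

end Summit.QuantumFields.YangMills.Cruxes.ContinuumLimitOnTrajectory.Disproof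

end
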